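import Summits.Schanuel.Schanuel.Theses.RoyCriterion
import Literature.NumberTheory.Transcendental.RoySmallValueMain
import Literature.NumberTheory.Transcendental.RoySmallValueRoyD
import Mathlib.NumberTheory.Transcendental.Liouville.Basic

/-!
# Disproof of `RoySmallValueDirichletGap` (crux `stmt-Schanuel-1050`) — standing adversary file

Crux (route `RoyCriterion`, decl `Summit.Schanuel.Schanuel.Theses.RoyCriterion.RoySmallValueDirichletGap`):
Roy 2013 (Mathematika 59 = arXiv:1301.0663), Theorem 1.1, with the lower bound on `ν` pushed down to
the Dirichlet exponent: `(ξ, η) ∈ ℂ × ℂˣ`, `1 ≤ τ < 2`, `β > τ`, `ν > 2 + β − τ`; if for every large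
`D` there is `0 ≠ P_D ∈ ℤ[X₁, X₂]`, `deg ≤ D`, height `≤ exp(D^β)`, with
`|𝒟₁ⁱ P_D(ξ, η)| ≤ exp(−D^ν)` for `0 ≤ i < 3⌊D^τ⌋` (`𝒟₁ = ∂/∂X₁ + X₂ ∂/∂X₂ = royD`), then
`ξ, η ∈ ℚ̄`.

## Findings (this file; everything outside `-- Near-misses` is sorry-free)

* §0 READ-BACK / OPEN CONTENT. `crux_iff` (the body, `Iff.rfl`), `crux_implies_print`
  (item ⟹ Roy's printed Theorem 1.1), and **`crux_iff_gapCase`**: since Roy 2013 Thm 1.1 is a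
  THEOREM in tree (`roy2013_thm_1_1_holds`, axioms standard), the crux is EQUIVALENT to its
  restriction to `1 < τ < 2` and `2 + β − τ < ν ≤ 2 + β − τ + (τ−1)(2−τ)/(β+1−τ)` (a window of
  width `≤ 1/4`); `crux_iff_nearEdge`: moreover WLOG `ν` is as close to the Dirichlet edge as one
  likes (the hypothesis is antitone in `ν`).
* §1 MONOTONICITY of the small-value hypothesis in the count, in `ν`, in `β`, in `τ`.
* §2 LOAD-BEARING HYPOTHESES (`theorem crux_false_without_…`): `η ≠ 0` (witness `(e, 0)`,
  `P_D = X₂`); `1 ≤ τ` — in fact EVERY slice `τ < 1` is false (witness `(e, 1)`,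
  `P_D = (X₂ − 1)^{3⌊D^τ⌋}`, exact `𝒟₁`-vanishing: an elementary substitute for the
  Khintchine–Philippon points of Roy 2013 p. 4); `2 + β − τ < ν` and `τ < β` (junk regimes
  `ν = 0`, resp. `β = −5, ν = −1`, at `(0, e⁻¹)` with `P_D = X₂` — the honest boundary for `ν` is
  the Dirichlet edge itself, §4); `P ≠ 0`.
* §3 NATURAL STRENGTHENINGS REFUTED: any variant whose derivative COUNT is eventually `≤ D` at
  some admissible `τ` is false (`not_cruxC_of_count_le_degree`; e.g. the unit count `⌊D^τ⌋` at
  `τ = 1`, `not_cruxWithUnitCount`). The mechanism (exact vanishing of `z ↦ P(ξ+z, ηe^z)` at a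
  point with a transcendental coordinate) is CAPPED at order `D = deg P` (docstring of
  `not_cruxC_of_count_le_degree`), so Roy's factor `3` (indeed any count `> D`) is out of its reach.
* §4 TIGHTNESS — THE DIRICHLET EDGE, kernel-checked (`dirichletEdge`): for EVERY `(ξ, η) ∈ ℂ²`,
  `1 ≤ τ < 2`, `β > τ` and every `ν < 2 + β − τ` the hypothesis holds (Dirichlet's box principle,
  Roy 2013 p. 3, with Cauchy's estimate for the `𝒟₁`-Taylor coefficients); so the crux's
  threshold cannot be lowered at all (`crux_slice_false_below_edge`, `not_cruxWithEdgeLowered`),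
  and the crux asserts a genuine threshold phenomenon at `ν = 2 + β − τ` at transcendental points.
* §5 NON-VACUITY IN THE WINDOW — THUE–SIEGEL, kernel-checked (`smallValueHyp_zero_rat`,
  `crux_hypothesis_satisfiable`): at every rational point `(0, p/q)` the hypothesis holds with EXACT
  zeros for `0 ≤ τ < 2`, `β > max{1, 2τ−2}` and every `ν` (Siegel's lemma on the integer
  `𝒟₁`-Taylor matrix at `(0,1)` + the rescaling `P(z,(p/q)e^z) = p^H Q(z,e^z)`); this is also the
  engine of §6.
* §6 UNIFORMITY IN `D` IS LOAD-BEARING, kernel-checked (`not_cruxFrequently`): the variant of the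
  crux with the hypothesis required only for INFINITELY MANY `D` (`∃ᶠ D` in place of `∀ᶠ D`) is
  FALSE — witness `(0, η∞)`, `η∞ = ∑ₙ 2^{−2^{4ⁿ}}` (transcendental, `transcendental_eta`), parameters
  `τ = 3/2, β = 2, ν = 13/5` strictly INSIDE the gap `(5/2, 8/3]`; indeed `frequently_hyp_at_eta`
  gives the `∃ᶠ`-hypothesis there for EVERY `ν < 4`, so also the `∃ᶠ`-variant of Roy's PRINTED
  theorem is false (`not_printFrequently`, `ν = 3`). So every proof of the crux must use the
  hypothesis at (essentially) consecutive scales, as Roy's descent (`D* < D`) does — no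
  scale-by-scale argument can work; dually, a refutation must defeat the coupling between
  consecutive `D`, which is exactly the transcendence-measure obstruction below.
* §7 THE DERIVATION IS LOAD-BEARING, kernel-checked (`not_cruxWithOp_dX1`, `_x2dX2`, `_dX1dX2`,
  `_euler`, `_euler12`; criterion `not_cruxWithOp_of_darboux`): replace `𝒟₁` by any generator of
  a one-parameter subgroup with an ALGEBRAIC first integral — the coordinate directions `∂/∂X₁`,
  `X₂∂/∂X₂` of `𝔾ₐ × 𝔾ₘ`, the diagonal of `𝔾ₐ²`, the diagonal and the `(t, t²)` direction of
  `𝔾ₘ²` — and the analogue of the crux (same degrees, heights, count `3⌊D^τ⌋`, exponents) is FALSE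
  in EVERY parameter slice, by a height-1 Darboux polynomial (`ΔP₀ = cP₀`) through a point
  `∉ ℚ̄²`.  For `𝒟₁` the Darboux polynomials are the `aX₂ᵏ` only, zero set `{η = 0}`
  (`royD_darboux`, `smallValueHypOp_royD_eta_zero`; CLASSIFICATION `eq_C_mul_X_pow_of_darboux`,
  `eta_eq_zero_of_darboux_root`, via the coefficient formula `coeff_royD`): the hypothesis `η ≠ 0`
  is precisely the Darboux exclusion, and nothing else in the statement is "general position".  What a proof must
  use is that every admissible `𝒟₁`-leaf `{X₂e^{−X₁} = θ}`, `θ ≠ 0`, is a transcendental curve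
  carrying at most one algebraic point (Hermite–Lindemann) — the role of `dist(α, A_γ)` in Roy's
  §4 and of the leaf terms in the registered line's `leafCloseness`.
* §8 POLYNOMIAL WINDOWS OF SCALES DO NOT SUFFICE, kernel-checked (`frequently_window_hyp_at_eta`,
  `not_cruxOnWindows`, `roy2013_thm_1_1_false_on_windows`): at `(0, η∞)` ONE rational base point
  serves every level of `[N, N^λ]` (`τ = 3/2`, `β = 2`, any `ν` with `λν < 4`, `λ < 2`), so the
  variant of the crux with the hypothesis on windows `[N, N^λ]` for infinitely many `N` is FALSE
  for every `λ < 3/2` (and the windowed printed theorem for `λ < 4/3`); §8b SHARPENS this with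
  Siegel's exponent (kernel taken at `(0, p/q)` directly, `exists_scaled_taylor_kernel`): windows of
  ratio `6/ν`, so `CruxOnWindows λ` is false for `0 ≤ λ < 23/10` (`not_cruxOnWindows'`) and the
  windowed printed theorem for `0 ≤ λ < 2` — a proof must couple `D` to levels below `D^{10/23}`.
  Docstring of §8: the service window of a rational base point and the universal GAP of exponent
  ratio `ν/(β+1−τ)` between consecutive convergents (paper).
* `-- Targets`: payload `stuck_stubs = []` (lead not yet cycling).  Registered skeleton (2026-08-16):
  `Lines/two-sided-absorption-transfer.lean`, stubs `stub_enemyLinks`, `stub_twoSidedAbsorption`,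
  `stub_royRegime`, `stub_tangentialTowerEmptiness`.  Cheap-attack census of the four stubs (this
  cycle, paper + reading of the tree proof; no kill): (i) `stub_royRegime` IS the algebra of Roy's
  Step 5 on the `IsLink` clauses — from mass + Step-4 (applied to `𝒰'`/`𝒰''`) + sizes one gets
  `D^δ(D^β n + D h) ≤ 3C²(D/D*)^τ((D*)^β n + D* h)`, whence (ii) `D* ≤ (3C²)^{1/(τ−1)}D^{1−δ/(τ−1)}`
  and (i) `D^{β+δ−τ} ≤ 6C³(D*)^{2+β−2τ}`, contradictory iff `δ(β+1−τ) > (τ−1)(2−τ)` — exactly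
  `δ > δ_R`; it holds for EVERY `(ξ, η)` (algebraic or not), no junk escape (`T* ≥ 1` because
  `D* ≥ 1`; `log pdist < 0` on `𝒰`; the `adist = 0` branch of `leafCloseness` is the `T·log pdist`
  branch, for which the transfer factor `T/T*` is exact).  (ii) In the tree proof
  `Roy2013.roy2013_thm_1_1_holds` (RoySmallValueMain.lean) the hypothesis `δ > δ_R` (`hδfrac`,
  l. 82) is consumed ONLY by `endgame` (l. 207); Steps 1–4 and all thresholds use `δ > 0`, `ν > 2`,
  `ν > 2+β−τ` — so `stub_enemyLinks` is Roy-minus-endgame as the planner says (risk = constants /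
  currency bridge only).  (iii) `IsLink` has no cheap inhabitant: a single near conjugate on the
  `log adist` branch can never satisfy mass (depth `T`) and the Step-4 floor (depth `T*`) together
  (no `T/T*` gain on that branch: `M ≤ M*` would force `D^δ ≤ C²`); rational/Hermite–Padé points
  near the leaf reach closeness `≈ h`, the mass clause wants `≳ D^{β+δ}n/C ≫ h`; so stubs 2–4 are
  immune to small-model refutation and `stub_twoSidedAbsorption` is vacuous for `δ > δ_R` at large
  `D` (there `IsLink` is self-contradictory), in particular in the regime `δ ≥ τ − 1` where its
  two-sided range would otherwise reach bounded levels (`Absorbs … 1 a` pins `a` to a hyperplane).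
  (iv) `Absorbs … 0 a` is FALSE for every `a` (`R = 1` is in `royBody 0 …`), harmless because the
  range's lower end `D^{1−δ/(τ−1)}/c` is `> 0`.  (v) The tree's `Roy2013.endgame` consumes data
  with `Ds ≤ D` and builds them for EVERY `D ≥ max(D₃, D₁+2)` (callback `fun Nr => …`,
  `D = max ⌈Nr⌉ …`), so `HasLinks`' `∀ᶠ D` is faithful; but `IsLink` asks `Ds < D` STRICTLY — the
  lead must take `Z` inside the zero locus of the level-`D` family (Roy Step 2) or relax to `≤`.
  (vi) `Roy2013.step4_orbit` needs `0 < pdist` at the points of `𝒮` (automatic when `γ ∉ ℚ̄²`)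
  and the bigness condition `log 2 + 2c₂² − U* < −(D* h + |O|(D* log 3 + Y*))` (Roy's (7.1)),
  which is where the Step-3 size bounds enter; the `b j` slot of `step4_orbit` matches the
  `if 0 < adist then log adist else T·log pdist` branch of `leafCloseness`.
* WHY IT RESISTS (bottom docblock): every counterexample mechanism we know funnels into
  "a transcendental point whose `𝒟₁`-LEAF `{X₂ e^{−X₁} = η e^{−ξ}}` passes within `exp(−2D^ν)` of an
  algebraic point of size `deg·log-height ≲ D^{β+1−τ}` at every scale", which `ν > β + 2 − τ`
  turns into a demand for near-violations of transcendence measures for `e^α` (`α ∈ ℚ̄`), i.e.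
  nothing constructible; approximation of the POINT itself by algebraic points caps at
  `ν ≤ 3 + β − 2τ` (enters the window iff `τ < 1`); powers/products are superadditive and exact
  vanishing caps at order `D`.

Previous generation (refuter-cdisprove-stmt-Schanuel-1050-0, evidence `Disproof.lean` v1–v3 on the
item, NOT readable from this seat's jail and never written to the tree) had also kernel-checked the
Dirichlet edge (rebuilt here, §4) and Thue–Siegel non-vacuity at `(0,1)` (rebuilt and extended to
`(0, p/q)`, §5); §6 is NEW. Def-free copies of §2–§6 are LANDED (all accepted) under
`Theorems/RoySmallValueDirichletGap/Negative/`: `EtaNeZeroFalse` (p69550),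
`TauLtOneAndCountLeDegreeFalse` (p69579), `GapReduction` (p69593), `DirichletEdgeBoxLemmas` (p70166),
`DirichletEdge` (p70664), `ThueSiegelNonVacuity` (p70705), `FrequentlyFalseLiouville` (p71316),
`FrequentlyFalse` (p71675) — lines, ideators and provers may import them
(`import Summits.Schanuel.Schanuel.Theorems.RoySmallValueDirichletGap.Negative.<Name>`).

## WHY IT RESISTS (numbers; the negative side's census)

Write `h` for the naive log-height and `d` for the degree of an algebraic base point, `S` for a
scale `D`. (1) EXACT vanishing at a point with a transcendental coordinate caps at order `D` (§3),
useless against `3⌊D^τ⌋`, `τ ≥ 1`. (2) Approximating the POINT by algebraic points `P_n`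
(`deg d_n`, `h_n`): the Thue–Siegel polynomial at `P_n` needs `S ≳ max((6d_n)^{1/(2−τ)},
(12c d_n h_n)^{1/(β+1−τ)})`, the perturbation needs `log(1/|P − P_n|) ≥ 2S_{n+1}^ν`, and Liouville
separation gives `log(1/|P_n − P_{n+1}|) ≲ d_n h_{n+1} + d_{n+1} h_n + O(d_n d_{n+1})`; with
`ν/(2−τ) > 2` the degrees must DECREASE — impossible (§6 is this mechanism with ONE scale per base
point, which is why only `∃ᶠ` survives; gen-1 records the cap `ν ≤ 3+β−2τ` for the `∀ᶠ` version).
(3) LEAF mechanism (the geometry of Roy's §"distance"): `θ = X₂e^{−X₁}` is a first integral of `𝒟₁`,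
each leaf `{θ = c}` carries at most one algebraic point (Hermite–Lindemann), so a counterexample needs
base points only moderately close (`log(1/|z_n|) ~ S^{ν−τ}`) but LEAVES within `ε`,
`log(1/ε) ≥ 2S^ν`, with base-point size `d h ≲ S^{β+1−τ}`: i.e. `log(1/|η_{n+1} − η_n e^{α}|) ≥ (dh)^κ`,
`κ = ν/(β+1−τ) > 1 + 1/(β+1−τ)` — an algebraic approximation to `e^α` (`α = ξ_{n+1}−ξ_n ∈ ℚ̄`) far
beyond Dirichlet/Wirsing quality `(d+1)h`, contradicting Lang–Waldschmidt-type expectations; Baker's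
product-of-heights lower bounds do NOT exclude it (feasible iff `ν ≤ 2(β+1−τ)`, true near the edge),
so neither a construction nor an unconditional impossibility is available: the crux in the gap is
tied to (non-)existence of abnormally good algebraic approximations to values of `exp` at algebraic
points. (4) Points on algebraic leaves `(α+t, γe^t)`: structured constructions reach smallness
exponent `min(2, 1+β/2) < 2 < ν`. (5) Powers/products: smallness order is additive and Dirichlet
quality per factor `d·S^{β+1−τ}/6 ≤ S^{2+β−τ}/6` — no gain. (6) No junk handle in the formalisation:
slot order, `‖·‖ = max|coeff|`, total degree, floor and casts are faithful (§0).

ROY'S UN-EXCLUDED SCENARIO (read off arXiv:1301.0663 §7 Step 5, p. 19; what a counterexample must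
realise and what a proof in the gap must exclude). With `ν = 2+β−τ+δ`, Step 5 derives
(i) `D^{δ+β−τ} deg Z ≪ (D*)^{1−τ} h(Z)` and (ii) `(D*)^{τ−1} ≪ D^{τ−δ−1}`, where `Z` is the
zero-dimensional `ℚ`-irreducible set extracted at level `D` and `D* < D` the last level whose
derivatives `𝒟ⁱP̃_{D*}` do not all vanish on `Z`; with `deg Z ≤ 2(D*)^{2−τ}`, `h(Z) ≤ 7(D*)^{1+β−τ}`
(Step 3) these contradict each other exactly when `δ > (τ−1)(2−τ)/(β+1−τ)`. For `δ` inside the gap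
BOTH are consistent, with `D* ≈ D^{1−δ/(τ−1)}`: ONE algebraic configuration `Z` of degree
`≈ (D*)^{2−τ}` and height `≈ (D*)^{1+β−τ}` on which ALL the `𝒟ⁱP̃_{D'}`, `D* < D' ≤ D`, vanish, its
points lying close to the LEAF `A_γ = {(1 : ξ+z : ηe^z)}` (the `𝒰''` alternative of Step 5, where
leaf-distance enters to order 1 while point-distance enters to order `T*`). This is the chained
version of mechanism (3): the base configuration must serve the whole range `[D*, D]` of scales and
then hand over to the next one. §6 shows single links exist (one configuration, one scale, inside the
gap); the hand-over between consecutive configurations is where Liouville/transcendence measures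
bite, for the prover (sharper height of `Z` across the hand-over ⇒ crux) and for the refuter
(abnormally good algebraic approximations to `e^α` ⇒ counterexample) alike.
-/

set_option linter.dupNamespace false

noncomputable section

namespace Summit.Schanuel.Schanuel.Cruxes.RoySmallValueDirichletGap.Disproof

open MvPolynomial Filter Complex
open Literature.NumberTheory.Transcendental
open Summit.Schanuel.Schanuel.Theses.RoyCriterion (RoySmallValueDirichletGap)

/-! ## §0 Read-back and the open content -/

/-- The small-value hypothesis of the crux at the point `(ξ, η)` with height exponent `β`,
smallness exponent `ν` and a general derivative-count function `c : ℕ → ℕ` (the crux has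
`c D = 3⌊D^τ⌋`). [cite: Roy2013, Theorem 1.1 (hypothesis)] -/
def SmallValueHypC (c : ℕ → ℕ) (ξ η : ℂ) (β ν : ℝ) : Prop :=
  ∀ᶠ D : ℕ in atTop, ∃ P : MvPolynomial (Fin 2) ℤ, P ≠ 0 ∧ P.totalDegree ≤ D ∧
    (mvPolyHeight P : ℝ) ≤ Real.exp ((D : ℝ) ^ β) ∧
    ∀ i : ℕ, i < c D → ‖aeval ![ξ, η] (royD^[i] P)‖ ≤ Real.exp (-(D : ℝ) ^ ν)

/-- Roy's count `3⌊D^τ⌋`. [cite: Roy2013, Theorem 1.1] -/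
def royCount (τ : ℝ) (D : ℕ) : ℕ := 3 * ⌊(D : ℝ) ^ τ⌋₊

/-- The crux's small-value hypothesis. [cite: Roy2013, Theorem 1.1 (hypothesis)] -/
def SmallValueHyp (ξ η : ℂ) (β τ ν : ℝ) : Prop := SmallValueHypC (royCount τ) ξ η β ν

/-- Roy's printed correction term `(τ−1)(2−τ)/(β+1−τ)` (the width of the open window).
[cite: Roy2013, Theorem 1.1, (1.1)] -/
def royGap (β τ : ℝ) : ℝ := (τ - 1) * (2 - τ) / (β + 1 - τ)

/-- READ-BACK: the crux, verbatim, in terms of `SmallValueHyp`. -/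
theorem crux_iff : RoySmallValueDirichletGap ↔
    ∀ (ξ η : ℂ), η ≠ 0 → ∀ (β τ ν : ℝ), 1 ≤ τ → τ < 2 → τ < β → 2 + β - τ < ν →
      SmallValueHyp ξ η β τ ν → IsAlgebraic ℚ ξ ∧ IsAlgebraic ℚ η := Iff.rfl

/-- The correction term is nonnegative on Roy's range. -/
theorem royGap_nonneg {β τ : ℝ} (h1 : 1 ≤ τ) (h2 : τ < 2) (hβ : τ < β) : 0 ≤ royGap β τ :=
  div_nonneg (mul_nonneg (by linarith) (by linarith)) (by linarith)

/-- The correction term is at most `(τ−1)(2−τ) ≤ 1/4`. [cite: Roy2013, p. 3] -/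
theorem royGap_le_quarter {β τ : ℝ} (h1 : 1 ≤ τ) (h2 : τ < 2) (hβ : τ < β) : royGap β τ ≤ 1 / 4 := by
  have hden : 1 ≤ β + 1 - τ := by linarith
  have hnum : (τ - 1) * (2 - τ) ≤ 1 / 4 := by nlinarith [sq_nonneg (τ - 3 / 2)]
  have hnum0 : 0 ≤ (τ - 1) * (2 - τ) := mul_nonneg (by linarith) (by linarith)
  calc royGap β τ = (τ - 1) * (2 - τ) / (β + 1 - τ) := rfl
    _ ≤ (τ - 1) * (2 - τ) / 1 := div_le_div_of_nonneg_left hnum0 one_pos hden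
    _ ≤ 1 / 4 := by simpa using hnum

/-- The correction term vanishes at `τ = 1`. -/
@[simp] theorem royGap_one (β : ℝ) : royGap β 1 = 0 := by simp [royGap]

/-- ITEM ⟹ PRINT: the crux implies Roy's printed Theorem 1.1 (whose hypothesis on `ν` is stronger). -/
theorem crux_implies_print (h : RoySmallValueDirichletGap) : roy2013_thm_1_1 := by
  intro ξ η hη β τ ν h1 h2 hβ hν hP
  exact h ξ η hη β τ ν h1 h2 hβ (by have := royGap_nonneg h1 h2 hβ; unfold royGap at this; linarith) hP

/-- The GAP CASE: the crux restricted to `1 < τ` and `ν` inside the half-open window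
`(2 + β − τ, 2 + β − τ + (τ−1)(2−τ)/(β+1−τ)]`. -/
def GapCase : Prop :=
  ∀ (ξ η : ℂ), η ≠ 0 → ∀ (β τ ν : ℝ), 1 < τ → τ < 2 → τ < β → 2 + β - τ < ν →
    ν ≤ 2 + β - τ + royGap β τ → SmallValueHyp ξ η β τ ν → IsAlgebraic ℚ ξ ∧ IsAlgebraic ℚ η

/-- **OPEN CONTENT = THE GAP CASE.** Because Roy's Theorem 1.1 is proved in tree
(`roy2013_thm_1_1_holds`), the crux is equivalent to its restriction to `1 < τ < 2`,
`2 + β − τ < ν ≤ 2 + β − τ + (τ−1)(2−τ)/(β+1−τ)`. [cite: Roy2013, Theorem 1.1] -/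
theorem crux_iff_gapCase : RoySmallValueDirichletGap ↔ GapCase := by
  constructor
  · intro h ξ η hη β τ ν h1 h2 hβ hν _ hP
    exact h ξ η hη β τ ν h1.le h2 hβ hν hP
  · intro h ξ η hη β τ ν h1 h2 hβ hν hP
    rcases lt_or_ge (2 + β - τ + royGap β τ) ν with hlt | hle
    · exact roy2013_thm_1_1_holds ξ η hη β τ ν h1 h2 hβ hlt hP
    · have h1' : 1 < τ := by
        rcases h1.lt_or_eq with h | h
        · exact h
        · exfalso; subst h; simp at hle; linarith
      exact h ξ η hη β τ ν h1' h2 hβ hν hle hP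

/-! ## §1 Monotonicity of the hypothesis -/

/-- Fewer derivative conditions is weaker. -/
theorem SmallValueHypC.mono_count {c c' : ℕ → ℕ} {ξ η : ℂ} {β ν : ℝ}
    (hcc : ∀ᶠ D in atTop, c' D ≤ c D) (h : SmallValueHypC c ξ η β ν) : SmallValueHypC c' ξ η β ν := by
  filter_upwards [h, hcc] with D hD hle
  obtain ⟨P, hP0, hdeg, hht, hval⟩ := hD
  exact ⟨P, hP0, hdeg, hht, fun i hi => hval i (lt_of_lt_of_le hi hle)⟩

/-- A smaller smallness exponent is weaker. -/
theorem SmallValueHypC.anti_nu {c : ℕ → ℕ} {ξ η : ℂ} {β ν ν' : ℝ} (hν : ν' ≤ ν)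
    (h : SmallValueHypC c ξ η β ν) : SmallValueHypC c ξ η β ν' := by
  filter_upwards [h, eventually_ge_atTop 1] with D hD hD1
  obtain ⟨P, hP0, hdeg, hht, hval⟩ := hD
  refine ⟨P, hP0, hdeg, hht, fun i hi => (hval i hi).trans ?_⟩
  have h1 : (1 : ℝ) ≤ D := by exact_mod_cast hD1
  exact Real.exp_le_exp.2 (neg_le_neg (Real.rpow_le_rpow_of_exponent_le h1 hν))

/-- A larger height exponent is weaker. -/
theorem SmallValueHypC.mono_beta {c : ℕ → ℕ} {ξ η : ℂ} {β β' ν : ℝ} (hβ : β ≤ β')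
    (h : SmallValueHypC c ξ η β ν) : SmallValueHypC c ξ η β' ν := by
  filter_upwards [h, eventually_ge_atTop 1] with D hD hD1
  obtain ⟨P, hP0, hdeg, hht, hval⟩ := hD
  refine ⟨P, hP0, hdeg, hht.trans ?_, hval⟩
  have h1 : (1 : ℝ) ≤ D := by exact_mod_cast hD1
  exact Real.exp_le_exp.2 (Real.rpow_le_rpow_of_exponent_le h1 hβ)

/-- Roy's count is monotone in `τ` (for `D ≥ 1`). -/
theorem royCount_mono {τ τ' : ℝ} (h : τ' ≤ τ) {D : ℕ} (hD : 1 ≤ D) : royCount τ' D ≤ royCount τ D := by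
  unfold royCount
  have h1 : (1 : ℝ) ≤ D := by exact_mod_cast hD
  exact Nat.mul_le_mul_left 3 (Nat.floor_le_floor (Real.rpow_le_rpow_of_exponent_le h1 h))

/-- A smaller `τ` is weaker. -/
theorem SmallValueHyp.anti_tau {ξ η : ℂ} {β τ τ' ν : ℝ} (hτ : τ' ≤ τ)
    (h : SmallValueHyp ξ η β τ ν) : SmallValueHyp ξ η β τ' ν :=
  SmallValueHypC.mono_count (by filter_upwards [eventually_ge_atTop 1] with D hD using royCount_mono hτ hD) h

/-- The crux restricted to `ν` within `ε` of the Dirichlet edge. -/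
def NearEdge (ε : ℝ) : Prop :=
  ∀ (ξ η : ℂ), η ≠ 0 → ∀ (β τ ν : ℝ), 1 ≤ τ → τ < 2 → τ < β → 2 + β - τ < ν → ν ≤ 2 + β - τ + ε →
    SmallValueHyp ξ η β τ ν → IsAlgebraic ℚ ξ ∧ IsAlgebraic ℚ η

/-- **WLOG `ν` is as close to the edge as we please**: for every `ε > 0` the crux is equivalent to
its restriction to `2 + β − τ < ν ≤ 2 + β − τ + ε` (antitonicity in `ν`). So the "hardest corner"
`ν ↓ 2 + β − τ` is the whole problem. -/
theorem crux_iff_nearEdge {ε : ℝ} (hε : 0 < ε) : RoySmallValueDirichletGap ↔ NearEdge ε := by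
  constructor
  · intro h ξ η hη β τ ν h1 h2 hβ hν _ hP
    exact h ξ η hη β τ ν h1 h2 hβ hν hP
  · intro h ξ η hη β τ ν h1 h2 hβ hν hP
    rcases le_or_gt ν (2 + β - τ + ε) with hle | hlt
    · exact h ξ η hη β τ ν h1 h2 hβ hν hle hP
    · exact h ξ η hη β τ (2 + β - τ + ε) h1 h2 hβ (by linarith) le_rfl
        (SmallValueHypC.anti_nu hlt.le hP)

/-! ## Toolbox: `royD` on the witnesses `X₂` and `(X₂ − 1)^n` -/

/-- `𝒟₁` is `ℤ`-linear: subtraction. -/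
theorem royD_sub (P Q : MvPolynomial (Fin 2) ℤ) : royD (P - Q) = royD P - royD Q := by
  simp only [royD, map_sub]; ring

/-- `𝒟₁ⁱ 0 = 0`. -/
theorem iterate_royD_zero (i : ℕ) : royD^[i] (0 : MvPolynomial (Fin 2) ℤ) = 0 :=
  Function.iterate_fixed royD_zero i

/-- `𝒟₁ⁱ X₂ = X₂` (the multiplicative coordinate is an eigenvector). -/
theorem iterate_royD_X_one (i : ℕ) : royD^[i] (X 1 : MvPolynomial (Fin 2) ℤ) = X 1 :=
  Function.iterate_fixed royD_X_one i

/-- `𝒟₁ (X₂ − 1) = X₂`. -/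
theorem royD_X_one_sub_one : royD (X 1 - 1 : MvPolynomial (Fin 2) ℤ) = X 1 := by
  rw [royD_sub, royD_X_one, show (1 : MvPolynomial (Fin 2) ℤ) = C 1 from rfl, royD_C, sub_zero]

/-- Power rule for the derivation `𝒟₁`. -/
theorem royD_pow_succ (P : MvPolynomial (Fin 2) ℤ) (n : ℕ) :
    royD (P ^ (n + 1)) = C ((n : ℤ) + 1) * P ^ n * royD P := by
  induction n with
  | zero => simp
  | succ n ih =>
    rw [pow_succ, royD_mul, ih]
    simp only [map_add, map_one, pow_succ, Nat.cast_succ, map_natCast]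
    ring

/-- **`(X₂ − 1)^{n−i} ∣ 𝒟₁ⁱ ((X₂ − 1)ⁿ R)`** for `i ≤ n`: exact `𝒟₁`-vanishing to order `n` at every
point `(ξ, 1)`. -/
theorem pow_dvd_iterate_royD (i : ℕ) : ∀ (n : ℕ) (R : MvPolynomial (Fin 2) ℤ), i ≤ n →
    (X 1 - 1) ^ (n - i) ∣ royD^[i] ((X 1 - 1) ^ n * R) := by
  induction i with
  | zero => intro n R _; exact ⟨R, by simp⟩
  | succ i ih =>
    intro n R hin
    obtain ⟨m, rfl⟩ : ∃ m, n = m + 1 := ⟨n - 1, by omega⟩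
    rw [Function.iterate_succ_apply, royD_mul, royD_pow_succ, royD_X_one_sub_one]
    have hrw : C ((m : ℤ) + 1) * (X 1 - 1) ^ m * X 1 * R + (X 1 - 1) ^ (m + 1) * royD R =
        (X 1 - 1) ^ m * (C ((m : ℤ) + 1) * X 1 * R + (X 1 - 1) * royD R) := by ring
    rw [hrw, show m + 1 - (i + 1) = m - i by omega]
    exact ih m _ (by omega)

/-- Hence `𝒟₁ⁱ (X₂ − 1)ⁿ` vanishes at `(ξ, 1)` for `i < n`. -/
theorem aeval_iterate_royD_pow_eq_zero (ξ : ℂ) {i n : ℕ} (hin : i < n) :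
    aeval ![ξ, 1] (royD^[i] ((X 1 - 1 : MvPolynomial (Fin 2) ℤ) ^ n)) = 0 := by
  obtain ⟨S, hS⟩ := pow_dvd_iterate_royD i n 1 hin.le
  rw [mul_one] at hS
  rw [hS, map_mul, map_pow]
  have h0 : aeval ![ξ, (1 : ℂ)] (X 1 - 1 : MvPolynomial (Fin 2) ℤ) = 0 := by simp
  rw [h0, zero_pow (by omega), zero_mul]

/-- `X₂ − 1 ≠ 0`. -/
theorem X_one_sub_one_ne_zero : (X 1 - 1 : MvPolynomial (Fin 2) ℤ) ≠ 0 := by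
  intro h
  have := congrArg (MvPolynomial.eval (0 : Fin 2 → ℤ)) h
  simp at this

/-- `deg (X₂ − 1)ⁿ ≤ n`. -/
theorem totalDegree_pow_X_one_sub_one_le (n : ℕ) :
    ((X 1 - 1 : MvPolynomial (Fin 2) ℤ) ^ n).totalDegree ≤ n := by
  refine (totalDegree_pow _ _).trans ?_
  have h : (X 1 - 1 : MvPolynomial (Fin 2) ℤ).totalDegree ≤ 1 := by
    refine (totalDegree_sub _ _).trans ?_
    simp [totalDegree_X]
  calc n * (X 1 - 1 : MvPolynomial (Fin 2) ℤ).totalDegree ≤ n * 1 := Nat.mul_le_mul_left n h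
    _ = n := mul_one n

/-- A coefficientwise bound gives a height bound. -/
theorem mvPolyHeight_le_of_forall {σ : Type*} (P : MvPolynomial σ ℤ) {B : ℕ}
    (h : ∀ m, (P.coeff m).natAbs ≤ B) : mvPolyHeight P ≤ B :=
  Finset.sup_le fun m _ => h m

/-- Height of `(X₂ − 1)ⁿ` is at most `2ⁿ` (sum of the binomial coefficients). -/
theorem mvPolyHeight_pow_X_one_sub_one_le (n : ℕ) :
    mvPolyHeight ((X 1 - 1 : MvPolynomial (Fin 2) ℤ) ^ n) ≤ 2 ^ n := by
  apply mvPolyHeight_le_of_forall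
  intro m
  have hexp : (X 1 - 1 : MvPolynomial (Fin 2) ℤ) ^ n =
      ∑ k ∈ Finset.range (n + 1), monomial (Finsupp.single 1 k) ((-1) ^ (n - k) * (n.choose k : ℤ)) := by
    rw [sub_eq_add_neg, add_pow]
    refine Finset.sum_congr rfl fun k _ => ?_
    rw [← C_mul_X_pow_eq_monomial, map_mul, map_pow, map_neg, map_one, map_natCast]
    ring
  rw [hexp, coeff_sum, ← Nat.sum_range_choose n]
  refine (Int.natAbs_sum_le _ _).trans (Finset.sum_le_sum fun k _ => ?_)
  rw [coeff_monomial]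
  split_ifs
  · simp [Int.natAbs_mul, Int.natAbs_pow]
  · simp

/-- Height of `X₂` is `≤ 1`. -/
theorem mvPolyHeight_X_one_le : mvPolyHeight (X 1 : MvPolynomial (Fin 2) ℤ) ≤ 1 := by
  apply mvPolyHeight_le_of_forall
  intro m
  rw [coeff_X]
  split_ifs <;> simp

/-! ## Toolbox: eventual inequalities in `D` -/

/-- `C·D^a ≤ D^b` eventually in `D : ℕ`, for `a < b`. -/
theorem eventually_nat_mul_rpow_le_rpow (C : ℝ) {a b : ℝ} (hab : a < b) :
    ∀ᶠ D : ℕ in atTop, C * (D : ℝ) ^ a ≤ (D : ℝ) ^ b := by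
  have h := eventually_mul_rpow_le_mul_rpow C hab one_pos
  simp only [one_mul] at h
  exact tendsto_natCast_atTop_atTop.eventually h

/-- For `τ < 1`, Roy's count is eventually within the degree budget: `3⌊D^τ⌋ ≤ D`. -/
theorem eventually_royCount_le_self {τ : ℝ} (hτ : τ < 1) : ∀ᶠ D : ℕ in atTop, royCount τ D ≤ D := by
  filter_upwards [eventually_nat_mul_rpow_le_rpow 3 hτ] with D hD
  have h0 : (0 : ℝ) ≤ (D : ℝ) ^ τ := Real.rpow_nonneg (Nat.cast_nonneg D) τ
  have h1 : ((royCount τ D : ℕ) : ℝ) ≤ D := by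
    unfold royCount
    push_cast
    calc (3 : ℝ) * ⌊(D : ℝ) ^ τ⌋₊ ≤ 3 * (D : ℝ) ^ τ := by gcongr; exact Nat.floor_le h0
      _ ≤ (D : ℝ) ^ (1 : ℝ) := hD
      _ = D := Real.rpow_one _
  exact_mod_cast h1

/-- For `τ < β`, the height of the witness `(X₂−1)^{3⌊D^τ⌋}` is eventually within budget:
`3⌊D^τ⌋ · log 2 ≤ D^β`. -/
theorem eventually_royCount_log_two_le {τ β : ℝ} (hτβ : τ < β) :
    ∀ᶠ D : ℕ in atTop, (royCount τ D : ℝ) * Real.log 2 ≤ (D : ℝ) ^ β := by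
  filter_upwards [eventually_nat_mul_rpow_le_rpow (3 * Real.log 2) hτβ] with D hD
  have h0 : (0 : ℝ) ≤ (D : ℝ) ^ τ := Real.rpow_nonneg (Nat.cast_nonneg D) τ
  have hl : 0 ≤ Real.log 2 := Real.log_nonneg one_le_two
  unfold royCount
  push_cast
  calc 3 * (⌊(D : ℝ) ^ τ⌋₊ : ℝ) * Real.log 2 ≤ 3 * (D : ℝ) ^ τ * Real.log 2 := by
        gcongr; exact Nat.floor_le h0
    _ = 3 * Real.log 2 * (D : ℝ) ^ τ := by ring
    _ ≤ (D : ℝ) ^ β := hD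

/-- For `1 ≤ β`, `D · log 2 ≤ D^β` for `D ≥ 1`... eventually. -/
theorem eventually_self_log_two_le {β : ℝ} (hβ : 1 ≤ β) :
    ∀ᶠ D : ℕ in atTop, (D : ℝ) * Real.log 2 ≤ (D : ℝ) ^ β := by
  filter_upwards [eventually_ge_atTop 1] with D hD
  have h1 : (1 : ℝ) ≤ D := by exact_mod_cast hD
  have hl : Real.log 2 ≤ 1 := by
    have := Real.log_two_lt_d9; linarith
  calc (D : ℝ) * Real.log 2 ≤ (D : ℝ) * 1 := by gcongr
    _ = (D : ℝ) ^ (1 : ℝ) := by simp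
    _ ≤ (D : ℝ) ^ β := Real.rpow_le_rpow_of_exponent_le h1 hβ

/-! ## Witness families -/

/-- **Witness family A** (points `(ξ, 1)`, exact vanishing): for ANY point `(ξ, 1)`, any `ν`, and
any count function `c` that is eventually `≤ D` with `c(D)·log 2 ≤ D^β`, the small-value hypothesis
holds, with `P_D = (X₂ − 1)^{c(D)}` and EXACT zeros. -/
theorem smallValueHypC_at_one (ξ : ℂ) {c : ℕ → ℕ} {β : ℝ} (ν : ℝ)
    (hdeg : ∀ᶠ D in atTop, c D ≤ D) (hht : ∀ᶠ D : ℕ in atTop, (c D : ℝ) * Real.log 2 ≤ (D : ℝ) ^ β) :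
    SmallValueHypC c ξ 1 β ν := by
  filter_upwards [hdeg, hht] with D h1 h2
  refine ⟨(X 1 - 1) ^ c D, pow_ne_zero _ X_one_sub_one_ne_zero,
    (totalDegree_pow_X_one_sub_one_le _).trans h1, ?_, fun i hi => ?_⟩
  · calc ((mvPolyHeight ((X 1 - 1 : MvPolynomial (Fin 2) ℤ) ^ c D) : ℕ) : ℝ) ≤ ((2 ^ c D : ℕ) : ℝ) := by
          exact_mod_cast mvPolyHeight_pow_X_one_sub_one_le (c D)
      _ = Real.exp ((c D : ℝ) * Real.log 2) := by
          rw [Real.exp_nat_mul, Real.exp_log two_pos]; push_cast; ring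
      _ ≤ Real.exp ((D : ℝ) ^ β) := Real.exp_le_exp.2 h2
  · rw [aeval_iterate_royD_pow_eq_zero ξ hi, norm_zero]
    exact (Real.exp_pos _).le

/-- **Witness family B** (points `(ξ, 0)`, the `𝒟₁`-invariant line `X₂ = 0`): at ANY point `(ξ, 0)`,
for any count, `β`, `ν`, the hypothesis holds with `P_D = X₂` (all `𝒟₁ⁱX₂ = X₂` vanish there). -/
theorem smallValueHypC_eta_zero (ξ : ℂ) (c : ℕ → ℕ) (β ν : ℝ) : SmallValueHypC c ξ 0 β ν := by
  filter_upwards [eventually_ge_atTop 1] with D hD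
  refine ⟨X 1, X_ne_zero _, by simpa [totalDegree_X] using hD, ?_, fun i _ => ?_⟩
  · calc ((mvPolyHeight (X 1 : MvPolynomial (Fin 2) ℤ) : ℕ) : ℝ) ≤ 1 := by
          exact_mod_cast mvPolyHeight_X_one_le
      _ ≤ Real.exp ((D : ℝ) ^ β) := Real.one_le_exp (Real.rpow_nonneg (Nat.cast_nonneg D) β)
  · rw [iterate_royD_X_one]
    simp [(Real.exp_pos _).le]

/-- **Witness family C** (points `(ξ, η)` with `‖η‖ ≤ exp(−D^ν)` needed for all large `D`, i.e. junk
exponents `ν ≤ 0`): at `(ξ, η)` with `‖η‖ = e^{−1}`, `P_D = X₂` gives `|𝒟₁ⁱP_D(ξ,η)| = e^{−1}`, which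
is `≤ exp(−D^ν)` whenever `D^ν ≤ 1`. -/
theorem smallValueHypC_of_norm_eta {ξ η : ℂ} (hη : ‖η‖ = Real.exp (-1)) (c : ℕ → ℕ) (β : ℝ) {ν : ℝ}
    (hν : ∀ᶠ D : ℕ in atTop, (D : ℝ) ^ ν ≤ 1) : SmallValueHypC c ξ η β ν := by
  filter_upwards [eventually_ge_atTop 1, hν] with D hD hDν
  refine ⟨X 1, X_ne_zero _, by simpa [totalDegree_X] using hD, ?_, fun i _ => ?_⟩
  · calc ((mvPolyHeight (X 1 : MvPolynomial (Fin 2) ℤ) : ℕ) : ℝ) ≤ 1 := by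
          exact_mod_cast mvPolyHeight_X_one_le
      _ ≤ Real.exp ((D : ℝ) ^ β) := Real.one_le_exp (Real.rpow_nonneg (Nat.cast_nonneg D) β)
  · rw [iterate_royD_X_one]
    simpa [hη] using hDν

/-- `e = exp 1` is transcendental (Hermite; in tree via Lindemann–Weierstrass). -/
theorem transcendental_e : ¬ IsAlgebraic ℚ (cexp 1) := transcendental_exp_holds isAlgebraic_one one_ne_zero

/-- `e⁻¹ = exp(−1)` is transcendental. -/
theorem transcendental_expNegOne : ¬ IsAlgebraic ℚ (cexp (-1)) :=
  transcendental_exp_holds isAlgebraic_one.neg (neg_ne_zero.2 one_ne_zero)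

/-- `‖exp(−1)‖ = e^{−1}`. -/
theorem norm_cexp_neg_one : ‖cexp (-1)‖ = Real.exp (-1) := by
  rw [Complex.norm_exp]; simp

/-! ## §2 Load-bearing hypotheses -/

/-- The crux with `η ≠ 0` dropped. -/
def CruxWithoutEtaNeZero : Prop :=
  ∀ (ξ η : ℂ), ∀ (β τ ν : ℝ), 1 ≤ τ → τ < 2 → τ < β → 2 + β - τ < ν →
    SmallValueHyp ξ η β τ ν → IsAlgebraic ℚ ξ ∧ IsAlgebraic ℚ η

/-- **`η ≠ 0` is load-bearing**: on the `𝒟₁`-invariant line `X₂ = 0` the hypothesis holds at every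
point (witness `(e, 0)`, `P_D = X₂`, parameters `(β, τ, ν) = (2, 1, 4)`). -/
theorem crux_false_without_etaNeZero : ¬ CruxWithoutEtaNeZero := fun h =>
  transcendental_e (h (cexp 1) 0 2 1 4 le_rfl (by norm_num) (by norm_num) (by norm_num)
    (smallValueHypC_eta_zero _ _ _ _)).1

/-- The crux with `1 ≤ τ` dropped (every real `τ < 2` allowed). -/
def CruxWithoutOneLeTau : Prop :=
  ∀ (ξ η : ℂ), η ≠ 0 → ∀ (β τ ν : ℝ), τ < 2 → τ < β → 2 + β - τ < ν →
    SmallValueHyp ξ η β τ ν → IsAlgebraic ℚ ξ ∧ IsAlgebraic ℚ η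

/-- **Every slice `τ < 1` is false** (so `1 ≤ τ` is load-bearing, and sharply so): at the point
`(e, 1)`, for EVERY `τ < 1`, every `β > τ` and every `ν`, the hypothesis holds with
`P_D = (X₂ − 1)^{3⌊D^τ⌋}` and exact zeros `𝒟₁ⁱP_D(e, 1) = 0`, `i < 3⌊D^τ⌋` — an elementary
substitute for the Khintchine–Philippon points used on p. 4 of Roy 2013 (which give algebraically
INDEPENDENT `(ξ, η)`; here `η = 1`). [cite: Roy2013, p. 4 (necessity of τ ≥ 1)] -/
theorem smallValueHyp_e_one_of_tau_lt_one {τ β : ℝ} (hτ : τ < 1) (hτβ : τ < β) (ν : ℝ) :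
    SmallValueHyp (cexp 1) 1 β τ ν :=
  smallValueHypC_at_one _ ν (eventually_royCount_le_self hτ) (eventually_royCount_log_two_le hτβ)

/-- The `τ < 1` slices of the crux-shaped implication are all false. -/
theorem crux_slice_false_of_tau_lt_one {τ β : ℝ} (hτ : τ < 1) (hτβ : τ < β) (ν : ℝ) :
    ¬ (∀ (ξ η : ℂ), η ≠ 0 → SmallValueHyp ξ η β τ ν → IsAlgebraic ℚ ξ ∧ IsAlgebraic ℚ η) := fun h =>
  transcendental_e (h (cexp 1) 1 one_ne_zero (smallValueHyp_e_one_of_tau_lt_one hτ hτβ ν)).1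

/-- **`1 ≤ τ` is load-bearing.** (Witness slice `τ = 1/2`, `β = 2`, `ν = 4`.) -/
theorem crux_false_without_oneLeTau : ¬ CruxWithoutOneLeTau := fun h =>
  crux_slice_false_of_tau_lt_one (τ := 1 / 2) (β := 2) (by norm_num) (by norm_num) 4
    fun ξ η hη hP => h ξ η hη 2 (1 / 2) 4 (by norm_num) (by norm_num) (by norm_num) hP

/-- The crux with the lower bound `2 + β − τ < ν` dropped. -/
def CruxWithoutNuBound : Prop :=
  ∀ (ξ η : ℂ), η ≠ 0 → ∀ (β τ ν : ℝ), 1 ≤ τ → τ < 2 → τ < β →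
    SmallValueHyp ξ η β τ ν → IsAlgebraic ℚ ξ ∧ IsAlgebraic ℚ η

/-- **The lower bound on `ν` is load-bearing** (junk witness: `ν = 0`, point `(0, e⁻¹)`, `P_D = X₂`,
`|𝒟₁ⁱX₂(0, e⁻¹)| = e⁻¹ = exp(−D⁰)`). The HONEST boundary is the Dirichlet edge `ν = 2 + β − τ`
(Roy 2013 p. 3: below it the hypothesis holds at every point; kernel-checked by the previous
generation's `dirichletEdge`, to be rebuilt here). [cite: Roy2013, p. 3 (Dirichlet's box principle)] -/
theorem crux_false_without_nuBound : ¬ CruxWithoutNuBound := fun h =>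
  transcendental_expNegOne (h 0 (cexp (-1)) (Complex.exp_ne_zero _) 2 1 0 le_rfl (by norm_num)
    (by norm_num) (smallValueHypC_of_norm_eta norm_cexp_neg_one _ _ (by simp))).2

/-- The crux with `τ < β` dropped. -/
def CruxWithoutTauLtBeta : Prop :=
  ∀ (ξ η : ℂ), η ≠ 0 → ∀ (β τ ν : ℝ), 1 ≤ τ → τ < 2 → 2 + β - τ < ν →
    SmallValueHyp ξ η β τ ν → IsAlgebraic ℚ ξ ∧ IsAlgebraic ℚ η

/-- **`τ < β` cannot simply be dropped** (junk witness: `τ = 1`, `β = −5`, `ν = −1 > 2 + β − τ = −4`,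
point `(0, e⁻¹)`, `P_D = X₂`: `e⁻¹ ≤ exp(−D⁻¹)` for `D ≥ 1`). Inside Roy's range (`β > 0`) we know no
witness: `β > τ` is a construction-side convenience of the printed proof, not a located boundary. -/
theorem crux_false_without_tauLtBeta : ¬ CruxWithoutTauLtBeta := fun h =>
  transcendental_expNegOne (h 0 (cexp (-1)) (Complex.exp_ne_zero _) (-5) 1 (-1) le_rfl (by norm_num)
    (by norm_num) (smallValueHypC_of_norm_eta norm_cexp_neg_one _ _ (by
      filter_upwards [eventually_ge_atTop 1] with D hD
      have h1 : (1 : ℝ) ≤ D := by exact_mod_cast hD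
      rw [Real.rpow_neg_one]
      exact inv_le_one_of_one_le₀ h1))).2

/-- The crux with `P ≠ 0` dropped from the hypothesis. -/
def CruxWithoutPNeZero : Prop :=
  ∀ (ξ η : ℂ), η ≠ 0 → ∀ (β τ ν : ℝ), 1 ≤ τ → τ < 2 → τ < β → 2 + β - τ < ν →
    (∀ᶠ D : ℕ in atTop, ∃ P : MvPolynomial (Fin 2) ℤ, P.totalDegree ≤ D ∧
      (mvPolyHeight P : ℝ) ≤ Real.exp ((D : ℝ) ^ β) ∧
      ∀ i : ℕ, i < royCount τ D → ‖aeval ![ξ, η] (royD^[i] P)‖ ≤ Real.exp (-(D : ℝ) ^ ν)) →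
    IsAlgebraic ℚ ξ ∧ IsAlgebraic ℚ η

/-- **`P ≠ 0` is load-bearing** (`P_D = 0` at `(e, 1)`). -/
theorem crux_false_without_pNeZero : ¬ CruxWithoutPNeZero := fun h =>
  transcendental_e (h (cexp 1) 1 one_ne_zero 2 1 4 le_rfl (by norm_num) (by norm_num) (by norm_num)
    (Eventually.of_forall fun D => ⟨0, by simp, by simp [(Real.exp_pos _).le],
      fun i _ => by simp [iterate_royD_zero, (Real.exp_pos _).le]⟩)).1

/-! ## §3 Natural strengthenings refuted: the derivative count -/

/-- The crux with a general count `c τ D` in place of `3⌊D^τ⌋`. -/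
def CruxC (c : ℝ → ℕ → ℕ) : Prop :=
  ∀ (ξ η : ℂ), η ≠ 0 → ∀ (β τ ν : ℝ), 1 ≤ τ → τ < 2 → τ < β → 2 + β - τ < ν →
    SmallValueHypC (c τ) ξ η β ν → IsAlgebraic ℚ ξ ∧ IsAlgebraic ℚ η

/-- The crux is `CruxC royCount`. -/
theorem crux_iff_cruxC : RoySmallValueDirichletGap ↔ CruxC royCount := Iff.rfl

/-- **Any count that is eventually `≤ D` at some admissible `τ₀ ∈ [1, 2)` makes the statement FALSE**
(witness `(e, 1)`, `P_D = (X₂ − 1)^{c(D)}`, `β = τ₀ + 1`, `ν = 4 + β`). WHY THE MECHANISM STOPS AT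
`D`: if `(ξ, η)` has a transcendental coordinate and `P ∈ ℤ[X₁, X₂]` has `deg P ≤ D`, then
`z ↦ P(ξ + z, η e^z)` vanishes at `0` to order at most `D` unless `P = 0` — its Taylor coefficients
are polynomials over `ℚ` in the transcendental coordinate(s), so exact vanishing is an identity, and
after `w = ξ + z` the function `P(w, η e^z) = ∑_k p_k(w) ηᵏ e^{kz}` is, for fixed `w`, an exponential
polynomial with `≤ D + 1` frequencies (order of vanishing `≤ D`). So Roy's factor `3` in `3⌊D^τ⌋`
(any count exceeding `deg P`) is exactly what defeats exact-vanishing witnesses for `τ ≥ 1`. -/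
theorem not_cruxC_of_count_le_degree {c : ℝ → ℕ → ℕ} {τ₀ : ℝ} (h1 : 1 ≤ τ₀) (h2 : τ₀ < 2)
    (hc : ∀ᶠ D in atTop, c τ₀ D ≤ D) : ¬ CruxC c := by
  intro h
  refine transcendental_e (h (cexp 1) 1 one_ne_zero (τ₀ + 1) τ₀ (4 + (τ₀ + 1)) h1 h2 (by linarith)
    (by linarith) (smallValueHypC_at_one _ _ hc ?_)).1
  filter_upwards [hc, eventually_self_log_two_le (β := τ₀ + 1) (by linarith)] with D hD hD'
  calc (c τ₀ D : ℝ) * Real.log 2 ≤ (D : ℝ) * Real.log 2 :=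
        mul_le_mul_of_nonneg_right (by exact_mod_cast hD) (Real.log_nonneg one_le_two)
    _ ≤ (D : ℝ) ^ (τ₀ + 1) := hD'

/-- The unit count `⌊D^τ⌋`. -/
def unitCount (τ : ℝ) (D : ℕ) : ℕ := ⌊(D : ℝ) ^ τ⌋₊

/-- **The unit-count variant (`⌊D^τ⌋` conditions instead of `3⌊D^τ⌋`) is FALSE**, already at
`τ = 1` (there `⌊D¹⌋ = D ≤ D`). -/
theorem not_cruxWithUnitCount : ¬ CruxC unitCount :=
  not_cruxC_of_count_le_degree (τ₀ := 1) le_rfl (by norm_num)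
    (Eventually.of_forall fun D => by simp [unitCount])

/-- Likewise any count `⌊D^τ⌋ + k₀·0`-type variant bounded by the degree, e.g. `min (3⌊D^τ⌋) D`. -/
theorem not_cruxWithCappedCount : ¬ CruxC (fun τ D => min (royCount τ D) D) :=
  not_cruxC_of_count_le_degree (τ₀ := 1) le_rfl (by norm_num)
    (Eventually.of_forall fun D => min_le_right _ _)


/-! ## §4 Tightness: the Dirichlet edge (Roy 2013 p. 3), kernel-checked

Dirichlet's box principle: coefficient vectors `c : {0..H}² → {0..A}` (`H = ⌊D/2⌋`, `A = ⌊e^{D^β}⌋`) of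
`P_c = ∑ c_{ab} X₁ᵃX₂ᵇ`; the values `vᵢ(c) = 𝒟₁ⁱP_c(ξ, η)`, `i < M = 3⌊D^τ⌋`, are bounded by
`B = (H+1)² A M! R^D` (Cauchy on the unit circle); cells of side `ε = e^{−D^ν}/2`; the count
`(2⌈B/ε⌉+1)^{2M} < (A+1)^{(H+1)²}` for large `D` uses exactly `τ < 2`, `β > 2τ − 2`, `β > τ − 1`,
`ν < 2 + β − τ`. (Also landed def-free as `Theorems/RoySmallValueDirichletGap/Negative/DirichletEdge*.lean`.) -/

section Dirichlet

open Finset Metric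
open Literature.NumberTheory.Transcendental.Roy2013 (expEval2 differentiable_expEval2
  iteratedDeriv_expEval2_zero)

/-! ### §4a Monomials: evaluation along the flow and Cauchy's estimate -/

/-- `X₁ᵃX₂ᵇ(ξ + z, η e^z) = (ξ+z)ᵃ (η e^z)ᵇ`. [folklore] -/
theorem expEval2_monomial (a b : ℕ) (ξ η z : ℂ) :
    expEval2 (X 0 ^ a * X 1 ^ b) ξ η z = (ξ + z) ^ a * (η * cexp z) ^ b := by
  simp [expEval2, map_mul, map_pow]

/-- On the unit circle, `|X₁ᵃX₂ᵇ(ξ + z, η e^z)| ≤ R^D` for `a, b ≤ D`, `R = (|ξ|+1)(e|η|+1)`.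
[folklore] -/
theorem norm_expEval2_monomial_le {a b D : ℕ} (ha : a ≤ D) (hb : b ≤ D) (ξ η : ℂ) {z : ℂ}
    (hz : ‖z‖ = 1) :
    ‖expEval2 (X 0 ^ a * X 1 ^ b) ξ η z‖ ≤ ((‖ξ‖ + 1) * (‖η‖ * Real.exp 1 + 1)) ^ D := by
  rw [expEval2_monomial, norm_mul, norm_pow, norm_pow, mul_pow]
  have h1 : ‖ξ + z‖ ≤ ‖ξ‖ + 1 := (norm_add_le _ _).trans (by rw [hz])
  have h2 : ‖η * cexp z‖ ≤ ‖η‖ * Real.exp 1 + 1 := by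
    rw [norm_mul, Complex.norm_exp]
    have : z.re ≤ 1 := (Complex.re_le_norm z).trans hz.le
    nlinarith [Real.exp_le_exp.2 this, norm_nonneg η, Real.exp_pos z.re]
  have hx1 : 1 ≤ ‖ξ‖ + 1 := by have := norm_nonneg ξ; linarith
  have hy1 : 1 ≤ ‖η‖ * Real.exp 1 + 1 := by
    have := mul_nonneg (norm_nonneg η) (Real.exp_pos 1).le; linarith
  gcongr
  · exact (pow_le_pow_left₀ (norm_nonneg _) h1 a).trans (pow_le_pow_right₀ hx1 ha)
  · exact (pow_le_pow_left₀ (norm_nonneg _) h2 b).trans (pow_le_pow_right₀ hy1 hb)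

/-- **Cauchy**: `|𝒟₁ⁱ(X₁ᵃX₂ᵇ)(ξ, η)| ≤ i! R^D` for `a, b ≤ D`. [folklore] -/
theorem norm_aeval_iterate_royD_monomial_le {a b D : ℕ} (ha : a ≤ D) (hb : b ≤ D) (ξ η : ℂ) (i : ℕ) :
    ‖aeval ![ξ, η] (royD^[i] (X 0 ^ a * X 1 ^ b))‖ ≤
      i.factorial * ((‖ξ‖ + 1) * (‖η‖ * Real.exp 1 + 1)) ^ D := by
  rw [← iteratedDeriv_expEval2_zero]
  have h := Complex.norm_iteratedDeriv_le_of_forall_mem_sphere_norm_le (f := expEval2 (X 0 ^ a * X 1 ^ b) ξ η)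
    (c := 0) i one_pos ((differentiable_expEval2 _ ξ η).diffContOnCl)
    (C := ((‖ξ‖ + 1) * (‖η‖ * Real.exp 1 + 1)) ^ D)
    (fun z hz => norm_expEval2_monomial_le ha hb ξ η (by simpa using hz))
  simpa using h

/-! ### Coefficient boxes -/

variable {H : ℕ}

/-- The polynomial with coefficient vector `d` on the monomials `X₁ᵃX₂ᵇ`, `a, b ≤ H`. -/
theorem boxPoly_def (d : Fin (H + 1) × Fin (H + 1) → ℤ) :
    (∑ k : Fin (H + 1) × Fin (H + 1), C (d k) * (X 0 ^ (k.1 : ℕ) * X 1 ^ (k.2 : ℕ)) :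
      MvPolynomial (Fin 2) ℤ) =
    ∑ k : Fin (H + 1) × Fin (H + 1),
      monomial (Finsupp.single 0 (k.1 : ℕ) + Finsupp.single 1 (k.2 : ℕ)) (d k) := by
  refine Finset.sum_congr rfl fun k _ => ?_
  rw [X_pow_eq_monomial, X_pow_eq_monomial, monomial_mul, C_mul_monomial]; simp

/-- The exponent map `(a, b) ↦ X₁ᵃX₂ᵇ` is injective. [folklore] -/
theorem expo_injective :
    Function.Injective fun k : Fin (H + 1) × Fin (H + 1) =>
      (Finsupp.single (0 : Fin 2) (k.1 : ℕ) + Finsupp.single 1 (k.2 : ℕ)) := by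
  intro k k' h
  have h0 := congrArg (fun f : Fin 2 →₀ ℕ => f 0) h
  have h1 := congrArg (fun f : Fin 2 →₀ ℕ => f 1) h
  simp at h0 h1
  exact Prod.ext (Fin.ext h0) (Fin.ext h1)

/-- Coefficients of a box polynomial. [folklore] -/
theorem coeff_boxPoly (d : Fin (H + 1) × Fin (H + 1) → ℤ) (m : Fin 2 →₀ ℕ) :
    coeff m (∑ k : Fin (H + 1) × Fin (H + 1), C (d k) * (X 0 ^ (k.1 : ℕ) * X 1 ^ (k.2 : ℕ)) :
      MvPolynomial (Fin 2) ℤ) =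
    ∑ k : Fin (H + 1) × Fin (H + 1),
      if Finsupp.single (0 : Fin 2) (k.1 : ℕ) + Finsupp.single 1 (k.2 : ℕ) = m then d k else 0 := by
  rw [boxPoly_def, coeff_sum]
  simp only [coeff_monomial]

/-- The coefficient at `X₁ᵃX₂ᵇ` is `d (a, b)`. [folklore] -/
theorem coeff_boxPoly_self (d : Fin (H + 1) × Fin (H + 1) → ℤ) (k₀ : Fin (H + 1) × Fin (H + 1)) :
    coeff (Finsupp.single (0 : Fin 2) (k₀.1 : ℕ) + Finsupp.single 1 (k₀.2 : ℕ))
      (∑ k : Fin (H + 1) × Fin (H + 1), C (d k) * (X 0 ^ (k.1 : ℕ) * X 1 ^ (k.2 : ℕ)) :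
        MvPolynomial (Fin 2) ℤ) = d k₀ := by
  rw [coeff_boxPoly]
  have : ∀ k : Fin (H + 1) × Fin (H + 1),
      (if Finsupp.single (0 : Fin 2) (k.1 : ℕ) + Finsupp.single 1 (k.2 : ℕ) =
          Finsupp.single (0 : Fin 2) (k₀.1 : ℕ) + Finsupp.single 1 (k₀.2 : ℕ) then d k else 0) =
      if k = k₀ then d k else 0 := by
    intro k
    by_cases hk : k = k₀
    · simp [hk]
    · rw [if_neg hk, if_neg (fun h => hk (expo_injective h))]
  simp_rw [this]
  simp

/-- Every coefficient of a box polynomial is one of the `d k`, or `0`. [folklore] -/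
theorem natAbs_coeff_boxPoly_le (d : Fin (H + 1) × Fin (H + 1) → ℤ) {A : ℕ}
    (hd : ∀ k, (d k).natAbs ≤ A) (m : Fin 2 →₀ ℕ) :
    (coeff m (∑ k : Fin (H + 1) × Fin (H + 1), C (d k) * (X 0 ^ (k.1 : ℕ) * X 1 ^ (k.2 : ℕ)) :
      MvPolynomial (Fin 2) ℤ)).natAbs ≤ A := by
  by_cases hm : ∃ k₀ : Fin (H + 1) × Fin (H + 1),
      Finsupp.single (0 : Fin 2) (k₀.1 : ℕ) + Finsupp.single 1 (k₀.2 : ℕ) = m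
  · obtain ⟨k₀, rfl⟩ := hm
    rw [coeff_boxPoly_self]; exact hd k₀
  · rw [coeff_boxPoly, Finset.sum_eq_zero fun k _ => if_neg fun h => hm ⟨k, h⟩]
    simp

/-- Degree of a box polynomial is `≤ 2H`. [folklore] -/
theorem totalDegree_boxPoly_le (d : Fin (H + 1) × Fin (H + 1) → ℤ) :
    (∑ k : Fin (H + 1) × Fin (H + 1), C (d k) * (X 0 ^ (k.1 : ℕ) * X 1 ^ (k.2 : ℕ)) :
      MvPolynomial (Fin 2) ℤ).totalDegree ≤ 2 * H := by
  rw [boxPoly_def]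
  refine totalDegree_finsetSum_le fun k _ => (totalDegree_monomial_le _ _).trans ?_
  rw [Finsupp.sum_add_index' (fun _ => rfl) (fun _ _ _ => rfl), Finsupp.sum_single_index rfl,
    Finsupp.sum_single_index rfl]
  show (k.1 : ℕ) + (k.2 : ℕ) ≤ 2 * H
  have := k.1.is_lt; have := k.2.is_lt; omega

/-- Values of `𝒟₁ⁱ` of a box polynomial are the corresponding linear combinations. [folklore] -/
theorem aeval_iterate_royD_boxPoly (d : Fin (H + 1) × Fin (H + 1) → ℤ) (ξ η : ℂ) (i : ℕ) :
    aeval ![ξ, η] (royD^[i] (∑ k : Fin (H + 1) × Fin (H + 1),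
      C (d k) * (X 0 ^ (k.1 : ℕ) * X 1 ^ (k.2 : ℕ)) : MvPolynomial (Fin 2) ℤ)) =
    ∑ k : Fin (H + 1) × Fin (H + 1),
      (d k : ℂ) * aeval ![ξ, η] (royD^[i] (X 0 ^ (k.1 : ℕ) * X 1 ^ (k.2 : ℕ))) := by
  rw [iterate_royD_sum, map_sum]
  refine Finset.sum_congr rfl fun k _ => ?_
  rw [iterate_royD_C_mul, map_mul, aeval_C]; simp

/-! ### Two small real lemmas -/

/-- Same `ε`-cell ⇒ distance `< ε`. [folklore] -/
theorem abs_sub_lt_of_floor_div_eq {x y ε : ℝ} (hε : 0 < ε) (h : ⌊x / ε⌋ = ⌊y / ε⌋) : |x - y| < ε := by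
  have h1 := Int.abs_sub_lt_one_of_floor_eq_floor h
  rw [← sub_div, abs_div, abs_of_pos hε, div_lt_one hε] at h1
  exact h1

/-- `C·D^a ≤ E·D^b` eventually in `D : ℕ`, for `a < b`, `E > 0`. [folklore] -/
theorem eventually_nat_rpow_le (C : ℝ) {a b E : ℝ} (hab : a < b) (hE : 0 < E) :
    ∀ᶠ D : ℕ in atTop, C * (D : ℝ) ^ a ≤ E * (D : ℝ) ^ b :=
  tendsto_natCast_atTop_atTop.eventually (eventually_mul_rpow_le_mul_rpow C hab hE)

/-- `C·D^a·log D ≤ E·D^b` eventually in `D : ℕ`, for `a < b`, `C ≥ 0`, `E > 0`. [folklore] -/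
theorem eventually_nat_rpow_log_le {C a b E : ℝ} (hab : a < b) (hC : 0 ≤ C) (hE : 0 < E) :
    ∀ᶠ D : ℕ in atTop, C * (D : ℝ) ^ a * Real.log D ≤ E * (D : ℝ) ^ b :=
  tendsto_natCast_atTop_atTop.eventually (eventually_mul_rpow_mul_log_le hab hC hE)

/-! ### The box principle -/

set_option maxHeartbeats 400000 in
/-- **Dirichlet's box principle below the edge** (Roy 2013, p. 3, in the range of the crux): for
EVERY `(ξ, η) ∈ ℂ²`, `1 ≤ τ < 2`, `β > τ` and `ν < 2 + β − τ`, for all large `D` there is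
`0 ≠ P ∈ ℤ[X₁, X₂]` with `deg P ≤ D`, height `≤ exp(D^β)` and `|𝒟₁ⁱP(ξ, η)| ≤ exp(−D^ν)` for all
`i < 3⌊D^τ⌋`. [cite: Roy2013, p. 3 (Dirichlet's box principle: "if it is possible to reduce the lower
bound on ν … it could not be by more than (τ−1)(2−τ)/(β+1−τ)")] -/
theorem hyp_below_edge (ξ η : ℂ) {β τ ν : ℝ} (h1 : 1 ≤ τ) (h2 : τ < 2) (hβ : τ < β)
    (hν : ν < 2 + β - τ) :
    ∀ᶠ D : ℕ in atTop, ∃ P : MvPolynomial (Fin 2) ℤ, P ≠ 0 ∧ P.totalDegree ≤ D ∧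
      (mvPolyHeight P : ℝ) ≤ Real.exp ((D : ℝ) ^ β) ∧
      ∀ i : ℕ, i < 3 * ⌊(D : ℝ) ^ τ⌋₊ → ‖aeval ![ξ, η] (royD^[i] P)‖ ≤ Real.exp (-(D : ℝ) ^ ν) := by
  -- the constant `R ≥ 1`
  set R : ℝ := (‖ξ‖ + 1) * (‖η‖ * Real.exp 1 + 1) with hR
  have hR1 : 1 ≤ R := by
    have hx1 : 1 ≤ ‖ξ‖ + 1 := by have := norm_nonneg ξ; linarith
    have hy1 : 1 ≤ ‖η‖ * Real.exp 1 + 1 := by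
      have := mul_nonneg (norm_nonneg η) (Real.exp_pos 1).le; linarith
    exact one_le_mul_of_one_le_of_one_le hx1 hy1
  have hlogR : 0 ≤ Real.log R := Real.log_nonneg hR1
  -- asymptotics: seven terms, each eventually ≤ D^{2+β}/56
  have hE : (0 : ℝ) < 1 / 56 := by norm_num
  have hev := ((((((eventually_nat_rpow_le (6 * Real.log 8) (show τ < 2 + β by linarith) hE).and
    (eventually_nat_rpow_le 12 (show τ + 1 < 2 + β by linarith) hE)).and
    (eventually_nat_rpow_le 6 (show τ + β < 2 + β by linarith) hE)).and
    (eventually_nat_rpow_le (18 * Real.log 3) (show 2 * τ < 2 + β by linarith) hE)).and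
    (eventually_nat_rpow_log_le (show 2 * τ < 2 + β by linarith) (show (0:ℝ) ≤ 18 * τ by linarith) hE)).and
    (eventually_nat_rpow_le (6 * Real.log R) (show τ + 1 < 2 + β by linarith) hE)).and
    (eventually_nat_rpow_le 6 (show τ + ν < 2 + β by linarith) hE)
  filter_upwards [hev, eventually_ge_atTop 1] with D hD hD1
  obtain ⟨⟨⟨⟨⟨⟨e1, e2⟩, e3⟩, e4⟩, e5⟩, e6⟩, e7⟩ := hD
  -- notation
  have hD1r : (1 : ℝ) ≤ D := by exact_mod_cast hD1
  have hD0r : (0 : ℝ) < D := by linarith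
  set x : ℝ := (D : ℝ) with hx
  set H : ℕ := D / 2 with hH
  set M : ℕ := 3 * ⌊x ^ τ⌋₊ with hM
  set A : ℕ := ⌊Real.exp (x ^ β)⌋₊ with hA
  set N : ℕ := (H + 1) * (H + 1) with hN
  set ε : ℝ := Real.exp (-x ^ ν) / 2 with hε
  have hε0 : 0 < ε := by positivity
  have hε1 : ε ≤ 1 / 2 := by
    have : Real.exp (-x ^ ν) ≤ 1 := by
      rw [Real.exp_le_one_iff, neg_nonpos]; exact Real.rpow_nonneg hD0r.le _
    rw [hε]; linarith
  have hA1 : 1 ≤ A := Nat.le_floor (by simpa using Real.one_le_exp (Real.rpow_nonneg hD0r.le β))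
  have hAexp : (A : ℝ) ≤ Real.exp (x ^ β) := Nat.floor_le (Real.exp_pos _).le
  have hAexp' : Real.exp (x ^ β) ≤ (A : ℝ) + 1 := (Nat.lt_floor_add_one _).le
  have hHD : 2 * H ≤ D := by omega
  have hHD' : x ≤ 2 * ((H : ℝ) + 1) := by
    have : D ≤ 2 * (H + 1) := by omega
    rw [hx]; exact_mod_cast this
  have hN4 : x ^ 2 / 4 ≤ (N : ℝ) := by
    rw [hN]; push_cast
    have h0 : 0 ≤ (H : ℝ) + 1 := by positivity
    have h1 : x / 2 ≤ (H : ℝ) + 1 := by linarith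
    have h2 : (x / 2) ^ 2 ≤ ((H : ℝ) + 1) ^ 2 := pow_le_pow_left₀ (by linarith) h1 2
    nlinarith [h2]
  have hNx : (N : ℝ) ≤ (x + 1) ^ 2 := by
    rw [hN]; push_cast
    have h1 : (H : ℝ) ≤ x := by rw [hx]; exact_mod_cast (show H ≤ D by omega)
    have h0 : 0 ≤ (H : ℝ) + 1 := by positivity
    have h2 : ((H : ℝ) + 1) ^ 2 ≤ (x + 1) ^ 2 := pow_le_pow_left₀ h0 (by linarith) 2
    nlinarith [h2]
  have hN1 : (1 : ℝ) ≤ N := by rw [hN]; exact_mod_cast Nat.one_le_iff_ne_zero.2 (by positivity)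
  have hMx : (M : ℝ) ≤ 3 * x ^ τ := by
    rw [hM]; push_cast
    exact mul_le_mul_of_nonneg_left (Nat.floor_le (Real.rpow_nonneg hD0r.le τ)) (by norm_num)
  have hM0 : (0 : ℝ) ≤ M := Nat.cast_nonneg M
  -- the bound `B` on the values
  set B : ℝ := (N : ℝ) * A * M.factorial * R ^ D with hB
  have hB1 : 1 ≤ B := by
    rw [hB]
    have h1 : (1 : ℝ) ≤ A := by exact_mod_cast hA1
    have h2 : (1 : ℝ) ≤ M.factorial := by exact_mod_cast M.factorial_pos
    have h3 : (1 : ℝ) ≤ R ^ D := one_le_pow₀ hR1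
    calc (1 : ℝ) = 1 * 1 * 1 * 1 := by ring
      _ ≤ (N : ℝ) * A * M.factorial * R ^ D := by gcongr
  -- values of `𝒟₁ⁱ` on coefficient vectors
  let mono : Fin (H + 1) × Fin (H + 1) → MvPolynomial (Fin 2) ℤ :=
    fun k => X 0 ^ (k.1 : ℕ) * X 1 ^ (k.2 : ℕ)
  let val : (Fin (H + 1) × Fin (H + 1) → ℤ) → ℕ → ℂ :=
    fun d i => ∑ k : Fin (H + 1) × Fin (H + 1), (d k : ℂ) * aeval ![ξ, η] (royD^[i] (mono k))
  have hmono : ∀ k : Fin (H + 1) × Fin (H + 1), ∀ i < M,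
      ‖aeval ![ξ, η] (royD^[i] (mono k))‖ ≤ M.factorial * R ^ D := by
    intro k i hi
    have ha : (k.1 : ℕ) ≤ D := by have := k.1.is_lt; omega
    have hb : (k.2 : ℕ) ≤ D := by have := k.2.is_lt; omega
    refine (norm_aeval_iterate_royD_monomial_le ha hb ξ η i).trans ?_
    exact mul_le_mul_of_nonneg_right (by exact_mod_cast Nat.factorial_le hi.le)
      (pow_nonneg (by linarith) _)
  have hval : ∀ d : Fin (H + 1) × Fin (H + 1) → ℤ, (∀ k, |(d k : ℝ)| ≤ A) → ∀ i < M,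
      ‖val d i‖ ≤ B := by
    intro d hd i hi
    calc ‖val d i‖ ≤ ∑ k : Fin (H + 1) × Fin (H + 1), ‖(d k : ℂ) * aeval ![ξ, η] (royD^[i] (mono k))‖ :=
          norm_sum_le _ _
      _ ≤ ∑ _k : Fin (H + 1) × Fin (H + 1), (A : ℝ) * (M.factorial * R ^ D) := by
          refine Finset.sum_le_sum fun k _ => ?_
          rw [norm_mul]
          refine mul_le_mul ?_ (hmono k i hi) (norm_nonneg _) (Nat.cast_nonneg A)
          rw [Complex.norm_intCast]; exact hd k
      _ = B := by
          rw [Finset.sum_const, Finset.card_univ, nsmul_eq_mul, hB, hN]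
          simp [Fintype.card_prod, Fintype.card_fin]; ring
  -- cells
  set L : ℕ := ⌈B / ε⌉₊ with hL
  have hLB : B / ε ≤ L := Nat.le_ceil _
  let toZ : (Fin (H + 1) × Fin (H + 1) → Fin (A + 1)) → (Fin (H + 1) × Fin (H + 1) → ℤ) :=
    fun c k => ((c k : ℕ) : ℤ)
  have htoZ : ∀ c : Fin (H + 1) × Fin (H + 1) → Fin (A + 1), ∀ k, |((toZ c k : ℤ) : ℝ)| ≤ A := by
    intro c k
    have h1 : ((c k : ℕ) : ℝ) ≤ A := by exact_mod_cast Nat.lt_succ_iff.1 (c k).is_lt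
    have h0 : (0 : ℝ) ≤ ((c k : ℕ) : ℝ) := Nat.cast_nonneg _
    simp only [toZ, Int.cast_natCast, abs_of_nonneg h0]
    exact h1
  let cell : (Fin (H + 1) × Fin (H + 1) → Fin (A + 1)) → (Fin M → ℤ × ℤ) :=
    fun c i => (⌊(val (toZ c) i).re / ε⌋, ⌊(val (toZ c) i).im / ε⌋)
  let T : Finset (Fin M → ℤ × ℤ) :=
    Fintype.piFinset fun _ => (Finset.Icc (-(L : ℤ)) L) ×ˢ (Finset.Icc (-(L : ℤ)) L)
  have hbox : ∀ t : ℝ, |t| ≤ B → ⌊t / ε⌋ ∈ Finset.Icc (-(L : ℤ)) L := by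
    intro t ht
    rw [Finset.mem_Icc]
    have ht1 : t ≤ B := (le_abs_self t).trans ht
    have ht2 : -B ≤ t := by have := neg_abs_le t; linarith
    have hup : t / ε ≤ L := (div_le_div_of_nonneg_right ht1 hε0.le).trans hLB
    have hlo : -(L : ℝ) ≤ t / ε := by
      have h' : -B / ε ≤ t / ε := div_le_div_of_nonneg_right (by linarith) hε0.le
      calc -(L : ℝ) ≤ -(B / ε) := by linarith
        _ = -B / ε := by ring
        _ ≤ t / ε := h'
    constructor
    · rw [Int.le_floor]; push_cast; exact hlo
    · calc ⌊t / ε⌋ ≤ ⌊((L : ℤ) : ℝ)⌋ := Int.floor_mono (by push_cast; exact hup)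
        _ = L := Int.floor_intCast _
  have hcellT : Set.MapsTo cell
      (↑(Finset.univ : Finset (Fin (H + 1) × Fin (H + 1) → Fin (A + 1)))) (↑T) := by
    intro c _
    rw [Finset.mem_coe]
    simp only [T, Fintype.mem_piFinset]
    intro i
    rw [Finset.mem_product]
    have hvi : ‖val (toZ c) i‖ ≤ B := hval (toZ c) (htoZ c) i i.is_lt
    exact ⟨hbox _ ((Complex.abs_re_le_norm _).trans hvi), hbox _ ((Complex.abs_im_le_norm _).trans hvi)⟩
  -- counting
  have hcardT : T.card = ((2 * L + 1) * (2 * L + 1)) ^ M := by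
    simp only [T, Fintype.card_piFinset, Finset.prod_const, Finset.card_univ, Fintype.card_fin,
      Finset.card_product, Int.card_Icc]
    congr 2 <;> omega
  have hcardU : (Finset.univ : Finset (Fin (H + 1) × Fin (H + 1) → Fin (A + 1))).card = (A + 1) ^ N := by
    rw [Finset.card_univ, Fintype.card_fun, Fintype.card_fin, Fintype.card_prod, Fintype.card_fin, hN]
  -- the main inequality, in ℝ
  have hlogN : Real.log N ≤ 2 * x := by
    have h1 : Real.log N ≤ Real.log ((x + 1) ^ 2) := Real.log_le_log (by linarith) hNx
    have h2 : Real.log (x + 1) ≤ x := by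
      have := Real.log_le_sub_one_of_pos (show 0 < x + 1 by linarith); linarith
    rw [Real.log_pow] at h1; push_cast at h1; linarith
  have hlogA : Real.log A ≤ x ^ β := (Real.log_le_iff_le_exp (by exact_mod_cast hA1)).2 hAexp
  have hlogfact : Real.log (M.factorial) ≤ M * Real.log M := by
    have h1 : (M.factorial : ℝ) ≤ (M : ℝ) ^ M := by exact_mod_cast Nat.factorial_le_pow M
    calc Real.log (M.factorial) ≤ Real.log ((M : ℝ) ^ M) :=
          Real.log_le_log (by exact_mod_cast M.factorial_pos) h1
      _ = M * Real.log M := Real.log_pow _ _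
  have hlogx : 0 ≤ Real.log x := Real.log_nonneg hD1r
  have hlog8 : 0 ≤ Real.log 8 := Real.log_nonneg (by norm_num)
  have hlog3 : 0 ≤ Real.log 3 := Real.log_nonneg (by norm_num)
  have hMlogM : (M : ℝ) * Real.log M ≤ 3 * x ^ τ * (Real.log 3 + τ * Real.log x) := by
    have hrhs : 0 ≤ Real.log 3 + τ * Real.log x := by positivity
    rcases Nat.eq_zero_or_pos M with hM0' | hMpos
    · rw [hM0']; simp; positivity
    · have hM1 : (0 : ℝ) < M := by exact_mod_cast hMpos
      have hlogM : Real.log M ≤ Real.log 3 + τ * Real.log x := by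
        calc Real.log M ≤ Real.log (3 * x ^ τ) := Real.log_le_log hM1 hMx
          _ = Real.log 3 + τ * Real.log x := by
              rw [Real.log_mul (by norm_num) (by positivity), Real.log_rpow hD0r]
      calc (M : ℝ) * Real.log M ≤ M * (Real.log 3 + τ * Real.log x) :=
            mul_le_mul_of_nonneg_left hlogM hM0
        _ ≤ 3 * x ^ τ * (Real.log 3 + τ * Real.log x) := mul_le_mul_of_nonneg_right hMx hrhs
  have hMlogM0 : 0 ≤ (M : ℝ) * Real.log M := by
    rcases Nat.eq_zero_or_pos M with hM0' | hMpos
    · rw [hM0']; simp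
    · exact mul_nonneg hM0 (Real.log_nonneg (by exact_mod_cast hMpos))
  have hlog8B : Real.log (8 * B) ≤ Real.log 8 + 2 * x + x ^ β + M * Real.log M + x * Real.log R := by
    rw [hB, Real.log_mul (by norm_num) (by positivity), Real.log_mul (by positivity) (by positivity),
      Real.log_mul (by positivity) (by positivity), Real.log_mul (by positivity) (by positivity),
      Real.log_pow]
    linarith
  -- powers of x
  have hxτ1 : x ^ τ * x = x ^ (τ + 1) := by rw [Real.rpow_add hD0r, Real.rpow_one]
  have hxτβ : x ^ τ * x ^ β = x ^ (τ + β) := by rw [Real.rpow_add hD0r]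
  have hx2τ : x ^ τ * x ^ τ = x ^ (2 * τ) := by rw [← Real.rpow_add hD0r]; ring_nf
  have hxτν : x ^ τ * x ^ ν = x ^ (τ + ν) := by rw [Real.rpow_add hD0r]
  have hx2β : x ^ 2 * x ^ β = x ^ (2 + β) := by
    rw [Real.rpow_add hD0r, Real.rpow_two]
  have hxτ0 : 0 ≤ x ^ τ := Real.rpow_nonneg hD0r.le τ
  have hxν0 : 0 ≤ x ^ ν := Real.rpow_nonneg hD0r.le ν
  have hxβ0 : 0 ≤ x ^ β := Real.rpow_nonneg hD0r.le β
  have hx2β0 : 0 < x ^ (2 + β) := Real.rpow_pos_of_pos hD0r _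
  have hS : 2 * M * (Real.log (8 * B) + x ^ ν) < N * x ^ β := by
    have t1 : 2 * M * Real.log 8 ≤ 6 * Real.log 8 * x ^ τ := by
      have := mul_le_mul_of_nonneg_right hMx hlog8; linarith only [this]
    have t2 : 2 * M * (2 * x) ≤ 12 * x ^ (τ + 1) := by
      rw [← hxτ1]; have := mul_le_mul_of_nonneg_right hMx hD0r.le; linarith only [this]
    have t3 : 2 * M * x ^ β ≤ 6 * x ^ (τ + β) := by
      rw [← hxτβ]; have := mul_le_mul_of_nonneg_right hMx hxβ0; linarith only [this]
    have t45 : 2 * M * (M * Real.log M) ≤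
        18 * Real.log 3 * x ^ (2 * τ) + 18 * τ * x ^ (2 * τ) * Real.log x := by
      calc 2 * M * (M * Real.log M) ≤ 2 * (3 * x ^ τ) * (3 * x ^ τ * (Real.log 3 + τ * Real.log x)) :=
            mul_le_mul (by linarith only [hMx]) hMlogM hMlogM0 (by positivity)
        _ = 18 * Real.log 3 * (x ^ τ * x ^ τ) + 18 * τ * (x ^ τ * x ^ τ) * Real.log x := by ring
        _ = _ := by rw [hx2τ]
    have t6 : 2 * M * (x * Real.log R) ≤ 6 * Real.log R * x ^ (τ + 1) := by
      rw [← hxτ1]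
      have := mul_le_mul_of_nonneg_right hMx (mul_nonneg hD0r.le hlogR); linarith only [this]
    have t7 : 2 * M * x ^ ν ≤ 6 * x ^ (τ + ν) := by
      rw [← hxτν]; have := mul_le_mul_of_nonneg_right hMx hxν0; linarith only [this]
    have hsum : 2 * M * (Real.log (8 * B) + x ^ ν) ≤ 7 * (1 / 56 * x ^ (2 + β)) := by
      calc 2 * M * (Real.log (8 * B) + x ^ ν)
          ≤ 2 * M * (Real.log 8 + 2 * x + x ^ β + M * Real.log M + x * Real.log R + x ^ ν) := by
            apply mul_le_mul_of_nonneg_left _ (by positivity); linarith only [hlog8B]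
        _ = 2 * M * Real.log 8 + 2 * M * (2 * x) + 2 * M * x ^ β + 2 * M * (M * Real.log M) +
              2 * M * (x * Real.log R) + 2 * M * x ^ ν := by ring
        _ ≤ 7 * (1 / 56 * x ^ (2 + β)) := by
            linarith only [t1, t2, t3, t45, t6, t7, e1, e2, e3, e4, e5, e6, e7]
    calc 2 * M * (Real.log (8 * B) + x ^ ν) ≤ 7 * (1 / 56 * x ^ (2 + β)) := hsum
      _ < x ^ 2 / 4 * x ^ β := by
          have h4 : x ^ 2 / 4 * x ^ β = x ^ (2 + β) / 4 := by rw [← hx2β]; ring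
          rw [h4]; linarith only [hx2β0]
      _ ≤ N * x ^ β := mul_le_mul_of_nonneg_right hN4 hxβ0
  have h2L : (2 * (L : ℝ) + 1) ≤ 4 * B / ε := by
    have h1 : (L : ℝ) < B / ε + 1 := Nat.ceil_lt_add_one (by positivity)
    have h2 : 2 ≤ B / ε := by
      rw [le_div_iff₀ hε0]; linarith only [hB1, hε1]
    have h3 : 4 * B / ε = 4 * (B / ε) := by ring
    rw [h3]; linarith only [h1, h2]
  have hcount : T.card < (Finset.univ : Finset (Fin (H + 1) × Fin (H + 1) → Fin (A + 1))).card := by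
    rw [hcardT, hcardU]
    have hεexp : 4 * B / ε = Real.exp (Real.log (8 * B) + x ^ ν) := by
      rw [Real.exp_add, Real.exp_log (by positivity), hε, Real.exp_neg]
      field_simp
      ring
    have hreal : (((2 * L + 1) * (2 * L + 1) : ℕ) : ℝ) ^ M < (((A + 1 : ℕ) : ℝ)) ^ N := by
      have hL0 : (0 : ℝ) ≤ 2 * L + 1 := by positivity
      calc (((2 * L + 1) * (2 * L + 1) : ℕ) : ℝ) ^ M = ((2 * (L : ℝ) + 1) ^ 2) ^ M := by push_cast; ring
        _ ≤ ((4 * B / ε) ^ 2) ^ M := by gcongr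
        _ = (4 * B / ε) ^ (2 * M) := by rw [← pow_mul]
        _ = Real.exp (Real.log (8 * B) + x ^ ν) ^ (2 * M) := by rw [hεexp]
        _ = Real.exp ((2 * M : ℕ) * (Real.log (8 * B) + x ^ ν)) := (Real.exp_nat_mul _ _).symm
        _ = Real.exp (2 * M * (Real.log (8 * B) + x ^ ν)) := by push_cast; ring_nf
        _ < Real.exp (N * x ^ β) := Real.exp_lt_exp.2 hS
        _ = Real.exp (x ^ β) ^ N := Real.exp_nat_mul _ _
        _ ≤ (((A + 1 : ℕ) : ℝ)) ^ N := by
            gcongr; push_cast; exact hAexp'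
    exact_mod_cast hreal
  -- pigeonhole
  obtain ⟨c₁, -, c₂, -, hne, hcell⟩ := Finset.exists_ne_map_eq_of_card_lt_of_maps_to hcount hcellT
  -- the polynomial
  let d : Fin (H + 1) × Fin (H + 1) → ℤ := fun k => toZ c₁ k - toZ c₂ k
  have hdA : ∀ k, (d k).natAbs ≤ A := by
    intro k
    have h1 := (c₁ k).is_lt; have h2 := (c₂ k).is_lt
    simp only [d, toZ]; omega
  refine ⟨∑ k : Fin (H + 1) × Fin (H + 1), C (d k) * (X 0 ^ (k.1 : ℕ) * X 1 ^ (k.2 : ℕ)),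
    ?_, ?_, ?_, ?_⟩
  · -- nonzero
    obtain ⟨k₀, hk₀⟩ : ∃ k₀, c₁ k₀ ≠ c₂ k₀ := Function.ne_iff.mp hne
    intro hP
    have hc := congrArg (coeff (Finsupp.single (0 : Fin 2) (k₀.1 : ℕ) + Finsupp.single 1 (k₀.2 : ℕ))) hP
    rw [coeff_boxPoly_self, coeff_zero] at hc
    apply hk₀
    have h' : ((c₁ k₀ : ℕ) : ℤ) = ((c₂ k₀ : ℕ) : ℤ) := by simp only [d, toZ] at hc; omega
    exact Fin.ext (by exact_mod_cast h')
  · -- degree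
    exact (totalDegree_boxPoly_le d).trans hHD
  · -- height
    have hh : mvPolyHeight (∑ k : Fin (H + 1) × Fin (H + 1),
        C (d k) * (X 0 ^ (k.1 : ℕ) * X 1 ^ (k.2 : ℕ)) : MvPolynomial (Fin 2) ℤ) ≤ A :=
      Finset.sup_le fun m _ => natAbs_coeff_boxPoly_le d hdA m
    calc _ ≤ (A : ℝ) := by exact_mod_cast hh
      _ ≤ Real.exp (x ^ β) := hAexp
  · -- values
    intro i hi
    rw [aeval_iterate_royD_boxPoly]
    have hsplit : (∑ k : Fin (H + 1) × Fin (H + 1),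
        (d k : ℂ) * aeval ![ξ, η] (royD^[i] (X 0 ^ (k.1 : ℕ) * X 1 ^ (k.2 : ℕ)))) =
        val (toZ c₁) i - val (toZ c₂) i := by
      simp only [val, mono, d, ← Finset.sum_sub_distrib]
      refine Finset.sum_congr rfl fun k _ => ?_
      push_cast; ring
    rw [hsplit]
    have hci := congrFun hcell ⟨i, hi⟩
    have hre : |(val (toZ c₁) i - val (toZ c₂) i).re| < ε := by
      rw [Complex.sub_re]; exact abs_sub_lt_of_floor_div_eq hε0 (congrArg Prod.fst hci)
    have him : |(val (toZ c₁) i - val (toZ c₂) i).im| < ε := by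
      rw [Complex.sub_im]; exact abs_sub_lt_of_floor_div_eq hε0 (congrArg Prod.snd hci)
    calc ‖val (toZ c₁) i - val (toZ c₂) i‖
        ≤ |(val (toZ c₁) i - val (toZ c₂) i).re| + |(val (toZ c₁) i - val (toZ c₂) i).im| :=
          Complex.norm_le_abs_re_add_abs_im _
      _ ≤ ε + ε := add_le_add hre.le him.le
      _ = Real.exp (-x ^ ν) := by rw [hε]; ring

/-- **§4 THE DIRICHLET EDGE (tightness)**: below the edge the hypothesis holds at EVERY point of `ℂ²`
(in the range of the crux). [cite: Roy2013, p. 3] -/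
theorem dirichletEdge {β τ ν : ℝ} (h1 : 1 ≤ τ) (h2 : τ < 2) (hβ : τ < β) (hν : ν < 2 + β - τ)
    (ξ η : ℂ) : SmallValueHyp ξ η β τ ν :=
  hyp_below_edge ξ η h1 h2 hβ hν

/-- Hence the crux-shaped implication is FALSE for every `ν` below the edge (witness `(e, 1)`):
the threshold `2 + β − τ` of the crux cannot be lowered at all. [cite: Roy2013, p. 3] -/
theorem crux_slice_false_below_edge {β τ ν : ℝ} (h1 : 1 ≤ τ) (h2 : τ < 2) (hβ : τ < β)
    (hν : ν < 2 + β - τ) :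
    ¬ (∀ (ξ η : ℂ), η ≠ 0 → SmallValueHyp ξ η β τ ν → IsAlgebraic ℚ ξ ∧ IsAlgebraic ℚ η) := fun h =>
  transcendental_e (h (cexp 1) 1 one_ne_zero (dirichletEdge h1 h2 hβ hν _ _)).1

/-- The crux with its `ν`-window lowered by `δ`. -/
def CruxWithEdgeLowered (δ : ℝ) : Prop :=
  ∀ (ξ η : ℂ), η ≠ 0 → ∀ (β τ ν : ℝ), 1 ≤ τ → τ < 2 → τ < β → 2 + β - τ - δ < ν →
    SmallValueHyp ξ η β τ ν → IsAlgebraic ℚ ξ ∧ IsAlgebraic ℚ η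

/-- **Lowering the window by any `δ > 0` makes the crux false.** [cite: Roy2013, p. 3] -/
theorem not_cruxWithEdgeLowered {δ : ℝ} (hδ : 0 < δ) : ¬ CruxWithEdgeLowered δ := fun h =>
  crux_slice_false_below_edge (β := 2) (τ := 1) (ν := 3 - δ / 2) le_rfl (by norm_num) (by norm_num)
    (by linarith) fun ξ η hη hP => h ξ η hη 2 1 (3 - δ / 2) le_rfl (by norm_num) (by norm_num) (by linarith) hP

/-- NON-VACUITY just below the window, at every point: combining `dirichletEdge` with antitonicity,
for every point and every `ν ≤ 2 + β − τ − δ` the hypothesis holds; in particular the hypothesis of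
the crux is satisfiable arbitrarily close to (below) the edge at transcendental points, so the crux
asserts a genuine THRESHOLD phenomenon at `ν = 2 + β − τ`. -/
theorem smallValueHyp_of_lt_edge {β τ ν : ℝ} (h1 : 1 ≤ τ) (h2 : τ < 2) (hβ : τ < β)
    (hν : ν < 2 + β - τ) (ξ η : ℂ) : SmallValueHyp ξ η β τ ν := dirichletEdge h1 h2 hβ hν ξ η

end Dirichlet


/-! ## §5 Non-vacuity in the window: Thue–Siegel at `(0, p/q)` (Roy 2013 p. 3), kernel-checked

Siegel's lemma (Mathlib) on the integer `𝒟₁`-Taylor matrix at `(0,1)` of the tree (`taylorMatrix`) gives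
`Q = ∑ t_{ab}X₁ᵃX₂ᵇ ≠ 0` with `𝒟₁ⁿQ(0,1) = 0` (`n < 3⌊D^τ⌋`), `‖t‖ ≤ exp(D^β/2)`; rescaling
`P = ∑ t_{ab} p^{H−b} qᵇ X₁ᵃX₂ᵇ` has `P(z, (p/q)e^z) = p^H Q(z, e^z)`. (Also landed def-free as
`Theorems/RoySmallValueDirichletGap/Negative/ThueSiegelNonVacuity.lean`.) -/

section ThueSiegel

open Finset Metric
open Literature.NumberTheory.Transcendental.Roy2013 (expEval2 iteratedDeriv_expEval2_zero)

/-! ### §5a Values of `𝒟₁ⁿ` at `(0, y)` through the `(0, 1)` Taylor functionals -/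

/-- `X₁ᵃX₂ᵇ(0 + z, y e^z) = yᵇ · X₁ᵃX₂ᵇ(z, e^z)`. [folklore] -/
theorem expEval2_monoXY_zero (a b : ℕ) (y z : ℂ) :
    expEval2 (monoXY a b) 0 y z = y ^ b * expEval (monoXY a b) z := by
  simp only [expEval2, expEval, monoXY, map_mul, map_pow, aeval_X, Matrix.cons_val_zero,
    Matrix.cons_val_one, zero_add, mul_pow]
  ring

/-- **`𝒟₁ⁿ(X₁ᵃX₂ᵇ)(0, y) = yᵇ · 𝒟₁ⁿ(X₁ᵃX₂ᵇ)(0, 1)`**. [folklore] -/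
theorem aeval_zero_iterate_royD_monoXY (n a b : ℕ) (y : ℂ) :
    aeval ![0, y] (royD^[n] (monoXY a b)) = y ^ b * (taylorInt n (monoXY a b) : ℂ) := by
  rw [← iteratedDeriv_expEval2_zero, taylorInt_cast]
  have h : expEval2 (monoXY a b) 0 y = fun z => y ^ b * expEval (monoXY a b) z :=
    funext (expEval2_monoXY_zero a b y)
  rw [h, iteratedDeriv_const_mul_field]

/-- Values of `𝒟₁ⁿ` of a box polynomial at `(0, y)`. [folklore] -/
theorem aeval_zero_iterate_royD_polyOfCoeffs {H : ℕ} (t : Fin (H + 1) × Fin (H + 1) → ℤ) (n : ℕ)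
    (y : ℂ) :
    aeval ![0, y] (royD^[n] (polyOfCoeffs t)) =
      ∑ ab, (t ab : ℂ) * (y ^ (ab.2 : ℕ) * (taylorInt n (monoXY ab.1 ab.2) : ℂ)) := by
  unfold polyOfCoeffs
  rw [iterate_royD_sum, map_sum]
  refine Finset.sum_congr rfl fun ab _ => ?_
  rw [iterate_royD_C_mul, map_mul, aeval_C, aeval_zero_iterate_royD_monoXY]
  simp

/-! ### Rescaling from `(0, 1)` to `(0, p/q)` -/

/-- **`𝒟₁ⁿP(0, p/q) = p^H · 𝒟₁ⁿQ(0, 1)`** for `P = ∑ t_{ab} p^{H−b} qᵇ X₁ᵃX₂ᵇ`,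
`Q = ∑ t_{ab} X₁ᵃX₂ᵇ`. [folklore] -/
theorem aeval_rescaled {H : ℕ} (t : Fin (H + 1) × Fin (H + 1) → ℤ) (p q : ℤ) (hq : q ≠ 0) (n : ℕ) :
    aeval ![0, ((p : ℂ) / (q : ℂ))]
      (royD^[n] (polyOfCoeffs fun ab => t ab * p ^ (H - (ab.2 : ℕ)) * q ^ (ab.2 : ℕ))) =
      (p : ℂ) ^ H * (taylorInt n (polyOfCoeffs t) : ℂ) := by
  rw [aeval_zero_iterate_royD_polyOfCoeffs, taylorInt_polyOfCoeffs]
  push_cast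
  rw [Finset.mul_sum]
  refine Finset.sum_congr rfl fun ab _ => ?_
  have hb : (ab.2 : ℕ) ≤ H := Nat.lt_succ_iff.1 ab.2.isLt
  have hq' : (q : ℂ) ≠ 0 := by exact_mod_cast hq
  have h1 : (q : ℂ) ^ (ab.2 : ℕ) * ((p : ℂ) / (q : ℂ)) ^ (ab.2 : ℕ) = (p : ℂ) ^ (ab.2 : ℕ) := by
    rw [← mul_pow, mul_div_cancel₀ _ hq']
  calc (t ab : ℂ) * (p : ℂ) ^ (H - (ab.2 : ℕ)) * (q : ℂ) ^ (ab.2 : ℕ) *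
        (((p : ℂ) / (q : ℂ)) ^ (ab.2 : ℕ) * (taylorInt n (monoXY ab.1 ab.2) : ℂ))
      = (t ab : ℂ) * ((p : ℂ) ^ (H - (ab.2 : ℕ)) * ((q : ℂ) ^ (ab.2 : ℕ) * ((p : ℂ) / (q : ℂ)) ^ (ab.2 : ℕ))) *
          (taylorInt n (monoXY ab.1 ab.2) : ℂ) := by ring
    _ = (p : ℂ) ^ H * ((taylorInt n (monoXY ab.1 ab.2) : ℂ) * (t ab : ℂ)) := by
        rw [h1, pow_sub_mul_pow _ hb]; ring

/-- The rescaled vector is non-zero. [folklore] -/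
theorem rescaled_ne_zero {H : ℕ} {t : Fin (H + 1) × Fin (H + 1) → ℤ} (ht : t ≠ 0) {p q : ℤ}
    (hp : p ≠ 0) (hq : q ≠ 0) :
    (fun ab : Fin (H + 1) × Fin (H + 1) => t ab * p ^ (H - (ab.2 : ℕ)) * q ^ (ab.2 : ℕ)) ≠ 0 := by
  obtain ⟨ab, hab⟩ := Function.ne_iff.1 ht
  refine Function.ne_iff.2 ⟨ab, ?_⟩
  simp only [Pi.zero_apply, ne_eq, mul_eq_zero, pow_eq_zero_iff', not_or]
  exact ⟨⟨hab, fun h => hp h.1⟩, fun h => hq h.1⟩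

/-- The rescaled vector has sup norm `≤ ‖t‖ · max(|p|,|q|)^H`. [folklore] -/
theorem norm_rescaled_le {H : ℕ} (t : Fin (H + 1) × Fin (H + 1) → ℤ) (p q : ℤ) :
    ‖(fun ab : Fin (H + 1) × Fin (H + 1) => t ab * p ^ (H - (ab.2 : ℕ)) * q ^ (ab.2 : ℕ))‖ ≤
      ‖t‖ * (max |(p : ℝ)| |(q : ℝ)|) ^ H := by
  refine (pi_norm_le_iff_of_nonneg (by positivity)).2 fun ab => ?_
  have hb : (ab.2 : ℕ) ≤ H := Nat.lt_succ_iff.1 ab.2.isLt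
  rw [Int.norm_eq_abs]
  push_cast
  rw [abs_mul, abs_mul, abs_pow, abs_pow]
  have h1 : |(t ab : ℝ)| ≤ ‖t‖ := by have := norm_le_pi_norm t ab; rwa [Int.norm_eq_abs] at this
  have h2 : |(p : ℝ)| ^ (H - (ab.2 : ℕ)) ≤ (max |(p : ℝ)| |(q : ℝ)|) ^ (H - (ab.2 : ℕ)) :=
    pow_le_pow_left₀ (abs_nonneg _) (le_max_left _ _) _
  have h3 : |(q : ℝ)| ^ (ab.2 : ℕ) ≤ (max |(p : ℝ)| |(q : ℝ)|) ^ (ab.2 : ℕ) :=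
    pow_le_pow_left₀ (abs_nonneg _) (le_max_right _ _) _
  calc |(t ab : ℝ)| * |(p : ℝ)| ^ (H - (ab.2 : ℕ)) * |(q : ℝ)| ^ (ab.2 : ℕ)
      ≤ ‖t‖ * (max |(p : ℝ)| |(q : ℝ)|) ^ (H - (ab.2 : ℕ)) * (max |(p : ℝ)| |(q : ℝ)|) ^ (ab.2 : ℕ) := by
        gcongr
    _ = ‖t‖ * (max |(p : ℝ)| |(q : ℝ)|) ^ H := by rw [mul_assoc, pow_sub_mul_pow _ hb]

/-- Total degree of a box polynomial on `{0..H}²` is `≤ 2H`. [folklore] -/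
theorem totalDegree_polyOfCoeffs_le {H : ℕ} (t : Fin (H + 1) × Fin (H + 1) → ℤ) :
    (polyOfCoeffs t).totalDegree ≤ 2 * H := by
  rw [polyOfCoeffs_eq_sum_monomial]
  refine totalDegree_finsetSum_le fun ab _ => (totalDegree_monomial_le _ _).trans ?_
  rw [boxExp, Finsupp.sum_add_index' (fun _ => rfl) (fun _ _ _ => rfl), Finsupp.sum_single_index rfl,
    Finsupp.sum_single_index rfl]
  show (ab.1 : ℕ) + (ab.2 : ℕ) ≤ 2 * H
  have := ab.1.is_lt; have := ab.2.is_lt; omega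

/-! ### Siegel's lemma on the Taylor matrix at `(0, 1)` -/

set_option maxHeartbeats 400000 in
/-- **Thue–Siegel at `(0, 1)`**: for `0 ≤ τ < 2` and `β > max{τ − 1, 2τ − 2}`, for all
large `D` there is a non-zero integer vector `t` on the box `{0..⌊D/2⌋}²` with
`𝒟₁ⁿ(∑ t_{ab}X₁ᵃX₂ᵇ)(0, 1) = 0` for all `n < 3⌊D^τ⌋` and `‖t‖ ≤ exp(D^β/2)`.
[cite: Roy2013, p. 3 (Thue–Siegel's lemma)] -/
theorem exists_taylor_kernel {τ β : ℝ} (hτ0 : 0 ≤ τ) (hτ2 : τ < 2) (hβ1 : τ - 1 < β)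
    (hβ2 : 2 * τ - 2 < β) :
    ∀ᶠ D : ℕ in atTop, ∃ t : Fin (D / 2 + 1) × Fin (D / 2 + 1) → ℤ, t ≠ 0 ∧
      (∀ n : ℕ, n < 3 * ⌊(D : ℝ) ^ τ⌋₊ → taylorInt n (polyOfCoeffs t) = 0) ∧
      ‖t‖ ≤ Real.exp ((D : ℝ) ^ β / 2) := by
  have hE : (0 : ℝ) < 1 / 6 := by norm_num
  have hev := (((eventually_nat_rpow_le 60 hβ1 hE).and
    (eventually_nat_rpow_le (72 * Real.log 3) hβ2 hE)).and
    (eventually_nat_rpow_log_le hβ2 (show (0 : ℝ) ≤ 72 * τ by positivity) hE)).and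
    (eventually_nat_rpow_le 24 hτ2 (show (0 : ℝ) < 1 by norm_num))
  filter_upwards [hev, eventually_ge_atTop 1] with D hD hD1
  obtain ⟨⟨⟨e1, e2⟩, e3⟩, e4⟩ := hD
  have hD1r : (1 : ℝ) ≤ D := by exact_mod_cast hD1
  have hD0r : (0 : ℝ) < D := by linarith
  set x : ℝ := (D : ℝ) with hx
  set H : ℕ := D / 2 with hH
  set L : ℕ := 3 * ⌊x ^ τ⌋₊ with hL
  -- sizes
  have hxτ1 : 1 ≤ x ^ τ := Real.one_le_rpow hD1r hτ0
  have hL1 : 1 ≤ L := by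
    have : 1 ≤ ⌊x ^ τ⌋₊ := Nat.le_floor (by simpa using hxτ1)
    omega
  have hLx : (L : ℝ) ≤ 3 * x ^ τ := by
    rw [hL]; push_cast
    exact mul_le_mul_of_nonneg_left (Nat.floor_le (by positivity)) (by norm_num)
  have hL0 : (0 : ℝ) < L := by exact_mod_cast hL1
  have hHx : (H : ℝ) ≤ x / 2 := by
    rw [hx, le_div_iff₀ (by norm_num : (0:ℝ) < 2)]; exact_mod_cast (show H * 2 ≤ D by omega)
  have hHx' : x / 2 ≤ (H : ℝ) + 1 := by
    rw [hx, div_le_iff₀ (by norm_num : (0:ℝ) < 2)]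
    exact_mod_cast (show D ≤ (H + 1) * 2 by omega)
  set N : ℕ := (H + 1) * (H + 1) with hN
  clear_value x H L N
  have hN4 : x ^ 2 / 4 ≤ (N : ℝ) := by
    rw [hN]; push_cast
    have h2 : (x / 2) ^ 2 ≤ ((H : ℝ) + 1) ^ 2 := pow_le_pow_left₀ (by linarith) hHx' 2
    nlinarith [h2]
  have hNx : (N : ℝ) ≤ (x + 1) ^ 2 := by
    rw [hN]; push_cast
    have h2 : ((H : ℝ) + 1) ^ 2 ≤ (x + 1) ^ 2 := pow_le_pow_left₀ (by positivity) (by linarith) 2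
    nlinarith [h2]
  have hx24 : 24 * x ^ τ ≤ x ^ (2 : ℝ) := by simpa using e4
  have hx2 : x ^ (2 : ℝ) = x ^ 2 := Real.rpow_two x
  have hLN2 : 2 * (L : ℝ) ≤ N := by
    calc 2 * (L : ℝ) ≤ 6 * x ^ τ := by linarith
      _ ≤ x ^ 2 / 4 := by rw [← hx2]; linarith
      _ ≤ N := hN4
  have hLN : L < N := by
    have h2 : ((2 * L : ℕ) : ℝ) ≤ N := by push_cast; exact hLN2
    have h3 : 2 * L ≤ N := by exact_mod_cast h2
    omega
  -- Siegel (the sup norm on integer matrices, as in Mathlib's Siegel lemma, as a term-level instance)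
  letI instM : SeminormedAddCommGroup (Matrix (Fin L) (Fin (H + 1) × Fin (H + 1)) ℤ) :=
    Matrix.seminormedAddCommGroup
  obtain ⟨t, ht0, hAt, hnorm⟩ := Int.Matrix.exists_ne_zero_int_vec_norm_le (taylorMatrix L H H)
    (by rw [Fintype.card_fin, Fintype.card_prod, Fintype.card_fin, ← hN]; exact hLN)
    (by rw [Fintype.card_fin]; omega)
  refine ⟨t, ht0, fun n hn => ?_, ?_⟩
  · have := congrFun hAt ⟨n, hn⟩
    rwa [taylorMatrix_mulVec, Pi.zero_apply] at this
  · have hnorm' : ‖t‖ ≤ ((((H + 1) * (H + 1) : ℕ) : ℝ) * max 1 ‖taylorMatrix L H H‖) ^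
        ((L : ℝ) / ((((H + 1) * (H + 1) : ℕ) : ℝ) - L)) := by
      have h := hnorm
      rw [Fintype.card_fin, Fintype.card_prod, Fintype.card_fin] at h
      exact h
    refine hnorm'.trans ?_
    -- the base and the exponent
    have hA : ‖taylorMatrix L H H‖ ≤ (L : ℝ) ^ L * Real.exp H := norm_taylorMatrix_le L H H hL1
    have hmax : max 1 ‖taylorMatrix L H H‖ ≤ (L : ℝ) ^ L * Real.exp H := by
      refine max_le ?_ hA
      exact one_le_mul_of_one_le_of_one_le (one_le_pow₀ (by exact_mod_cast hL1))
        (Real.one_le_exp (by positivity))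
    have hmax1 : 1 ≤ max 1 ‖taylorMatrix L H H‖ := le_max_left _ _
    have hN1 : (1 : ℝ) ≤ (((H + 1) * (H + 1) : ℕ) : ℝ) := by
      exact_mod_cast Nat.one_le_iff_ne_zero.2 (by positivity)
    have hNcast : (((H + 1) * (H + 1) : ℕ) : ℝ) = N := by rw [hN]
    set B₀ : ℝ := (((H + 1) * (H + 1) : ℕ) : ℝ) * max 1 ‖taylorMatrix L H H‖ with hB₀
    have hB₀1 : 1 ≤ B₀ := one_le_mul_of_one_le_of_one_le hN1 hmax1
    have hB₀pos : 0 < B₀ := by linarith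
    have hlogx : 0 ≤ Real.log x := Real.log_nonneg hD1r
    have hlog3 : 0 ≤ Real.log 3 := Real.log_nonneg (by norm_num)
    have hLlogL : (L : ℝ) * Real.log L ≤ 3 * x ^ τ * (Real.log 3 + τ * Real.log x) := by
      have hlogL : Real.log L ≤ Real.log 3 + τ * Real.log x := by
        calc Real.log L ≤ Real.log (3 * x ^ τ) := Real.log_le_log hL0 hLx
          _ = Real.log 3 + τ * Real.log x := by
              rw [Real.log_mul (by norm_num) (by positivity), Real.log_rpow hD0r]
      calc (L : ℝ) * Real.log L ≤ L * (Real.log 3 + τ * Real.log x) :=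
            mul_le_mul_of_nonneg_left hlogL hL0.le
        _ ≤ 3 * x ^ τ * (Real.log 3 + τ * Real.log x) :=
            mul_le_mul_of_nonneg_right hLx (by positivity)
    have hlogB₀ : Real.log B₀ ≤ 2 * x + (3 * x ^ τ * (Real.log 3 + τ * Real.log x) + x / 2) := by
      have hlogN : Real.log (((H + 1) * (H + 1) : ℕ) : ℝ) ≤ 2 * x := by
        have h1 : Real.log (((H + 1) * (H + 1) : ℕ) : ℝ) ≤ Real.log ((x + 1) ^ 2) :=
          Real.log_le_log (by positivity) (by rw [hNcast]; exact hNx)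
        have h2 : Real.log (x + 1) ≤ x := by
          have := Real.log_le_sub_one_of_pos (show 0 < x + 1 by linarith); linarith
        have hlog2 : Real.log ((x + 1) ^ 2) = 2 * Real.log (x + 1) := by
          rw [Real.log_pow]; norm_num
        rw [hlog2] at h1; linarith
      have hlogmax : Real.log (max 1 ‖taylorMatrix L H H‖) ≤ L * Real.log L + H := by
        calc Real.log (max 1 ‖taylorMatrix L H H‖) ≤ Real.log ((L : ℝ) ^ L * Real.exp H) :=
              Real.log_le_log (by positivity) hmax
          _ = L * Real.log L + H := by
              rw [Real.log_mul (by positivity) (by positivity), Real.log_pow, Real.log_exp]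
      rw [hB₀, Real.log_mul (by positivity) (by positivity)]
      linarith
    have hlogB₀0 : 0 ≤ Real.log B₀ := Real.log_nonneg hB₀1
    have hexp_le : (L : ℝ) / ((((H + 1) * (H + 1) : ℕ) : ℝ) - L) ≤ 24 * x ^ (τ - 2) := by
      rw [hNcast]
      have hLhalf : (L : ℝ) ≤ N / 2 := by
        rw [le_div_iff₀ (two_pos : (0:ℝ) < 2), mul_comm]; exact hLN2
      have hNL : (N : ℝ) / 2 ≤ (N : ℝ) - L := by
        calc (N : ℝ) / 2 = N - N / 2 := by ring
          _ ≤ N - L := sub_le_sub_left hLhalf _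
      have hNpos' : (0 : ℝ) < N := lt_of_lt_of_le (by positivity) hN4
      have hNLpos : (0 : ℝ) < (N : ℝ) - L := lt_of_lt_of_le (half_pos hNpos') hNL
      have hNpos : (0 : ℝ) < x ^ 2 / 8 := by positivity
      have hx8 : x ^ 2 / 8 ≤ (N : ℝ) - L := by
        calc x ^ 2 / 8 = (x ^ 2 / 4) / 2 := by ring
          _ ≤ (N : ℝ) / 2 := by gcongr
          _ ≤ N - L := hNL
      calc (L : ℝ) / ((N : ℝ) - L) ≤ (3 * x ^ τ) / ((N : ℝ) - L) :=
            div_le_div_of_nonneg_right hLx hNLpos.le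
        _ ≤ (3 * x ^ τ) / (x ^ 2 / 8) :=
            div_le_div_of_nonneg_left (by positivity) hNpos hx8
        _ = 24 * (x ^ τ / x ^ 2) := by ring
        _ = 24 * x ^ (τ - 2) := by rw [← hx2, ← Real.rpow_sub hD0r]
    have hexp0 : 0 ≤ (L : ℝ) / ((((H + 1) * (H + 1) : ℕ) : ℝ) - L) := by
      rw [hNcast]
      have hLhalf : (L : ℝ) ≤ N / 2 := by
        rw [le_div_iff₀ (two_pos : (0:ℝ) < 2), mul_comm]; exact hLN2
      have hNpos' : (0 : ℝ) < N := lt_of_lt_of_le (by positivity) hN4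
      exact div_nonneg hL0.le (by
        have : (N : ℝ) / 2 ≤ N - L := by
          calc (N : ℝ) / 2 = N - N / 2 := by ring
            _ ≤ N - L := sub_le_sub_left hLhalf _
        exact (lt_of_lt_of_le (half_pos hNpos') this).le)
    -- x-power identities
    have hp1 : x ^ (τ - 2) * x = x ^ (τ - 1) := by
      rw [← Real.rpow_add_one hD0r.ne']; ring_nf
    have hp2 : x ^ (τ - 2) * x ^ τ = x ^ (2 * τ - 2) := by
      rw [← Real.rpow_add hD0r]; ring_nf
    have hxτ2 : 0 ≤ x ^ (τ - 2) := Real.rpow_nonneg hD0r.le _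
    -- assemble
    have hprod : Real.log B₀ * ((L : ℝ) / ((((H + 1) * (H + 1) : ℕ) : ℝ) - L)) ≤ x ^ β / 2 := by
      calc Real.log B₀ * ((L : ℝ) / ((((H + 1) * (H + 1) : ℕ) : ℝ) - L))
          ≤ (2 * x + (3 * x ^ τ * (Real.log 3 + τ * Real.log x) + x / 2)) * (24 * x ^ (τ - 2)) :=
            mul_le_mul hlogB₀ hexp_le hexp0 (by positivity)
        _ = 60 * (x ^ (τ - 2) * x) + 72 * Real.log 3 * (x ^ (τ - 2) * x ^ τ) +
              72 * τ * (x ^ (τ - 2) * x ^ τ) * Real.log x := by ring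
        _ = 60 * x ^ (τ - 1) + 72 * Real.log 3 * x ^ (2 * τ - 2) +
              72 * τ * x ^ (2 * τ - 2) * Real.log x := by rw [hp1, hp2]
        _ ≤ 1 / 6 * x ^ β + 1 / 6 * x ^ β + 1 / 6 * x ^ β := by linarith only [e1, e2, e3]
        _ = x ^ β / 2 := by ring
    rw [Real.rpow_def_of_pos hB₀pos]
    exact Real.exp_le_exp.2 hprod

/-- **Thue–Siegel NON-VACUITY at `(0, p/q)`**: for integers `p, q ≠ 0`, `0 ≤ τ < 2`,
`β > max{τ − 1, 2τ − 2}`, `β > 1` (to absorb the rescaling), and EVERY `ν`, the small-value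
hypothesis of the crux holds at the algebraic point `(0, p/q)` with EXACT zeros.
[cite: Roy2013, p. 3 (Thue–Siegel)] -/
theorem hyp_at_zero_rat (p q : ℤ) (hp : p ≠ 0) (hq : q ≠ 0) {τ β : ℝ} (hτ0 : 0 ≤ τ) (hτ2 : τ < 2)
    (hβ2 : 2 * τ - 2 < β) (hβ1 : 1 < β) (ν : ℝ) :
    ∀ᶠ D : ℕ in atTop, ∃ P : MvPolynomial (Fin 2) ℤ, P ≠ 0 ∧ P.totalDegree ≤ D ∧
      (mvPolyHeight P : ℝ) ≤ Real.exp ((D : ℝ) ^ β) ∧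
      ∀ i : ℕ, i < 3 * ⌊(D : ℝ) ^ τ⌋₊ →
        ‖aeval ![(0 : ℂ), (p : ℂ) / (q : ℂ)] (royD^[i] P)‖ ≤ Real.exp (-(D : ℝ) ^ ν) := by
  set R : ℝ := max |(p : ℝ)| |(q : ℝ)| with hR
  have hR1 : 1 ≤ R := by
    have : (1 : ℝ) ≤ |(p : ℝ)| := by
      have h := Int.one_le_abs hp
      exact_mod_cast h
    exact this.trans (le_max_left _ _)
  have hlogR : 0 ≤ Real.log R := Real.log_nonneg hR1
  have hev := (exists_taylor_kernel hτ0 hτ2 (by linarith) hβ2).and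
    (eventually_nat_rpow_le (Real.log R / 2) hβ1 (show (0:ℝ) < 1 / 2 by norm_num))
  filter_upwards [hev, eventually_ge_atTop 1] with D hD hD1
  obtain ⟨⟨t, ht0, hker, hnorm⟩, e1⟩ := hD
  have hD0r : (0 : ℝ) < D := by exact_mod_cast hD1
  refine ⟨polyOfCoeffs fun ab => t ab * p ^ (D / 2 - (ab.2 : ℕ)) * q ^ (ab.2 : ℕ),
    polyOfCoeffs_ne_zero (rescaled_ne_zero ht0 hp hq), ?_, ?_, fun i hi => ?_⟩
  · exact (totalDegree_polyOfCoeffs_le _).trans (by omega)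
  · refine (mvPolyHeight_polyOfCoeffs_le _).trans ((norm_rescaled_le t p q).trans ?_)
    have hH : ((D / 2 : ℕ) : ℝ) ≤ (D : ℝ) / 2 := by
      rw [le_div_iff₀ (by norm_num : (0:ℝ) < 2)]; exact_mod_cast (show D / 2 * 2 ≤ D by omega)
    have hRH : R ^ (D / 2) ≤ Real.exp ((D : ℝ) ^ β / 2) := by
      rw [← Real.rpow_natCast, Real.rpow_def_of_pos (by linarith)]
      refine Real.exp_le_exp.2 ?_
      calc Real.log R * ((D / 2 : ℕ) : ℝ) ≤ Real.log R * (D / 2) := mul_le_mul_of_nonneg_left hH hlogR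
        _ = Real.log R / 2 * (D : ℝ) ^ (1 : ℝ) := by rw [Real.rpow_one]; ring
        _ ≤ 1 / 2 * (D : ℝ) ^ β := e1
        _ = (D : ℝ) ^ β / 2 := by ring
    calc ‖t‖ * R ^ (D / 2) ≤ Real.exp ((D : ℝ) ^ β / 2) * Real.exp ((D : ℝ) ^ β / 2) :=
          mul_le_mul hnorm hRH (by positivity) (by positivity)
      _ = Real.exp ((D : ℝ) ^ β) := by rw [← Real.exp_add]; ring_nf
  · rw [aeval_rescaled t p q hq, hker i hi]
    simp [(Real.exp_pos _).le]

/-- **§5 NON-VACUITY IN THE WINDOW (Thue–Siegel)**: at every rational point `(0, p/q)`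
(`p, q ≠ 0`), for `0 ≤ τ < 2`, `β > max{1, 2τ − 2}` and EVERY `ν`, the crux's hypothesis holds (with
exact zeros). In particular the hypothesis of the crux is satisfiable INSIDE the window at
(algebraic) points, so the crux is not vacuously true. [cite: Roy2013, p. 3 (Thue–Siegel)] -/
theorem smallValueHyp_zero_rat (p q : ℤ) (hp : p ≠ 0) (hq : q ≠ 0) {τ β : ℝ} (hτ0 : 0 ≤ τ)
    (hτ2 : τ < 2) (hβ2 : 2 * τ - 2 < β) (hβ1 : 1 < β) (ν : ℝ) :
    SmallValueHyp 0 ((p : ℂ) / (q : ℂ)) β τ ν :=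
  hyp_at_zero_rat p q hp hq hτ0 hτ2 hβ2 hβ1 ν

/-- The crux's hypothesis is satisfiable in the whole parameter range of the crux (at `(0, 1)`),
for every `ν` — so `RoySmallValueDirichletGap` is NOT vacuously true. -/
theorem crux_hypothesis_satisfiable {β τ : ℝ} (h1 : 1 ≤ τ) (h2 : τ < 2) (hβ : τ < β) (ν : ℝ) :
    ∃ ξ η : ℂ, η ≠ 0 ∧ SmallValueHyp ξ η β τ ν :=
  ⟨0, 1, one_ne_zero, by
    simpa using smallValueHyp_zero_rat 1 1 one_ne_zero one_ne_zero (by linarith) h2 (by linarith)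
      (by linarith) ν⟩

end ThueSiegel


/-! ## §6 Uniformity in `D` is load-bearing: the `∃ᶠ D`-variant is FALSE at `(0, η∞)`, kernel-checked

`η∞ = ∑ₙ 2^{−2^{4ⁿ}}` (a fast Liouville number, transcendental); at the scales `D = 2·2^{4ⁿ}` the
Thue–Siegel polynomial of §5 at the rational point `(0, s_n)` (partial sum) moved to `(0, η∞)`
(distance `≤ 2·2^{−e(n)⁴}`) satisfies the hypothesis with `τ = 3/2, β = 2, ν = 13/5` — inside the gap.
(Also landed def-free as `Theorems/RoySmallValueDirichletGap/Negative/FrequentlyFalse*.lean`.) -/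

section Frequently

open Finset

/-! ### The exponent sequence `e(n) = 2^{4ⁿ}` -/

/-- `e(n+1) = e(n)⁴`. [folklore] -/
theorem e_succ (n : ℕ) : (2 : ℕ) ^ 4 ^ (n + 1) = (2 ^ 4 ^ n) ^ 4 := by
  rw [pow_succ, pow_mul]

/-- `2 ≤ e(n)`. [folklore] -/
theorem two_le_e (n : ℕ) : 2 ≤ (2 : ℕ) ^ 4 ^ n :=
  calc (2 : ℕ) = 2 ^ 1 := rfl
    _ ≤ 2 ^ 4 ^ n := Nat.pow_le_pow_right (by norm_num) (Nat.one_le_pow _ _ (by norm_num))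

/-- `e(n) + 1 ≤ e(n+1)` (indeed much more). [folklore] -/
theorem e_succ_ge (n : ℕ) : (2 : ℕ) ^ 4 ^ n + 1 ≤ 2 ^ 4 ^ (n + 1) := by
  rw [e_succ]
  have h := two_le_e n
  set x := (2 : ℕ) ^ 4 ^ n
  calc x + 1 ≤ x * x := by nlinarith
    _ ≤ x * x * (x * x) := Nat.le_mul_of_pos_right _ (by positivity)
    _ = x ^ 4 := by ring

/-- `e` is strictly monotone, quantitatively: `e(n) + i ≤ e(n + i)`. [folklore] -/
theorem e_add_ge (n i : ℕ) : (2 : ℕ) ^ 4 ^ n + i ≤ 2 ^ 4 ^ (n + i) := by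
  induction i with
  | zero => simp
  | succ i ih =>
    calc (2 : ℕ) ^ 4 ^ n + (i + 1) = (2 ^ 4 ^ n + i) + 1 := by ring
      _ ≤ 2 ^ 4 ^ (n + i) + 1 := by omega
      _ ≤ 2 ^ 4 ^ (n + i + 1) := e_succ_ge _
      _ = 2 ^ 4 ^ (n + (i + 1)) := by rw [add_assoc]

/-- `e(m) ≤ e(n)` for `m ≤ n`. [folklore] -/
theorem e_mono {m n : ℕ} (h : m ≤ n) : (2 : ℕ) ^ 4 ^ m ≤ 2 ^ 4 ^ n :=
  Nat.pow_le_pow_right (by norm_num) (Nat.pow_le_pow_right (by norm_num) h)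

/-- `n + 2 ≤ e(n)`. [folklore] -/
theorem add_two_le_e (n : ℕ) : n + 2 ≤ (2 : ℕ) ^ 4 ^ n := by
  have := e_add_ge 0 n
  simpa [add_comm] using this

/-! ### The number `η∞ = ∑ₙ 2^{-e(n)}` -/

/-- The terms are bounded by a geometric sequence: `2^{-e(n)} ≤ (1/2)^{n+2}`. [folklore] -/
theorem term_le_geom (n : ℕ) : ((2 : ℝ) ^ 2 ^ 4 ^ n)⁻¹ ≤ (1 / 2 : ℝ) ^ (n + 2) := by
  rw [one_div, inv_pow]
  exact inv_anti₀ (by positivity) (pow_le_pow_right₀ (by norm_num) (add_two_le_e n))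

/-- The terms are positive. [folklore] -/
theorem term_pos (n : ℕ) : 0 < ((2 : ℝ) ^ 2 ^ 4 ^ n)⁻¹ := by positivity

/-- The dominating geometric series is summable. [folklore] -/
theorem summable_geom_shift : Summable fun n : ℕ => (1 / 2 : ℝ) ^ (n + 2) :=
  (summable_nat_add_iff (f := fun n : ℕ => (1 / 2 : ℝ) ^ n) 2).2
    (summable_geometric_of_lt_one (by norm_num : (0:ℝ) ≤ 1 / 2) (by norm_num : (1 / 2 : ℝ) < 1))

/-- Summability of `∑ 2^{-e(n)}`. [folklore] -/
theorem summable_terms : Summable fun n : ℕ => ((2 : ℝ) ^ 2 ^ 4 ^ n)⁻¹ :=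
  Summable.of_nonneg_of_le (fun n => (term_pos n).le) term_le_geom summable_geom_shift

/-- `0 < η∞`. [folklore] -/
theorem eta_pos : 0 < ∑' n : ℕ, ((2 : ℝ) ^ 2 ^ 4 ^ n)⁻¹ :=
  summable_terms.tsum_pos (fun n => (term_pos n).le) 0 (term_pos 0)

/-- `η∞ ≤ 1/2 < 1`. [folklore] -/
theorem eta_le_half : ∑' n : ℕ, ((2 : ℝ) ^ 2 ^ 4 ^ n)⁻¹ ≤ 1 / 2 := by
  calc ∑' n : ℕ, ((2 : ℝ) ^ 2 ^ 4 ^ n)⁻¹ ≤ ∑' n : ℕ, (1 / 2 : ℝ) ^ (n + 2) :=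
        Summable.tsum_le_tsum term_le_geom summable_terms summable_geom_shift
    _ = ∑' n : ℕ, (1 / 2 : ℝ) ^ 2 * (1 / 2 : ℝ) ^ n := by
        congr 1; ext n; ring
    _ = (1 / 2 : ℝ) ^ 2 * ∑' n : ℕ, (1 / 2 : ℝ) ^ n := tsum_mul_left
    _ = 1 / 2 := by
        rw [tsum_geometric_of_lt_one (by norm_num) (by norm_num)]; norm_num

/-- The numerator of the `n`-th partial sum: `a_n = ∑_{m ≤ n} 2^{e(n) − e(m)}`. We use it inline. -/
theorem partialSum_eq (n : ℕ) :
    ∑ m ∈ range (n + 1), ((2 : ℝ) ^ 2 ^ 4 ^ m)⁻¹ =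
      ((∑ m ∈ range (n + 1), (2 : ℕ) ^ (2 ^ 4 ^ n - 2 ^ 4 ^ m) : ℕ) : ℝ) / (2 : ℝ) ^ 2 ^ 4 ^ n := by
  push_cast
  rw [Finset.sum_div]
  refine Finset.sum_congr rfl fun m hm => ?_
  have hmn : m ≤ n := Nat.lt_succ_iff.1 (Finset.mem_range.1 hm)
  have hle : 2 ^ 4 ^ m ≤ 2 ^ 4 ^ n := e_mono hmn
  rw [eq_div_iff (by positivity), ← pow_sub_mul_pow (2 : ℝ) hle, mul_comm ((2 : ℝ) ^ _) ((2 : ℝ) ^ _),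
    ← mul_assoc, inv_mul_cancel₀ (by positivity), one_mul]

/-- The numerator is positive. [folklore] -/
theorem numerator_pos (n : ℕ) : 0 < ∑ m ∈ range (n + 1), (2 : ℕ) ^ (2 ^ 4 ^ n - 2 ^ 4 ^ m) :=
  Finset.sum_pos (fun m _ => by positivity) ⟨0, by simp⟩

/-- **Tail bound**: `0 < η∞ − s_n ≤ 2 · 2^{−e(n+1)}`. [folklore] -/
theorem tail_bounds (n : ℕ) :
    0 < (∑' m : ℕ, ((2 : ℝ) ^ 2 ^ 4 ^ m)⁻¹) - ∑ m ∈ range (n + 1), ((2 : ℝ) ^ 2 ^ 4 ^ m)⁻¹ ∧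
    (∑' m : ℕ, ((2 : ℝ) ^ 2 ^ 4 ^ m)⁻¹) - ∑ m ∈ range (n + 1), ((2 : ℝ) ^ 2 ^ 4 ^ m)⁻¹ ≤
      2 * ((2 : ℝ) ^ 2 ^ 4 ^ (n + 1))⁻¹ := by
  have hsplit := (summable_terms.sum_add_tsum_nat_add (n + 1))
  have htail : (∑' m : ℕ, ((2 : ℝ) ^ 2 ^ 4 ^ m)⁻¹) - ∑ m ∈ range (n + 1), ((2 : ℝ) ^ 2 ^ 4 ^ m)⁻¹ =
      ∑' m : ℕ, ((2 : ℝ) ^ 2 ^ 4 ^ (m + (n + 1)))⁻¹ := by rw [← hsplit]; ring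
  rw [htail]
  have hsum' : Summable fun m : ℕ => ((2 : ℝ) ^ 2 ^ 4 ^ (m + (n + 1)))⁻¹ :=
    (summable_nat_add_iff (f := fun m : ℕ => ((2 : ℝ) ^ 2 ^ 4 ^ m)⁻¹) (n + 1)).2 summable_terms
  constructor
  · exact hsum'.tsum_pos (fun m => (term_pos _).le) 0 (term_pos _)
  · -- compare with the geometric series `2^{-e(n+1)} (1/2)^m`
    have hcmp : ∀ m : ℕ, ((2 : ℝ) ^ 2 ^ 4 ^ (m + (n + 1)))⁻¹ ≤ ((2 : ℝ) ^ 2 ^ 4 ^ (n + 1))⁻¹ * (1 / 2 : ℝ) ^ m := by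
      intro m
      rw [one_div, inv_pow, ← mul_inv, ← pow_add]
      refine inv_anti₀ (by positivity) (pow_le_pow_right₀ (by norm_num) ?_)
      have := e_add_ge (n + 1) m
      rw [add_comm m]; exact this
    have hgs : Summable fun m : ℕ => ((2 : ℝ) ^ 2 ^ 4 ^ (n + 1))⁻¹ * (1 / 2 : ℝ) ^ m :=
      (summable_geometric_of_lt_one (by norm_num : (0:ℝ) ≤ 1 / 2)
        (by norm_num : (1 / 2 : ℝ) < 1)).mul_left _
    calc ∑' m : ℕ, ((2 : ℝ) ^ 2 ^ 4 ^ (m + (n + 1)))⁻¹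
        ≤ ∑' m : ℕ, ((2 : ℝ) ^ 2 ^ 4 ^ (n + 1))⁻¹ * (1 / 2 : ℝ) ^ m :=
          Summable.tsum_le_tsum hcmp hsum' hgs
      _ = ((2 : ℝ) ^ 2 ^ 4 ^ (n + 1))⁻¹ * ∑' m : ℕ, (1 / 2 : ℝ) ^ m := tsum_mul_left
      _ = ((2 : ℝ) ^ 2 ^ 4 ^ (n + 1))⁻¹ * 2 := by
          rw [tsum_geometric_of_lt_one (by norm_num) (by norm_num)]; norm_num
      _ = 2 * ((2 : ℝ) ^ 2 ^ 4 ^ (n + 1))⁻¹ := by ring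

/-- The numerical heart of the Liouville property: `2 · 2^{-e(k)⁴} < (2^{e(k)})^{-k}`. [folklore] -/
theorem liouville_ineq (k : ℕ) :
    (2 : ℝ) * ((2 : ℝ) ^ (2 ^ 4 ^ k) ^ 4)⁻¹ < 1 / ((2 : ℝ) ^ 2 ^ 4 ^ k) ^ k := by
  have h2 := two_le_e k
  have hk := add_two_le_e k
  generalize 2 ^ 4 ^ k = x at h2 hk ⊢
  rw [one_div, ← pow_mul]
  have hlt : x * k + 1 < x ^ 4 := by
    calc x * k + 1 < x * x := by nlinarith
      _ ≤ x * x * (x * x) := Nat.le_mul_of_pos_right _ (by positivity)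
      _ = x ^ 4 := by ring
  have h1 : (2 : ℝ) ^ (x * k + 1) < (2 : ℝ) ^ (x ^ 4) := pow_lt_pow_right₀ (by norm_num) hlt
  rw [← div_eq_mul_inv, ← one_div, div_lt_div_iff₀ (by positivity) (by positivity), one_mul,
    ← pow_succ']
  exact h1

/-- **`η∞` is a Liouville number.** [folklore] -/
theorem liouville_eta : Liouville (∑' n : ℕ, ((2 : ℝ) ^ 2 ^ 4 ^ n)⁻¹) := by
  intro k
  -- use the partial sum of order `n = k`
  obtain ⟨hpos, hle⟩ := tail_bounds k
  rw [e_succ] at hle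
  have haR : ((((∑ m ∈ range (k + 1), (2 : ℕ) ^ (2 ^ 4 ^ k - 2 ^ 4 ^ m) : ℕ) : ℤ) : ℝ) /
      (((2 ^ 2 ^ 4 ^ k : ℕ) : ℤ) : ℝ)) = ∑ m ∈ range (k + 1), ((2 : ℝ) ^ 2 ^ 4 ^ m)⁻¹ := by
    rw [partialSum_eq k]; push_cast; ring
  have hbR : (((2 ^ 2 ^ 4 ^ k : ℕ) : ℤ) : ℝ) = (2 : ℝ) ^ 2 ^ 4 ^ k := by push_cast; ring
  refine ⟨(∑ m ∈ range (k + 1), (2 : ℕ) ^ (2 ^ 4 ^ k - 2 ^ 4 ^ m) : ℕ), (2 ^ 2 ^ 4 ^ k : ℕ), ?_, ?_, ?_⟩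
  · exact_mod_cast one_lt_pow₀ (by norm_num : (1 : ℕ) < 2) (by positivity : 2 ^ 4 ^ k ≠ 0)
  · intro heq
    rw [haR] at heq
    linarith
  · rw [haR, hbR, abs_of_pos hpos]
    exact lt_of_le_of_lt hle (liouville_ineq k)


/-- **`η∞` is transcendental** (as a complex number, over `ℚ`). [folklore] -/
theorem transcendental_eta : ¬ IsAlgebraic ℚ ((∑' n : ℕ, ((2 : ℝ) ^ 2 ^ 4 ^ n)⁻¹ : ℝ) : ℂ) := by
  intro halg
  haveI : Algebra.IsAlgebraic ℤ ℚ := IsLocalization.isAlgebraic ℚ (nonZeroDivisors ℤ)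
  have hZ : IsAlgebraic ℤ ((∑' n : ℕ, ((2 : ℝ) ^ 2 ^ 4 ^ n)⁻¹ : ℝ) : ℂ) := halg.restrictScalars ℤ
  have hZ' : IsAlgebraic ℤ (algebraMap ℝ ℂ (∑' n : ℕ, ((2 : ℝ) ^ 2 ^ 4 ^ n)⁻¹)) := by
    rw [Complex.coe_algebraMap]; exact hZ
  have hR : IsAlgebraic ℤ (∑' n : ℕ, ((2 : ℝ) ^ 2 ^ 4 ^ n)⁻¹) :=
    (isAlgebraic_algebraMap_iff (algebraMap ℝ ℂ).injective).1 hZ'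
  exact liouville_eta.transcendental hR

/-! ### Perturbation of the values of `𝒟₁ⁿ` in the second coordinate -/

/-- `‖y^b − r^b‖ ≤ H ‖y − r‖` on the unit disc, for `b ≤ H`. [folklore] -/
theorem norm_pow_sub_pow_le_of_le {y r : ℂ} (hy : ‖y‖ ≤ 1) (hr : ‖r‖ ≤ 1) {b H : ℕ} (hb : b ≤ H) :
    ‖y ^ b - r ^ b‖ ≤ H * ‖y - r‖ := by
  have key : ∀ b : ℕ, ‖y ^ b - r ^ b‖ ≤ b * ‖y - r‖ := by
    intro b
    induction b with
    | zero => simp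
    | succ b ih =>
      have hsplit : y ^ (b + 1) - r ^ (b + 1) = y * (y ^ b - r ^ b) + (y - r) * r ^ b := by ring
      rw [hsplit]
      calc ‖y * (y ^ b - r ^ b) + (y - r) * r ^ b‖
          ≤ ‖y‖ * ‖y ^ b - r ^ b‖ + ‖y - r‖ * ‖r‖ ^ b := by
            refine (norm_add_le _ _).trans ?_
            rw [norm_mul, norm_mul, norm_pow]
        _ ≤ 1 * (b * ‖y - r‖) + ‖y - r‖ * 1 := by
            gcongr
            exact pow_le_one₀ (norm_nonneg _) hr
        _ = (b + 1 : ℕ) * ‖y - r‖ := by push_cast; ring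
  exact (key b).trans (mul_le_mul_of_nonneg_right (by exact_mod_cast hb) (norm_nonneg _))

/-- **Perturbation bound**: for a box polynomial `Q = ∑ t_{ab}X₁ᵃX₂ᵇ` on `{0..H}²` and `|y|, |r| ≤ 1`,
`|𝒟₁ⁿQ(0, y) − 𝒟₁ⁿQ(0, r)| ≤ (H+1)² ‖t‖ · n! e^H · H |y − r|`. [folklore] -/
theorem norm_aeval_zero_sub_le {H : ℕ} (t : Fin (H + 1) × Fin (H + 1) → ℤ) (n : ℕ) {y r : ℂ}
    (hy : ‖y‖ ≤ 1) (hr : ‖r‖ ≤ 1) :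
    ‖aeval ![0, y] (royD^[n] (polyOfCoeffs t)) - aeval ![0, r] (royD^[n] (polyOfCoeffs t))‖ ≤
      (((H + 1) * (H + 1) : ℕ) : ℝ) * ‖t‖ * (n.factorial * Real.exp H) * (H * ‖y - r‖) := by
  rw [aeval_zero_iterate_royD_polyOfCoeffs, aeval_zero_iterate_royD_polyOfCoeffs, ← Finset.sum_sub_distrib]
  calc ‖∑ ab : Fin (H + 1) × Fin (H + 1), ((t ab : ℂ) * (y ^ (ab.2 : ℕ) * (taylorInt n (monoXY ab.1 ab.2) : ℂ)) -
          (t ab : ℂ) * (r ^ (ab.2 : ℕ) * (taylorInt n (monoXY ab.1 ab.2) : ℂ)))‖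
      ≤ ∑ ab : Fin (H + 1) × Fin (H + 1), ‖(t ab : ℂ) * (y ^ (ab.2 : ℕ) * (taylorInt n (monoXY ab.1 ab.2) : ℂ)) -
          (t ab : ℂ) * (r ^ (ab.2 : ℕ) * (taylorInt n (monoXY ab.1 ab.2) : ℂ))‖ := norm_sum_le _ _
    _ ≤ ∑ _ab : Fin (H + 1) × Fin (H + 1), ‖t‖ * (n.factorial * Real.exp H) * (H * ‖y - r‖) := by
        refine Finset.sum_le_sum fun ab _ => ?_
        have hb : (ab.2 : ℕ) ≤ H := Nat.lt_succ_iff.1 ab.2.isLt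
        have hfac : (t ab : ℂ) * (y ^ (ab.2 : ℕ) * (taylorInt n (monoXY ab.1 ab.2) : ℂ)) -
            (t ab : ℂ) * (r ^ (ab.2 : ℕ) * (taylorInt n (monoXY ab.1 ab.2) : ℂ)) =
            (t ab : ℂ) * (taylorInt n (monoXY ab.1 ab.2) : ℂ) * (y ^ (ab.2 : ℕ) - r ^ (ab.2 : ℕ)) := by ring
        rw [hfac, norm_mul, norm_mul, Complex.norm_intCast, Complex.norm_intCast]
        have h1 : |(t ab : ℝ)| ≤ ‖t‖ := by
          have := norm_le_pi_norm t ab; rwa [Int.norm_eq_abs] at this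
        have h2 : |(taylorInt n (monoXY ab.1 ab.2) : ℝ)| ≤ n.factorial * Real.exp H := by
          have h : |(taylorInt n (monoXY ab.1 ab.2) : ℝ)| ≤ n.factorial * Real.exp (ab.2 : ℕ) := by
            have h' := abs_taylorInt_monoXY_le n ab.1 ab.2
            simpa [Int.cast_abs] using h'
          refine h.trans (mul_le_mul_of_nonneg_left (Real.exp_le_exp.2 (by exact_mod_cast hb)) ?_)
          positivity
        have h3 : ‖y ^ (ab.2 : ℕ) - r ^ (ab.2 : ℕ)‖ ≤ H * ‖y - r‖ :=
          norm_pow_sub_pow_le_of_le hy hr hb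
        have h0' : 0 ≤ |(taylorInt n (monoXY ab.1 ab.2) : ℝ)| := abs_nonneg _
        exact mul_le_mul (mul_le_mul h1 h2 h0' (norm_nonneg _)) h3 (norm_nonneg _) (by positivity)
    _ = (((H + 1) * (H + 1) : ℕ) : ℝ) * ‖t‖ * (n.factorial * Real.exp H) * (H * ‖y - r‖) := by
        rw [Finset.sum_const, Finset.card_univ, nsmul_eq_mul]
        simp [Fintype.card_prod, Fintype.card_fin, mul_assoc]

/-! ### The numerical inequality at the scales `D = 2h`, `h = e(n)` -/

/-- `2^{3/2} ≤ 3` and `2^ν ≤ 16` for `ν ≤ 4`. [folklore] -/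
theorem two_rpow_bounds {ν : ℝ} (hν : ν ≤ 4) : (2 : ℝ) ^ ((3 : ℝ) / 2) ≤ 3 ∧ (2 : ℝ) ^ ν ≤ 16 := by
  constructor
  · have h : ((2 : ℝ) ^ ((3 : ℝ) / 2)) ^ (2 : ℕ) ≤ (3 : ℝ) ^ (2 : ℕ) := by
      rw [← Real.rpow_natCast, ← Real.rpow_mul (by norm_num)]; norm_num
    exact le_of_pow_le_pow_left₀ (by norm_num) (by norm_num) h
  · calc (2 : ℝ) ^ ν ≤ (2 : ℝ) ^ (4 : ℝ) := Real.rpow_le_rpow_of_exponent_le (by norm_num) hν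
      _ = 16 := by norm_num

set_option maxHeartbeats 400000 in
/-- **The numerical inequality**: for `ν < 4`, eventually in `h`,
`(h+1)² · (e^{2h²} 2^{h²}) · (L^L e^h) · (h · 2·2^{−h⁴}) ≤ exp(−(2h)^ν)`, `L = 3⌊(2h)^{3/2}⌋`.
[folklore] -/
theorem numerics {ν : ℝ} (hν : ν < 4) : ∀ᶠ h : ℕ in atTop,
    ((h : ℝ) + 1) ^ 2 * (Real.exp (2 * (h : ℝ) ^ 2) * (2 : ℝ) ^ (h * h)) *
      (((3 * ⌊(2 * (h : ℝ)) ^ ((3 : ℝ) / 2)⌋₊ : ℕ) : ℝ) ^ (3 * ⌊(2 * (h : ℝ)) ^ ((3 : ℝ) / 2)⌋₊) *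
        Real.exp h) *
      ((h : ℝ) * (2 * ((2 : ℝ) ^ (h ^ 4))⁻¹)) ≤ Real.exp (-(2 * (h : ℝ)) ^ ν) := by
  have hc : (0 : ℝ) < Real.log 2 / 16 := by have := Real.log_pos (by norm_num : (1:ℝ) < 2); positivity
  have hev := (((((eventually_nat_rpow_le 6 (show (1 : ℝ) < 4 by norm_num) hc).and
    (eventually_nat_rpow_le (2 + Real.log 2) (show (2 : ℝ) < 4 by norm_num) hc)).and
    (eventually_nat_rpow_le (9 * Real.log 9) (show (3 : ℝ) / 2 < 4 by norm_num) hc)).and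
    (eventually_nat_rpow_log_le (show (3 : ℝ) / 2 < 4 by norm_num) (show (0:ℝ) ≤ 27 / 2 by norm_num) hc)).and
    (eventually_nat_rpow_le 16 hν hc)).and
    (eventually_nat_rpow_le (Real.log 2) (show (0 : ℝ) < 4 by norm_num) hc)
  filter_upwards [hev, eventually_ge_atTop 1] with h hh hh1
  obtain ⟨⟨⟨⟨⟨e1, e2⟩, e3⟩, e4⟩, e5⟩, e6⟩ := hh
  have hx1 : (1 : ℝ) ≤ h := by exact_mod_cast hh1
  have hx0 : (0 : ℝ) < h := by linarith
  set x : ℝ := (h : ℝ) with hx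
  -- the count `L`
  set L : ℕ := 3 * ⌊(2 * x) ^ ((3 : ℝ) / 2)⌋₊ with hL
  have h2x : (2 * x) ^ ((3 : ℝ) / 2) = (2 : ℝ) ^ ((3 : ℝ) / 2) * x ^ ((3 : ℝ) / 2) :=
    Real.mul_rpow (by norm_num) hx0.le
  have hx32 : 1 ≤ x ^ ((3 : ℝ) / 2) := Real.one_le_rpow hx1 (by norm_num)
  have hLx : (L : ℝ) ≤ 9 * x ^ ((3 : ℝ) / 2) := by
    rw [hL]; push_cast
    calc (3 : ℝ) * ⌊(2 * x) ^ ((3 : ℝ) / 2)⌋₊ ≤ 3 * (2 * x) ^ ((3 : ℝ) / 2) :=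
          mul_le_mul_of_nonneg_left (Nat.floor_le (by positivity)) (by norm_num)
      _ = 3 * (2 : ℝ) ^ ((3 : ℝ) / 2) * x ^ ((3 : ℝ) / 2) := by rw [h2x]; ring
      _ ≤ 3 * 3 * x ^ ((3 : ℝ) / 2) := by gcongr; exact (two_rpow_bounds hν.le).1
      _ = 9 * x ^ ((3 : ℝ) / 2) := by ring
  have hL1 : 1 ≤ L := by
    have : 1 ≤ ⌊(2 * x) ^ ((3 : ℝ) / 2)⌋₊ := Nat.le_floor (by
      rw [h2x]; push_cast
      exact one_le_mul_of_one_le_of_one_le (Real.one_le_rpow (by norm_num) (by norm_num)) hx32)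
    omega
  have hL0 : (0 : ℝ) < L := by exact_mod_cast hL1
  clear_value x L
  have hlogx : 0 ≤ Real.log x := Real.log_nonneg hx1
  have hlog9 : 0 ≤ Real.log 9 := Real.log_nonneg (by norm_num)
  have hlog2 : 0 < Real.log 2 := Real.log_pos (by norm_num)
  have hLlogL : (L : ℝ) * Real.log L ≤ 9 * Real.log 9 * x ^ ((3 : ℝ) / 2) +
      27 / 2 * x ^ ((3 : ℝ) / 2) * Real.log x := by
    have hlogL : Real.log L ≤ Real.log 9 + 3 / 2 * Real.log x := by
      calc Real.log L ≤ Real.log (9 * x ^ ((3 : ℝ) / 2)) := Real.log_le_log hL0 hLx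
        _ = Real.log 9 + 3 / 2 * Real.log x := by
            rw [Real.log_mul (by norm_num) (by positivity), Real.log_rpow hx0]
    calc (L : ℝ) * Real.log L ≤ L * (Real.log 9 + 3 / 2 * Real.log x) :=
          mul_le_mul_of_nonneg_left hlogL hL0.le
      _ ≤ 9 * x ^ ((3 : ℝ) / 2) * (Real.log 9 + 3 / 2 * Real.log x) :=
          mul_le_mul_of_nonneg_right hLx (by positivity)
      _ = _ := by ring
  -- rewrite every factor as an exponential
  have hf1 : (x + 1) ^ 2 ≤ Real.exp (2 * x) := by
    have h1 : x + 1 ≤ Real.exp x := by have := Real.add_one_le_exp x; linarith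
    calc (x + 1) ^ 2 ≤ (Real.exp x) ^ 2 := pow_le_pow_left₀ (by linarith) h1 2
      _ = Real.exp (2 * x) := by rw [← Real.exp_nat_mul]; norm_num
  have hf2 : (2 : ℝ) ^ (h * h) = Real.exp (x ^ 2 * Real.log 2) := by
    rw [← Real.rpow_natCast, Real.rpow_def_of_pos (by norm_num), hx]; push_cast; ring_nf
  have hf3 : (L : ℝ) ^ L = Real.exp (L * Real.log L) := by
    rw [← Real.rpow_natCast, Real.rpow_def_of_pos hL0]; ring_nf
  have hf4 : x ≤ Real.exp x := by have := Real.add_one_le_exp x; linarith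
  have hf5 : (2 : ℝ) * ((2 : ℝ) ^ (h ^ 4))⁻¹ = Real.exp (Real.log 2 - x ^ 4 * Real.log 2) := by
    rw [Real.exp_sub, Real.exp_log (by norm_num), ← Real.rpow_natCast, Real.rpow_def_of_pos (by norm_num),
      hx, div_eq_mul_inv]
    push_cast; ring_nf
  -- the exponent bookkeeping
  have hx4 : x ^ (4 : ℝ) = x ^ 4 := by exact_mod_cast Real.rpow_natCast x 4
  have hxr1 : x ^ (1 : ℝ) = x := Real.rpow_one x
  have hxr2 : x ^ (2 : ℝ) = x ^ 2 := Real.rpow_two x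
  have hxr0 : x ^ (0 : ℝ) = 1 := Real.rpow_zero x
  rw [hx4] at e1 e2 e3 e4 e5 e6
  rw [hxr1] at e1
  rw [hxr2] at e2
  rw [hxr0, mul_one] at e6
  have h26 : (2 * x) ^ ν ≤ 16 * x ^ ν := by
    rw [Real.mul_rpow (by norm_num) hx0.le]
    exact mul_le_mul_of_nonneg_right (two_rpow_bounds hν.le).2 (by positivity)
  have hexpo : 2 * x + 2 * x ^ 2 + x ^ 2 * Real.log 2 + L * Real.log L + x + x +
      (Real.log 2 - x ^ 4 * Real.log 2) ≤ -(2 * x) ^ ν := by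
    have hsum : 2 * x + 2 * x ^ 2 + x ^ 2 * Real.log 2 + L * Real.log L + x + x + Real.log 2 +
        (2 * x) ^ ν ≤ x ^ 4 * Real.log 2 := by
      have : 6 * x + (2 + Real.log 2) * x ^ 2 + (9 * Real.log 9 * x ^ ((3 : ℝ) / 2) +
          27 / 2 * x ^ ((3 : ℝ) / 2) * Real.log x) + 16 * x ^ ν + Real.log 2 ≤
          6 * (Real.log 2 / 16 * x ^ 4) := by linarith only [e1, e2, e3, e4, e5, e6]
      have hx4pos : 0 ≤ x ^ 4 * Real.log 2 := by positivity
      linarith only [this, hLlogL, h26, hx4pos, hx0]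
    linarith only [hsum]
  -- assemble
  calc (x + 1) ^ 2 * (Real.exp (2 * x ^ 2) * (2 : ℝ) ^ (h * h)) * ((L : ℝ) ^ L * Real.exp x) *
        (x * (2 * ((2 : ℝ) ^ (h ^ 4))⁻¹))
      ≤ Real.exp (2 * x) * (Real.exp (2 * x ^ 2) * Real.exp (x ^ 2 * Real.log 2)) *
        (Real.exp (L * Real.log L) * Real.exp x) * (Real.exp x * Real.exp (Real.log 2 - x ^ 4 * Real.log 2)) := by
          rw [hf2, hf3, hf5]
          gcongr
    _ = Real.exp (2 * x + 2 * x ^ 2 + x ^ 2 * Real.log 2 + L * Real.log L + x + x +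
          (Real.log 2 - x ^ 4 * Real.log 2)) := by simp only [← Real.exp_add]; ring_nf
    _ ≤ Real.exp (-(2 * x) ^ ν) := Real.exp_le_exp.2 hexpo


/-! ### Assembly: the hypothesis holds for infinitely many `D` at `(0, η∞)` -/

set_option maxHeartbeats 400000 in
/-- **At the transcendental point `(0, η∞)` the small-value hypothesis of the crux holds for
INFINITELY MANY `D`**, with `τ = 3/2`, `β = 2` and ANY `ν < 4` (this covers the whole open
window `(5/2, 8/3]` of the crux AND Roy's proved range above it, so "for each sufficiently large `D`"
is load-bearing already in the printed Theorem 1.1): at the scales `D = 2e(n)`, take the Thue–Siegel polynomial with exact zeros at the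
rational point `(0, s_n)` (`s_n` the `n`-th partial sum of `η∞`) and move to `(0, η∞)`, at distance
`≤ 2·2^{−e(n)⁴}`. [folklore] -/
theorem frequently_hyp_at_eta {ν : ℝ} (hν : ν < 4) :
    ∃ᶠ D : ℕ in atTop, ∃ P : MvPolynomial (Fin 2) ℤ, P ≠ 0 ∧ P.totalDegree ≤ D ∧
      (mvPolyHeight P : ℝ) ≤ Real.exp ((D : ℝ) ^ (2 : ℝ)) ∧
      ∀ i : ℕ, i < 3 * ⌊(D : ℝ) ^ ((3 : ℝ) / 2)⌋₊ →
        ‖aeval ![(0 : ℂ), ((∑' m : ℕ, ((2 : ℝ) ^ 2 ^ 4 ^ m)⁻¹ : ℝ) : ℂ)] (royD^[i] P)‖ ≤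
          Real.exp (-(D : ℝ) ^ ν) := by
  rw [Filter.frequently_atTop]
  intro N
  obtain ⟨D₀, hD₀⟩ := Filter.eventually_atTop.1
    (exists_taylor_kernel (τ := 3 / 2) (β := 2) (by norm_num) (by norm_num) (by norm_num) (by norm_num))
  obtain ⟨h₀, hh₀⟩ := Filter.eventually_atTop.1 (numerics hν)
  -- the index `n`, the scale `h = e(n)`, `D = 2h`
  obtain ⟨n, hn⟩ : ∃ n : ℕ, n = N + D₀ + h₀ := ⟨_, rfl⟩
  obtain ⟨h, hh⟩ : ∃ h : ℕ, h = 2 ^ 4 ^ n := ⟨_, rfl⟩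
  have hnh : n + 2 ≤ h := hh ▸ add_two_le_e n
  have hh1 : 1 ≤ h := by omega
  refine ⟨2 * h, by omega, ?_⟩
  obtain ⟨t, ht0, hker, hnorm⟩ := hD₀ (2 * h) (by omega)
  have hnum := hh₀ h (by omega)
  have hK : 2 * h / 2 = h := by omega
  have hKr : ((2 * h / 2 : ℕ) : ℝ) = (h : ℝ) := by rw [hK]
  have hDr : ((2 * h : ℕ) : ℝ) = 2 * (h : ℝ) := by push_cast; ring
  have hx1 : (1 : ℝ) ≤ h := by exact_mod_cast hh1
  have hx0 : (0 : ℝ) < h := by linarith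
  -- the number and its `n`-th partial sum
  have hηpos := eta_pos
  have hηhalf := eta_le_half
  obtain ⟨htail0, htail⟩ := tail_bounds n
  rw [e_succ, ← hh] at htail
  have ha0 : 0 < ∑ m ∈ range (n + 1), (2 : ℕ) ^ (2 ^ 4 ^ n - 2 ^ 4 ^ m) := numerator_pos n
  obtain ⟨a, ha⟩ : ∃ a : ℕ, a = ∑ m ∈ range (n + 1), (2 : ℕ) ^ (2 ^ 4 ^ n - 2 ^ 4 ^ m) := ⟨_, rfl⟩
  rw [← ha] at ha0
  have hs : ∑ m ∈ range (n + 1), ((2 : ℝ) ^ 2 ^ 4 ^ m)⁻¹ = (a : ℝ) / (2 : ℝ) ^ h := by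
    rw [partialSum_eq n, ← ha, ← hh]
  rw [hs] at htail0 htail
  have ha0z : ((a : ℕ) : ℤ) ≠ 0 := by exact_mod_cast ha0.ne'
  have hq0 : ((2 : ℤ) ^ h) ≠ 0 := by positivity
  have hs_le : (a : ℝ) / (2 : ℝ) ^ h ≤ 1 := by linarith
  have hs_pos : 0 < (a : ℝ) / (2 : ℝ) ^ h := by positivity
  have ha_le : (a : ℝ) ≤ (2 : ℝ) ^ h := by
    rwa [div_le_one (by positivity)] at hs_le
  -- the complex points
  have hy1 : ‖((∑' m : ℕ, ((2 : ℝ) ^ 2 ^ 4 ^ m)⁻¹ : ℝ) : ℂ)‖ ≤ 1 := by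
    rw [Complex.norm_real, Real.norm_eq_abs, abs_of_pos hηpos]; linarith
  have hr1 : ‖(((a : ℝ) / (2 : ℝ) ^ h : ℝ) : ℂ)‖ ≤ 1 := by
    rw [Complex.norm_real, Real.norm_eq_abs, abs_of_pos hs_pos]; exact hs_le
  have hpt : ((((a : ℕ) : ℤ) : ℂ) / ((((2 : ℤ) ^ h : ℤ)) : ℂ)) = (((a : ℝ) / (2 : ℝ) ^ h : ℝ) : ℂ) := by
    push_cast; ring
  have hdist : ‖((∑' m : ℕ, ((2 : ℝ) ^ 2 ^ 4 ^ m)⁻¹ : ℝ) : ℂ) - (((a : ℝ) / (2 : ℝ) ^ h : ℝ) : ℂ)‖ ≤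
      2 * ((2 : ℝ) ^ h ^ 4)⁻¹ := by
    rw [← Complex.ofReal_sub, Complex.norm_real, Real.norm_eq_abs, abs_of_pos htail0]
    exact htail
  -- the polynomial
  refine ⟨polyOfCoeffs fun ab => t ab * ((a : ℕ) : ℤ) ^ (2 * h / 2 - (ab.2 : ℕ)) * ((2 : ℤ) ^ h) ^ (ab.2 : ℕ),
    polyOfCoeffs_ne_zero (rescaled_ne_zero ht0 ha0z hq0), ?_, ?_, ?_⟩
  · exact (totalDegree_polyOfCoeffs_le _).trans (by omega)
  · -- height
    have hR : max |(((a : ℕ) : ℤ) : ℝ)| |((((2 : ℤ) ^ h : ℤ)) : ℝ)| ≤ (2 : ℝ) ^ h := by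
      refine max_le ?_ ?_
      · push_cast; rw [abs_of_nonneg (by positivity)]; exact ha_le
      · push_cast; rw [abs_of_nonneg (by positivity)]
    have ht' := norm_rescaled_le t ((a : ℕ) : ℤ) ((2 : ℤ) ^ h)
    have hRpow : (max |(((a : ℕ) : ℤ) : ℝ)| |((((2 : ℤ) ^ h : ℤ)) : ℝ)|) ^ (2 * h / 2) =
        (max |(((a : ℕ) : ℤ) : ℝ)| |((((2 : ℤ) ^ h : ℤ)) : ℝ)|) ^ h := by rw [hK]
    rw [hRpow] at ht'
    have hnorm' : ‖t‖ ≤ Real.exp (2 * (h : ℝ) ^ 2) := by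
      refine hnorm.trans (le_of_eq ?_)
      rw [hDr, Real.rpow_two]; ring_nf
    have h2hh : ((2 : ℝ) ^ h) ^ h ≤ Real.exp (2 * (h : ℝ) ^ 2) := by
      rw [← pow_mul, ← Real.rpow_natCast, Real.rpow_def_of_pos (by norm_num)]
      refine Real.exp_le_exp.2 ?_
      have hl2 : Real.log 2 ≤ 2 := by have := Real.log_two_lt_d9; linarith
      push_cast
      nlinarith [hl2, sq_nonneg (h : ℝ)]
    calc (mvPolyHeight (polyOfCoeffs fun ab => t ab * ((a : ℕ) : ℤ) ^ (2 * h / 2 - (ab.2 : ℕ)) *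
            ((2 : ℤ) ^ h) ^ (ab.2 : ℕ)) : ℝ)
        ≤ ‖t‖ * (max |(((a : ℕ) : ℤ) : ℝ)| |((((2 : ℤ) ^ h : ℤ)) : ℝ)|) ^ h :=
          (mvPolyHeight_polyOfCoeffs_le _).trans ht'
      _ ≤ Real.exp (2 * (h : ℝ) ^ 2) * ((2 : ℝ) ^ h) ^ h := by gcongr
      _ ≤ Real.exp (2 * (h : ℝ) ^ 2) * Real.exp (2 * (h : ℝ) ^ 2) := by gcongr
      _ = Real.exp (((2 * h : ℕ) : ℝ) ^ (2 : ℝ)) := by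
          rw [← Real.exp_add, hDr, Real.rpow_two]; ring_nf
  · -- values
    intro i hi
    rw [hDr] at hi ⊢
    have hzero : aeval ![(0 : ℂ), ((((a : ℕ) : ℤ) : ℂ) / ((((2 : ℤ) ^ h : ℤ)) : ℂ))]
        (royD^[i] (polyOfCoeffs fun ab => t ab * ((a : ℕ) : ℤ) ^ (2 * h / 2 - (ab.2 : ℕ)) *
          ((2 : ℤ) ^ h) ^ (ab.2 : ℕ))) = 0 := by
      rw [aeval_rescaled t ((a : ℕ) : ℤ) ((2 : ℤ) ^ h) hq0 i, hker i (by rwa [hDr]), Int.cast_zero,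
        mul_zero]
    rw [hpt] at hzero
    have key := norm_aeval_zero_sub_le
      (fun ab => t ab * ((a : ℕ) : ℤ) ^ (2 * h / 2 - (ab.2 : ℕ)) * ((2 : ℤ) ^ h) ^ (ab.2 : ℕ)) i hy1 hr1
    rw [hzero, sub_zero] at key
    refine key.trans ?_
    -- bound the four factors
    have hL1 : 1 ≤ 3 * ⌊(2 * (h : ℝ)) ^ ((3 : ℝ) / 2)⌋₊ := by
      have : 1 ≤ ⌊(2 * (h : ℝ)) ^ ((3 : ℝ) / 2)⌋₊ := Nat.le_floor (by
        have : (1 : ℝ) ≤ (2 * (h : ℝ)) ^ ((3 : ℝ) / 2) := Real.one_le_rpow (by linarith) (by norm_num)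
        simpa using this)
      omega
    have hfac : (i.factorial : ℝ) ≤
        ((3 * ⌊(2 * (h : ℝ)) ^ ((3 : ℝ) / 2)⌋₊ : ℕ) : ℝ) ^ (3 * ⌊(2 * (h : ℝ)) ^ ((3 : ℝ) / 2)⌋₊) := by
      have h1 : i.factorial ≤ i ^ i := Nat.factorial_le_pow i
      have h2 : i ^ i ≤ (3 * ⌊(2 * (h : ℝ)) ^ ((3 : ℝ) / 2)⌋₊) ^ i := Nat.pow_le_pow_left hi.le i
      have h3 : (3 * ⌊(2 * (h : ℝ)) ^ ((3 : ℝ) / 2)⌋₊) ^ i ≤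
          (3 * ⌊(2 * (h : ℝ)) ^ ((3 : ℝ) / 2)⌋₊) ^ (3 * ⌊(2 * (h : ℝ)) ^ ((3 : ℝ) / 2)⌋₊) :=
        Nat.pow_le_pow_right hL1 hi.le
      exact_mod_cast h1.trans (h2.trans h3)
    have ht' := norm_rescaled_le t ((a : ℕ) : ℤ) ((2 : ℤ) ^ h)
    have hRpow : (max |(((a : ℕ) : ℤ) : ℝ)| |((((2 : ℤ) ^ h : ℤ)) : ℝ)|) ^ (2 * h / 2) =
        (max |(((a : ℕ) : ℤ) : ℝ)| |((((2 : ℤ) ^ h : ℤ)) : ℝ)|) ^ h := by rw [hK]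
    rw [hRpow] at ht'
    have hR : max |(((a : ℕ) : ℤ) : ℝ)| |((((2 : ℤ) ^ h : ℤ)) : ℝ)| ≤ (2 : ℝ) ^ h := by
      refine max_le ?_ ?_
      · push_cast; rw [abs_of_nonneg (by positivity)]; exact ha_le
      · push_cast; rw [abs_of_nonneg (by positivity)]
    have hnorm' : ‖t‖ ≤ Real.exp (2 * (h : ℝ) ^ 2) := by
      refine hnorm.trans (le_of_eq ?_)
      rw [hDr, Real.rpow_two]; ring_nf
    have htt : ‖(fun ab : Fin (2 * h / 2 + 1) × Fin (2 * h / 2 + 1) =>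
        t ab * ((a : ℕ) : ℤ) ^ (2 * h / 2 - (ab.2 : ℕ)) * ((2 : ℤ) ^ h) ^ (ab.2 : ℕ))‖ ≤
        Real.exp (2 * (h : ℝ) ^ 2) * (2 : ℝ) ^ (h * h) := by
      refine ht'.trans ?_
      rw [pow_mul]
      gcongr
    have hcard : ((((2 * h / 2 + 1) * (2 * h / 2 + 1)) : ℕ) : ℝ) = ((h : ℝ) + 1) ^ 2 := by
      rw [hK]; push_cast; ring
    calc ((((2 * h / 2 + 1) * (2 * h / 2 + 1)) : ℕ) : ℝ) *
          ‖(fun ab : Fin (2 * h / 2 + 1) × Fin (2 * h / 2 + 1) =>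
            t ab * ((a : ℕ) : ℤ) ^ (2 * h / 2 - (ab.2 : ℕ)) * ((2 : ℤ) ^ h) ^ (ab.2 : ℕ))‖ *
          ((i.factorial : ℝ) * Real.exp ((2 * h / 2 : ℕ) : ℝ)) *
          (((2 * h / 2 : ℕ) : ℝ) * ‖((∑' m : ℕ, ((2 : ℝ) ^ 2 ^ 4 ^ m)⁻¹ : ℝ) : ℂ) -
            (((a : ℝ) / (2 : ℝ) ^ h : ℝ) : ℂ)‖)
        ≤ ((h : ℝ) + 1) ^ 2 * (Real.exp (2 * (h : ℝ) ^ 2) * (2 : ℝ) ^ (h * h)) *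
          (((3 * ⌊(2 * (h : ℝ)) ^ ((3 : ℝ) / 2)⌋₊ : ℕ) : ℝ) ^ (3 * ⌊(2 * (h : ℝ)) ^ ((3 : ℝ) / 2)⌋₊) *
            Real.exp h) *
          ((h : ℝ) * (2 * ((2 : ℝ) ^ (h ^ 4))⁻¹)) := by
          rw [hcard, hKr]
          gcongr
      _ ≤ Real.exp (-(2 * (h : ℝ)) ^ ν) := hnum

/-- **UNIFORMITY IN `D` IS LOAD-BEARING**: the variant of `RoySmallValueDirichletGap` in which the
small-value hypothesis is only required for INFINITELY MANY `D` (`∃ᶠ D` in place of "for each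
sufficiently large `D`") is FALSE — at the transcendental point `(0, η∞)`, `η∞ = ∑ₙ 2^{-2^{4ⁿ}}`,
with `τ = 3/2`, `β = 2`, `ν = 13/5` (inside the gap `(5/2, 8/3]`). So any proof of the crux must use
the hypothesis at (essentially) consecutive scales, as Roy's descent does.
[cite: Roy2013, Theorem 1.1 ("for each sufficiently large positive integer D")] -/
theorem roySmallValueDirichletGap_false_with_frequently :
    ¬ (∀ (ξ η : ℂ), η ≠ 0 → ∀ (β τ ν : ℝ), 1 ≤ τ → τ < 2 → τ < β → 2 + β - τ < ν →
      (∃ᶠ D : ℕ in Filter.atTop, ∃ P : MvPolynomial (Fin 2) ℤ, P ≠ 0 ∧ P.totalDegree ≤ D ∧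
        (mvPolyHeight P : ℝ) ≤ Real.exp ((D : ℝ) ^ β) ∧
        ∀ i : ℕ, i < 3 * ⌊(D : ℝ) ^ τ⌋₊ →
          ‖MvPolynomial.aeval ![ξ, η] (royD^[i] P)‖ ≤ Real.exp (-(D : ℝ) ^ ν)) →
      IsAlgebraic ℚ ξ ∧ IsAlgebraic ℚ η) := fun hC =>
  transcendental_eta (hC 0 _ (Complex.ofReal_ne_zero.2 eta_pos.ne') 2 (3 / 2) (13 / 5) (by norm_num)
    (by norm_num) (by norm_num) (by norm_num) (frequently_hyp_at_eta (by norm_num))).2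

/-- The crux with "for infinitely many `D`" (`∃ᶠ`) in place of "for all large `D`" (`∀ᶠ`). -/
def CruxFrequently : Prop :=
  ∀ (ξ η : ℂ), η ≠ 0 → ∀ (β τ ν : ℝ), 1 ≤ τ → τ < 2 → τ < β → 2 + β - τ < ν →
    (∃ᶠ D : ℕ in atTop, ∃ P : MvPolynomial (Fin 2) ℤ, P ≠ 0 ∧ P.totalDegree ≤ D ∧
      (mvPolyHeight P : ℝ) ≤ Real.exp ((D : ℝ) ^ β) ∧
      ∀ i : ℕ, i < royCount τ D → ‖aeval ![ξ, η] (royD^[i] P)‖ ≤ Real.exp (-(D : ℝ) ^ ν)) →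
    IsAlgebraic ℚ ξ ∧ IsAlgebraic ℚ η

/-- **§6 UNIFORMITY IN `D` IS LOAD-BEARING**: `CruxFrequently` is FALSE (witness `(0, η∞)`,
`τ = 3/2`, `β = 2`, `ν = 13/5` inside the gap). Any proof of the crux must exploit the hypothesis at
consecutive scales (Roy's descent `D* < D`). -/
theorem not_cruxFrequently : ¬ CruxFrequently := roySmallValueDirichletGap_false_with_frequently

/-- **Even Roy's PRINTED Theorem 1.1 needs "for each sufficiently large `D`"**: its `∃ᶠ D`-variant
(with the printed, stronger lower bound on `ν`) is false as well — same witness, `ν = 3 > 8/3`.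
[cite: Roy2013, Theorem 1.1] -/
theorem roy2013_thm_1_1_false_with_frequently :
    ¬ (∀ (ξ η : ℂ), η ≠ 0 → ∀ (β τ ν : ℝ), 1 ≤ τ → τ < 2 → τ < β →
      2 + β - τ + (τ - 1) * (2 - τ) / (β + 1 - τ) < ν →
      (∃ᶠ D : ℕ in Filter.atTop, ∃ P : MvPolynomial (Fin 2) ℤ, P ≠ 0 ∧ P.totalDegree ≤ D ∧
        (mvPolyHeight P : ℝ) ≤ Real.exp ((D : ℝ) ^ β) ∧
        ∀ i : ℕ, i < 3 * ⌊(D : ℝ) ^ τ⌋₊ →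
          ‖MvPolynomial.aeval ![ξ, η] (royD^[i] P)‖ ≤ Real.exp (-(D : ℝ) ^ ν)) →
      IsAlgebraic ℚ ξ ∧ IsAlgebraic ℚ η) := fun hC =>
  transcendental_eta (hC 0 _ (Complex.ofReal_ne_zero.2 eta_pos.ne') 2 (3 / 2) 3 (by norm_num)
    (by norm_num) (by norm_num) (by norm_num) (frequently_hyp_at_eta (by norm_num))).2


/-- `∃ᶠ`-variant of the PRINTED theorem, in `SmallValueHypC` dress: false. -/
def PrintFrequently : Prop :=
  ∀ (ξ η : ℂ), η ≠ 0 → ∀ (β τ ν : ℝ), 1 ≤ τ → τ < 2 → τ < β → 2 + β - τ + royGap β τ < ν →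
    (∃ᶠ D : ℕ in atTop, ∃ P : MvPolynomial (Fin 2) ℤ, P ≠ 0 ∧ P.totalDegree ≤ D ∧
      (mvPolyHeight P : ℝ) ≤ Real.exp ((D : ℝ) ^ β) ∧
      ∀ i : ℕ, i < royCount τ D → ‖aeval ![ξ, η] (royD^[i] P)‖ ≤ Real.exp (-(D : ℝ) ^ ν)) →
    IsAlgebraic ℚ ξ ∧ IsAlgebraic ℚ η

/-- Roy's printed theorem with `∃ᶠ D` is false too (uniformity is load-bearing for the THEOREM, not
only for the crux). -/
theorem not_printFrequently : ¬ PrintFrequently := roy2013_thm_1_1_false_with_frequently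

end Frequently


/-! ## §7 The DERIVATION is load-bearing: analogues for vector fields with an algebraic first
integral are FALSE (Darboux elements), kernel-checked

Roy's `𝒟₁ = ∂/∂X₁ + X₂∂/∂X₂` is the infinitesimal generator of the one-parameter subgroup
`t ↦ (t, eᵗ)` of `𝔾ₐ × 𝔾ₘ`; its first integral `θ = X₂e^{−X₁}` is transcendental, and its only
Darboux polynomials (`𝒟₁P = cP`) are the `aX₂ᵏ`, with zero set `{η = 0}` — exactly the line the
hypothesis `η ≠ 0` removes (§2).  For every "degenerate" generator — the two coordinate directions
`∂/∂X₁`, `X₂∂/∂X₂` of `𝔾ₐ × 𝔾ₘ`, the diagonal `∂/∂X₁ + ∂/∂X₂` of `𝔾ₐ²`, the diagonal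
`X₁∂/∂X₁ + X₂∂/∂X₂` and the subgroup `(t, t²)` direction `X₁∂/∂X₁ + 2X₂∂/∂X₂` of `𝔾ₘ²` — there is a
Darboux polynomial of height `1` through a point `(ξ, η) ∉ ℚ̄²` with `η ≠ 0`, so the analogue of
the crux (same degrees, heights, counts, exponents) is FALSE in every parameter slice.  Moral for
provers: beyond `η ≠ 0`, nothing in the statement is "generic position"; what a proof must use is
that the `𝒟₁`-orbit closure of every admissible point is a TRANSCENDENTAL leaf (Hermite–Lindemann
enters through the leaf, as in Roy's `dist(α, A_γ)`), and exact-vanishing mechanisms are exhausted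
by the Darboux locus. -/

section Operators

/-- The crux with Roy's derivation `royD` replaced by an arbitrary self-map `Δ` of `ℤ[X₁, X₂]`.
[cite: Roy2013, Theorem 1.1 (shape of the statement)] -/
def CruxWithOp (Δ : MvPolynomial (Fin 2) ℤ → MvPolynomial (Fin 2) ℤ) : Prop :=
  ∀ (ξ η : ℂ), η ≠ 0 → ∀ (β τ ν : ℝ), 1 ≤ τ → τ < 2 → τ < β → 2 + β - τ < ν →
    (∀ᶠ D : ℕ in atTop, ∃ P : MvPolynomial (Fin 2) ℤ, P ≠ 0 ∧ P.totalDegree ≤ D ∧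
      (mvPolyHeight P : ℝ) ≤ Real.exp ((D : ℝ) ^ β) ∧
      ∀ i : ℕ, i < 3 * ⌊(D : ℝ) ^ τ⌋₊ → ‖aeval ![ξ, η] (Δ^[i] P)‖ ≤ Real.exp (-(D : ℝ) ^ ν)) →
    IsAlgebraic ℚ ξ ∧ IsAlgebraic ℚ η

/-- READ-BACK: the crux is `CruxWithOp royD`, verbatim. -/
theorem crux_iff_cruxWithOp_royD : RoySmallValueDirichletGap ↔ CruxWithOp royD := Iff.rfl

/-- The small-value hypothesis for the operator `Δ` at `(ξ, η)` with exponents `(β, τ, ν)`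
(`SmallValueHypOp royD = SmallValueHyp`). -/
def SmallValueHypOp (Δ : MvPolynomial (Fin 2) ℤ → MvPolynomial (Fin 2) ℤ) (ξ η : ℂ) (β τ ν : ℝ) :
    Prop :=
  ∀ᶠ D : ℕ in atTop, ∃ P : MvPolynomial (Fin 2) ℤ, P ≠ 0 ∧ P.totalDegree ≤ D ∧
    (mvPolyHeight P : ℝ) ≤ Real.exp ((D : ℝ) ^ β) ∧
    ∀ i : ℕ, i < 3 * ⌊(D : ℝ) ^ τ⌋₊ → ‖aeval ![ξ, η] (Δ^[i] P)‖ ≤ Real.exp (-(D : ℝ) ^ ν)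

/-- `SmallValueHypOp royD` is the crux's hypothesis. -/
theorem smallValueHypOp_royD_iff (ξ η : ℂ) (β τ ν : ℝ) :
    SmallValueHypOp royD ξ η β τ ν ↔ SmallValueHyp ξ η β τ ν := Iff.rfl

/-- A fixed polynomial is eventually within any height budget `exp(D^β)`, `β > 0`. [folklore] -/
theorem eventually_height_le (P₀ : MvPolynomial (Fin 2) ℤ) {β : ℝ} (hβ : 0 < β) :
    ∀ᶠ D : ℕ in atTop, (mvPolyHeight P₀ : ℝ) ≤ Real.exp ((D : ℝ) ^ β) := by
  have ht : Tendsto (fun D : ℕ => (D : ℝ) ^ β) atTop atTop :=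
    (tendsto_rpow_atTop hβ).comp tendsto_natCast_atTop_atTop
  filter_upwards [ht.eventually_ge_atTop (mvPolyHeight P₀ : ℝ)] with D hD
  exact hD.trans ((le_add_of_nonneg_right zero_le_one).trans (Real.add_one_le_exp _))

/-- **Exact-vanishing witnesses**: if ONE fixed non-zero `P₀` has all its `Δ`-iterates vanishing at
`(ξ, η)`, the `Δ`-small-value hypothesis holds there for every `β > 0` and all `τ, ν`. [folklore] -/
theorem smallValueHypOp_of_vanishing {Δ : MvPolynomial (Fin 2) ℤ → MvPolynomial (Fin 2) ℤ}
    {P₀ : MvPolynomial (Fin 2) ℤ} (hP₀ : P₀ ≠ 0) {ξ η : ℂ}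
    (hvan : ∀ i, aeval ![ξ, η] (Δ^[i] P₀) = 0) {β : ℝ} (hβ : 0 < β) (τ ν : ℝ) :
    SmallValueHypOp Δ ξ η β τ ν := by
  filter_upwards [eventually_ge_atTop P₀.totalDegree, eventually_height_le P₀ hβ] with D hD hH
  exact ⟨P₀, hP₀, hD, hH, fun i _ => by rw [hvan i, norm_zero]; exact (Real.exp_pos _).le⟩

/-- Hence such a point, if not in `ℚ̄²` and with `η ≠ 0`, refutes EVERY parameter slice of
`CruxWithOp Δ` (any `β > 0`, any `τ`, any `ν`). [folklore] -/
theorem cruxWithOp_slice_false_of_vanishing {Δ : MvPolynomial (Fin 2) ℤ → MvPolynomial (Fin 2) ℤ}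
    {P₀ : MvPolynomial (Fin 2) ℤ} (hP₀ : P₀ ≠ 0) {ξ η : ℂ} (hη : η ≠ 0)
    (hna : ¬ (IsAlgebraic ℚ ξ ∧ IsAlgebraic ℚ η)) (hvan : ∀ i, aeval ![ξ, η] (Δ^[i] P₀) = 0)
    {β : ℝ} (hβ : 0 < β) (τ ν : ℝ) :
    ¬ (∀ (ξ η : ℂ), η ≠ 0 → SmallValueHypOp Δ ξ η β τ ν → IsAlgebraic ℚ ξ ∧ IsAlgebraic ℚ η) :=
  fun h => hna (h ξ η hη (smallValueHypOp_of_vanishing hP₀ hvan hβ τ ν))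

/-- … and in particular `CruxWithOp Δ` itself (slice `(β, τ, ν) = (2, 1, 4)`). [folklore] -/
theorem not_cruxWithOp_of_vanishing {Δ : MvPolynomial (Fin 2) ℤ → MvPolynomial (Fin 2) ℤ}
    {P₀ : MvPolynomial (Fin 2) ℤ} (hP₀ : P₀ ≠ 0) {ξ η : ℂ} (hη : η ≠ 0)
    (hna : ¬ (IsAlgebraic ℚ ξ ∧ IsAlgebraic ℚ η)) (hvan : ∀ i, aeval ![ξ, η] (Δ^[i] P₀) = 0) :
    ¬ CruxWithOp Δ := fun h =>
  hna (h ξ η hη 2 1 4 le_rfl (by norm_num) (by norm_num) (by norm_num)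
    (smallValueHypOp_of_vanishing hP₀ hvan two_pos 1 4))

/-- **Darboux elements**: if `Δ` commutes with integer scalars (`Δ (C c · P) = C c · Δ P`) and
`Δ P₀ = C c · P₀`, then `Δⁱ P₀ = C (cⁱ) · P₀`. [folklore] -/
theorem iterate_of_darboux {Δ : MvPolynomial (Fin 2) ℤ → MvPolynomial (Fin 2) ℤ}
    (hlin : ∀ (c : ℤ) (P : MvPolynomial (Fin 2) ℤ), Δ (C c * P) = C c * Δ P)
    {P₀ : MvPolynomial (Fin 2) ℤ} {c : ℤ} (h : Δ P₀ = C c * P₀) :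
    ∀ i : ℕ, Δ^[i] P₀ = C (c ^ i) * P₀
  | 0 => by simp
  | i + 1 => by
    rw [Function.iterate_succ_apply', iterate_of_darboux hlin h i, hlin, h, ← mul_assoc, ← map_mul,
      pow_succ]

/-- So all `Δ`-iterates of a Darboux element vanish wherever the element does. [folklore] -/
theorem aeval_iterate_of_darboux {Δ : MvPolynomial (Fin 2) ℤ → MvPolynomial (Fin 2) ℤ}
    (hlin : ∀ (c : ℤ) (P : MvPolynomial (Fin 2) ℤ), Δ (C c * P) = C c * Δ P)
    {P₀ : MvPolynomial (Fin 2) ℤ} {c : ℤ} (h : Δ P₀ = C c * P₀) {ξ η : ℂ}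
    (hroot : aeval ![ξ, η] P₀ = 0) (i : ℕ) : aeval ![ξ, η] (Δ^[i] P₀) = 0 := by
  rw [iterate_of_darboux hlin h i, map_mul, hroot, mul_zero]

/-- **THE DARBOUX CRITERION**: a `ℤ`-linear `Δ` with a non-zero Darboux element `P₀`
(`Δ P₀ = c P₀`) vanishing at a point `(ξ, η) ∉ ℚ̄²` with `η ≠ 0` has a FALSE crux-analogue.
[folklore] -/
theorem not_cruxWithOp_of_darboux {Δ : MvPolynomial (Fin 2) ℤ → MvPolynomial (Fin 2) ℤ}
    (hlin : ∀ (c : ℤ) (P : MvPolynomial (Fin 2) ℤ), Δ (C c * P) = C c * Δ P)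
    {P₀ : MvPolynomial (Fin 2) ℤ} (hP₀ : P₀ ≠ 0) {c : ℤ} (h : Δ P₀ = C c * P₀) {ξ η : ℂ}
    (hη : η ≠ 0) (hna : ¬ (IsAlgebraic ℚ ξ ∧ IsAlgebraic ℚ η)) (hroot : aeval ![ξ, η] P₀ = 0) :
    ¬ CruxWithOp Δ :=
  not_cruxWithOp_of_vanishing hP₀ hη hna (aeval_iterate_of_darboux hlin h hroot)

/-! ### The degenerate generators and their Darboux elements -/

/-- `∂/∂X₁` (the additive direction of `𝔾ₐ × 𝔾ₘ`; flow `(ξ + t, η)`). -/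
def dX1 (P : MvPolynomial (Fin 2) ℤ) : MvPolynomial (Fin 2) ℤ := pderiv 0 P

/-- `X₂ ∂/∂X₂` (the multiplicative direction of `𝔾ₐ × 𝔾ₘ`; flow `(ξ, η eᵗ)`). -/
def x2dX2 (P : MvPolynomial (Fin 2) ℤ) : MvPolynomial (Fin 2) ℤ := X 1 * pderiv 1 P

/-- `∂/∂X₁ + ∂/∂X₂` (the diagonal of `𝔾ₐ × 𝔾ₐ`; flow `(ξ + t, η + t)`). -/
def dX1dX2 (P : MvPolynomial (Fin 2) ℤ) : MvPolynomial (Fin 2) ℤ := pderiv 0 P + pderiv 1 P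

/-- `X₁∂/∂X₁ + X₂∂/∂X₂` (Euler; the diagonal of `𝔾ₘ × 𝔾ₘ`; flow `(ξ eᵗ, η eᵗ)`). -/
def euler (P : MvPolynomial (Fin 2) ℤ) : MvPolynomial (Fin 2) ℤ := X 0 * pderiv 0 P + X 1 * pderiv 1 P

/-- `X₁∂/∂X₁ + 2X₂∂/∂X₂` (the subgroup `(t, t²)` of `𝔾ₘ × 𝔾ₘ`; flow `(ξ eᵗ, η e^{2t})`). -/
def euler12 (P : MvPolynomial (Fin 2) ℤ) : MvPolynomial (Fin 2) ℤ :=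
  X 0 * pderiv 0 P + C 2 * X 1 * pderiv 1 P

/-- `∂/∂X₁` is `ℤ`-linear. -/
theorem dX1_lin (c : ℤ) (P : MvPolynomial (Fin 2) ℤ) : dX1 (C c * P) = C c * dX1 P := by
  simp [dX1, Derivation.leibniz]

/-- `X₂∂/∂X₂` is `ℤ`-linear. -/
theorem x2dX2_lin (c : ℤ) (P : MvPolynomial (Fin 2) ℤ) : x2dX2 (C c * P) = C c * x2dX2 P := by
  simp [x2dX2, Derivation.leibniz]; ring

/-- `∂/∂X₁ + ∂/∂X₂` is `ℤ`-linear. -/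
theorem dX1dX2_lin (c : ℤ) (P : MvPolynomial (Fin 2) ℤ) : dX1dX2 (C c * P) = C c * dX1dX2 P := by
  simp [dX1dX2, Derivation.leibniz]; ring

/-- Euler is `ℤ`-linear. -/
theorem euler_lin (c : ℤ) (P : MvPolynomial (Fin 2) ℤ) : euler (C c * P) = C c * euler P := by
  simp [euler, Derivation.leibniz]; ring

/-- `X₁∂₁ + 2X₂∂₂` is `ℤ`-linear. -/
theorem euler12_lin (c : ℤ) (P : MvPolynomial (Fin 2) ℤ) : euler12 (C c * P) = C c * euler12 P := by
  simp [euler12, Derivation.leibniz]; ring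

/-- Roy's `𝒟₁` is `ℤ`-linear. -/
theorem royD_lin (c : ℤ) (P : MvPolynomial (Fin 2) ℤ) : royD (C c * P) = C c * royD P := by
  rw [royD_mul, royD_C, zero_mul, zero_add]

/-- Darboux element of `∂/∂X₁`: `X₂ − 1` (constant `0`), zero set `{η = 1}`. -/
theorem dX1_darboux : dX1 (X 1 - 1 : MvPolynomial (Fin 2) ℤ) = C 0 * (X 1 - 1) := by
  simp [dX1, pderiv_X]

/-- Darboux element of `X₂∂/∂X₂`: `X₁` (constant `0`), zero set `{ξ = 0}`. -/
theorem x2dX2_darboux : x2dX2 (X 0 : MvPolynomial (Fin 2) ℤ) = C 0 * X 0 := by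
  simp [x2dX2, pderiv_X]

/-- Darboux element of `∂/∂X₁ + ∂/∂X₂`: `X₂ − X₁ − 1` (constant `0`), zero set `{η = ξ + 1}`. -/
theorem dX1dX2_darboux : dX1dX2 (X 1 - X 0 - 1 : MvPolynomial (Fin 2) ℤ) = C 0 * (X 1 - X 0 - 1) := by
  simp [dX1dX2, pderiv_X]

/-- Darboux element of Euler: `X₂ − X₁` (constant `1`), zero set `{η = ξ}`. -/
theorem euler_darboux : euler (X 1 - X 0 : MvPolynomial (Fin 2) ℤ) = C 1 * (X 1 - X 0) := by
  simp [euler, pderiv_X]; ring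

/-- Darboux element of `X₁∂₁ + 2X₂∂₂`: `X₂ − X₁²` (constant `2`), zero set `{η = ξ²}`. -/
theorem euler12_darboux : euler12 (X 1 - X 0 ^ 2 : MvPolynomial (Fin 2) ℤ) = C 2 * (X 1 - X 0 ^ 2) := by
  simp [euler12, pderiv_X]; ring

/-- Darboux element of Roy's `𝒟₁` itself: `X₂` (constant `1`) — zero set `{η = 0}`, exactly what
the crux's hypothesis `η ≠ 0` removes (cf. `crux_false_without_etaNeZero`, §2). -/
theorem royD_darboux : royD (X 1 : MvPolynomial (Fin 2) ℤ) = C 1 * X 1 := by simp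

/-- `X₂ − X₁ − 1 ≠ 0`. -/
theorem X_one_sub_X_zero_sub_one_ne_zero : (X 1 - X 0 - 1 : MvPolynomial (Fin 2) ℤ) ≠ 0 := by
  intro h; have := congrArg (MvPolynomial.eval (0 : Fin 2 → ℤ)) h; simp at this

/-- `X₂ − X₁ ≠ 0`. -/
theorem X_one_sub_X_zero_ne_zero : (X 1 - X 0 : MvPolynomial (Fin 2) ℤ) ≠ 0 := by
  intro h; have := congrArg (MvPolynomial.eval (![0, 1] : Fin 2 → ℤ)) h; simp at this

/-- `X₂ − X₁² ≠ 0`. -/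
theorem X_one_sub_X_zero_sq_ne_zero : (X 1 - X 0 ^ 2 : MvPolynomial (Fin 2) ℤ) ≠ 0 := by
  intro h; have := congrArg (MvPolynomial.eval (![0, 1] : Fin 2 → ℤ)) h; simp at this

/-- **`∂/∂X₁`-analogue of the crux is FALSE**: witness `(e, 1)`, `P_D = X₂ − 1` (the additive
coordinate direction of `𝔾ₐ × 𝔾ₘ` has the algebraic leaves `{η = const}`). [folklore] -/
theorem not_cruxWithOp_dX1 : ¬ CruxWithOp dX1 :=
  not_cruxWithOp_of_darboux dX1_lin X_one_sub_one_ne_zero dX1_darboux (ξ := cexp 1) (η := 1)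
    one_ne_zero (fun h => transcendental_e h.1) (by simp)

/-- **`X₂∂/∂X₂`-analogue FALSE**: witness `(0, e)`, `P_D = X₁` (leaves `{ξ = const}`). [folklore] -/
theorem not_cruxWithOp_x2dX2 : ¬ CruxWithOp x2dX2 :=
  not_cruxWithOp_of_darboux x2dX2_lin (X_ne_zero 0) x2dX2_darboux (ξ := 0) (η := cexp 1)
    (Complex.exp_ne_zero 1) (fun h => transcendental_e h.2) (by simp)

/-- **`𝔾ₐ²`-analogue (`∂/∂X₁ + ∂/∂X₂`) FALSE**: witness `(e − 1, e)`, `P_D = X₂ − X₁ − 1`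
(leaves `{η − ξ = const}`). [folklore] -/
theorem not_cruxWithOp_dX1dX2 : ¬ CruxWithOp dX1dX2 :=
  not_cruxWithOp_of_darboux dX1dX2_lin X_one_sub_X_zero_sub_one_ne_zero dX1dX2_darboux
    (ξ := cexp 1 - 1) (η := cexp 1) (Complex.exp_ne_zero 1) (fun h => transcendental_e h.2)
    (by simp)

/-- **`𝔾ₘ²`-analogue (Euler, diagonal subgroup) FALSE**: witness `(e, e)`, `P_D = X₂ − X₁`
(leaves `{η/ξ = const}`). [folklore] -/
theorem not_cruxWithOp_euler : ¬ CruxWithOp euler :=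
  not_cruxWithOp_of_darboux euler_lin X_one_sub_X_zero_ne_zero euler_darboux
    (ξ := cexp 1) (η := cexp 1) (Complex.exp_ne_zero 1) (fun h => transcendental_e h.2) (by simp)

/-- **`𝔾ₘ²`-analogue (subgroup `(t, t²)`, `X₁∂₁ + 2X₂∂₂`) FALSE**: witness `(e, e²)`,
`P_D = X₂ − X₁²` (leaves `{η/ξ² = const}`; degree-2 Darboux element, constant `2`). [folklore] -/
theorem not_cruxWithOp_euler12 : ¬ CruxWithOp euler12 :=
  not_cruxWithOp_of_darboux euler12_lin X_one_sub_X_zero_sq_ne_zero euler12_darboux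
    (ξ := cexp 1) (η := cexp 1 ^ 2) (pow_ne_zero 2 (Complex.exp_ne_zero 1))
    (fun h => transcendental_e h.1) (by simp)

/-- For Roy's `𝒟₁` the Darboux criterion yields exactly the excluded line `{η = 0}`: the hypothesis
holds at EVERY `(ξ, 0)`, for every `β > 0`, `τ`, `ν` (this is §2's witness family B seen through §7).
[folklore] -/
theorem smallValueHypOp_royD_eta_zero (ξ : ℂ) {β : ℝ} (hβ : 0 < β) (τ ν : ℝ) :
    SmallValueHypOp royD ξ 0 β τ ν :=
  smallValueHypOp_of_vanishing (X_ne_zero 1)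
    (aeval_iterate_of_darboux royD_lin royD_darboux (by simp)) hβ τ ν

/-! ### Tightness of §7 for `𝒟₁`: classification of its Darboux elements -/

/-- `e₀ = (1, 0)`, the exponent vector of `X₁`. -/
abbrev e0 : Fin 2 →₀ ℕ := Finsupp.single 0 1

/-- `[m](X₂ ∂P/∂X₂) = m₁ · [m]P`. [folklore] -/
theorem coeff_X_one_mul_pderiv_one (P : MvPolynomial (Fin 2) ℤ) (m : Fin 2 →₀ ℕ) :
    (X 1 * pderiv 1 P).coeff m = P.coeff m * (m 1 : ℤ) := by
  classical
  rw [coeff_X_mul']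
  split_ifs with h
  · have h1 : 1 ≤ m 1 := Nat.one_le_iff_ne_zero.mpr (by simpa using h)
    have hle : Finsupp.single (1 : Fin 2) 1 ≤ m := by
      simpa [Finsupp.single_le_iff] using h1
    rw [coeff_pderiv, tsub_add_cancel_of_le hle]
    simp only [Finsupp.tsub_apply, Finsupp.single_eq_same]
    push_cast [Nat.cast_sub h1]
    ring
  · have h0 : m 1 = 0 := by simpa using h
    simp [h0]

/-- **Coefficient formula for Roy's derivation**: `[m](𝒟₁P) = (m₀+1)·[m+e₀]P + m₁·[m]P`.
[cite: Roy2001, §1 (the derivation D)] -/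
theorem coeff_royD (P : MvPolynomial (Fin 2) ℤ) (m : Fin 2 →₀ ℕ) :
    (royD P).coeff m = P.coeff (m + e0) * ((m 0 : ℤ) + 1) + P.coeff m * (m 1 : ℤ) := by
  rw [royD, coeff_add, coeff_pderiv, coeff_X_one_mul_pderiv_one]

/-- The Darboux relation `𝒟₁P = cP` on coefficients: `(m₀+1)[m+e₀]P = (c − m₁)[m]P`. [folklore] -/
theorem coeff_rel_of_darboux {P : MvPolynomial (Fin 2) ℤ} {c : ℤ} (h : royD P = C c * P)
    (m : Fin 2 →₀ ℕ) :
    P.coeff (m + e0) * ((m 0 : ℤ) + 1) = (c - (m 1 : ℤ)) * P.coeff m := by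
  have := congrArg (coeff m) h
  rw [coeff_royD, coeff_C_mul] at this
  linear_combination this

/-- `(m + k·e₀)₁ = m₁`. [folklore] -/
theorem add_nsmul_e0_apply_one (m : Fin 2 →₀ ℕ) (k : ℕ) : (m + k • e0) 1 = m 1 := by
  simp [e0]

/-- `(m + k·e₀)₀ = m₀ + k`. [folklore] -/
theorem add_nsmul_e0_apply_zero (m : Fin 2 →₀ ℕ) (k : ℕ) : (m + k • e0) 0 = m 0 + k := by
  simp [e0]

/-- Off the eigen-row `m₁ = c`, all coefficients of a Darboux element vanish (else the relation
propagates a non-zero coefficient to unbounded `X₁`-degree). [folklore] -/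
theorem coeff_eq_zero_of_darboux_of_ne {P : MvPolynomial (Fin 2) ℤ} {c : ℤ} (h : royD P = C c * P)
    {m : Fin 2 →₀ ℕ} (hm : (m 1 : ℤ) ≠ c) : P.coeff m = 0 := by
  classical
  by_contra hne
  have key : ∀ k : ℕ, P.coeff (m + k • e0) ≠ 0 := by
    intro k
    induction k with
    | zero => simpa using hne
    | succ k ih =>
      intro h0
      have hrel := coeff_rel_of_darboux h (m + k • e0)
      rw [add_assoc, ← succ_nsmul, h0, zero_mul, add_nsmul_e0_apply_one] at hrel
      exact ih ((mul_eq_zero.mp hrel.symm).resolve_left (sub_ne_zero.mpr (Ne.symm hm)))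
  have hk := key (P.degreeOf 0 + 1)
  have hle := monomial_le_degreeOf (0 : Fin 2) (mem_support_iff.mpr hk)
  rw [add_nsmul_e0_apply_zero] at hle
  omega

/-- On the eigen-row, only the `X₁`-free coefficient survives. [folklore] -/
theorem coeff_eq_zero_of_darboux_of_pos {P : MvPolynomial (Fin 2) ℤ} {c : ℤ} (h : royD P = C c * P)
    {m : Fin 2 →₀ ℕ} (hm : (m 1 : ℤ) = c) (h0 : 1 ≤ m 0) : P.coeff m = 0 := by
  classical
  have hle : e0 ≤ m := by simpa [e0, Finsupp.single_le_iff] using h0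
  have hrel := coeff_rel_of_darboux h (m - e0)
  rw [tsub_add_cancel_of_le hle] at hrel
  have h1 : (((m - e0) 1 : ℕ) : ℤ) = c := by
    rw [← hm]; simp [e0]
  rw [h1, sub_self, zero_mul] at hrel
  have hpos : (((m - e0) 0 : ℕ) : ℤ) + 1 ≠ 0 := by positivity
  exact (mul_eq_zero.mp hrel).resolve_right hpos

/-- **CLASSIFICATION OF THE DARBOUX ELEMENTS OF `𝒟₁`**: `𝒟₁P = cP` in `ℤ[X₁, X₂]` forces
`P = a·X₂ⁿ` (and then `a = 0` or `n = c`). [folklore] -/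
theorem eq_C_mul_X_pow_of_darboux {P : MvPolynomial (Fin 2) ℤ} {c : ℤ} (h : royD P = C c * P) :
    ∃ (a : ℤ) (n : ℕ), P = C a * X 1 ^ n := by
  classical
  refine ⟨P.coeff (Finsupp.single 1 c.toNat), c.toNat, ?_⟩
  ext m
  rw [coeff_C_mul, coeff_X_pow]
  split_ifs with hm
  · rw [← hm, mul_one]
  · rw [mul_zero]
    by_cases h1 : (m 1 : ℤ) = c
    · refine coeff_eq_zero_of_darboux_of_pos h h1 (Nat.one_le_iff_ne_zero.mpr fun h00 => hm ?_)
      ext i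
      fin_cases i
      · simp [h00]
      · simp [← h1]
    · exact coeff_eq_zero_of_darboux_of_ne h h1

/-- **THE DARBOUX LOCUS OF `𝒟₁` IS `{η = 0}`** (tightness of §7 for the crux itself): a non-zero
Darboux element of `𝒟₁` vanishing at `(ξ, η)` forces `η = 0`.  So the exact-vanishing mechanism
that kills every degenerate analogue above produces, for `𝒟₁`, nothing outside the line that the
hypothesis `η ≠ 0` excludes; together with §3 (exact vanishing at a point with a transcendental
coordinate caps at order `deg P`), exact zeros are exhausted as a refutation mechanism. [folklore] -/
theorem eta_eq_zero_of_darboux_root {P : MvPolynomial (Fin 2) ℤ} {c : ℤ} (h : royD P = C c * P)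
    (hP : P ≠ 0) {ξ η : ℂ} (hroot : aeval ![ξ, η] P = 0) : η = 0 := by
  obtain ⟨a, n, rfl⟩ := eq_C_mul_X_pow_of_darboux h
  have ha : a ≠ 0 := by rintro rfl; simp at hP
  have h' : (a : ℂ) * η ^ n = 0 := by simpa using hroot
  rcases mul_eq_zero.mp h' with h'' | h''
  · exact absurd (by exact_mod_cast h'') ha
  · exact (pow_eq_zero_iff'.mp h'').1

end Operators


/-! ## §8 How long can ONE base configuration serve?  Polynomial WINDOWS of scales, kernel-checked

Sharpening of §6.  At `(0, η∞)` a single rational base point `(0, s_n)` (`s_n` the `n`-th partial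
sum, denominator `q_n = 2^{e(n)}`) carries Thue–Siegel polynomials with exact zeros at EVERY level
`D` of the window `[N, N^λ]`, `N = 2e(n)`, and their values at `(0, η∞)` stay below `exp(−D^ν)` as
long as `λν < 4` (`4` = the growth exponent `e(n+1) = e(n)⁴`; `λ < 2` keeps the height in budget):
`frequently_window_hyp_at_eta`.  Hence the variant `CruxOnWindows λ` of the crux whose hypothesis
is only required on windows `[N, N^λ]` for infinitely many `N` is FALSE for every `λ < 3/2`
(`not_cruxOnWindows`; `ν = 13/5` in the gap), and the windowed PRINTED theorem is false for
`λ < 4/3` (`roy2013_thm_1_1_false_on_windows`, `ν = 3`).  So any proof must couple level `D` to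
levels below `D^{2/3}` (at these exponents); Roy's descent couples `D` to `D* ≲ D^{1−δ/(τ−1)}`
AND to all levels from `D₀` on (Step 3), which is why it is immune.

Paper-level complement (not kernel-checked; the census for provers).  For a rational base point
`p/q` at distance `ε` from `η` the service window at exponents `(β, τ, ν)` is
`[(c log q)^{1/(β+1−τ)}, (log(1/ε)/2)^{1/ν}]` once heights are taken with the Siegel exponent
(`log H(P_D) ≲ 6D^{τ−1}(log q + log D)` instead of the crude `D log q` used here, which gives the
lower end `(log q)^{1/(β−1)}`).  For CONSECUTIVE convergents of ANY real `η` one has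
`log(1/ε_n) ≈ log q_{n+1}`, so window `n` ends at `(log q_{n+1})^{1/ν}` while window `n+1` starts at
`(log q_{n+1})^{1/(β+1−τ)}`: a GAP of exponent ratio `ν/(β+1−τ) > 1 + 1/(β+1−τ)` between
consecutive windows, for every `η` — the hand-over obstruction of the bottom census, quantified;
longer windows (faster `q_{n+1}`) never close it.  Closing it needs base configurations of many
algebraic points sharing the burden (Roy's `Z`, degree `≍ (D*)^{2−τ}`), i.e. the abnormal
approximations to transcendental leaves discussed there.

By-product for the POSITIVE side (a remark for ideators; paper, not kernel-checked).  At a point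
`(0, η)` and a level `D`, let `p/q` be a rational with `D log q + D^β + 2D log D < log(1/|η − p/q|)`
and `D log q < D^ν`.  Then every `P` as in the hypothesis at level `D` has EXACT zeros at
`(0, p/q)`: `𝒟₁ⁱP(0, p/q) ∈ q^{−D}ℤ` and `|𝒟₁ⁱP(0, p/q)| ≤ e^{−D^ν} + (perturbation) < q^{−D}`.
Expanding `y ↦ 𝒟₁ⁱP(0, y)` at `y = p/q` to higher order, the same argument forces the mixed jets
`∂_yᵏ𝒟₁ⁱP(0, p/q) = 0` for `i < 3⌊D^τ⌋` and all `k` with `k·log(1/|η − p/q|) ≲ D^ν`, i.e.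
`(∂_X₂ᵏP)(z, (p/q)eᶻ) = O(z^{3⌊D^τ⌋})` for `k < K ≈ D^ν/log(1/|η − p/q|)`.  In the GAP between two
service windows of a fast Liouville number (`η = η∞`: levels `N^{4/ν} < D < N²`, `N = e(n)`,
`p/q = s_n`) this gives `K·3D^τ ≫ D²` forced exact conditions on the `≍ D²/2` coefficients of `P`.
A multiplicity estimate for such BOX JETS along `(𝒟₁, ∂_X₂)` at one rational point of `𝔾ₐ × 𝔾ₘ`
("`∑_{k<K} ord_{z=0}(∂_X₂ᵏP)(z, s eᶻ) ≤ cD²` fails, but independence of the `K` families is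
plausible for `K ≪ D^{1/2}`") would prove that the hypothesis FAILS at gap levels, i.e. the crux
HOLDS at `(0, η∞)` and at every point `(0, η)` with sufficiently lacunary convergents — a special
case not covered by Roy's theorem inside the gap, and a test-bed for the line's currency. -/

section Windows

open Finset

/-- `y^a ≤ 16·x^{λa}` for `0 ≤ y ≤ (2x)^λ`, `x ≥ 1`, `0 ≤ a`, `λa ≤ 4`. [folklore] -/
theorem rpow_le_sixteen_mul {x y lam a : ℝ} (hx : 1 ≤ x) (hy0 : 0 ≤ y) (hyY : y ≤ (2 * x) ^ lam)
    (ha : 0 ≤ a) (hla : lam * a ≤ 4) : y ^ a ≤ 16 * x ^ (lam * a) := by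
  have h2x : (0 : ℝ) ≤ 2 * x := by linarith
  calc y ^ a ≤ ((2 * x) ^ lam) ^ a := Real.rpow_le_rpow hy0 hyY ha
    _ = (2 * x) ^ (lam * a) := by rw [← Real.rpow_mul h2x]
    _ = 2 ^ (lam * a) * x ^ (lam * a) := Real.mul_rpow (by norm_num) (by linarith)
    _ ≤ (2 : ℝ) ^ (4 : ℝ) * x ^ (lam * a) :=
        mul_le_mul_of_nonneg_right (Real.rpow_le_rpow_of_exponent_le (by norm_num) hla)
          (Real.rpow_nonneg (by linarith) _)
    _ = 16 * x ^ (lam * a) := by norm_num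

/-- **Window numerics**: for `λ < 2`, `0 < ν`, `λν < 4`, eventually in `h`, for every real
`y ∈ [2h, (2h)^λ]`: `4y + 10y² + 5y^{3/2} + 1 + y^ν ≤ h⁴ log 2`. [folklore] -/
theorem window_exponent_numerics {ν lam : ℝ} (hν : 0 < ν) (hlam2 : lam < 2)
    (hlamν : lam * ν < 4) :
    ∀ᶠ h : ℕ in atTop, ∀ y : ℝ, 2 * (h : ℝ) ≤ y → y ≤ (2 * (h : ℝ)) ^ lam →
      4 * y + 10 * y ^ (2 : ℝ) + 5 * y ^ ((3 : ℝ) / 2) + 1 + y ^ ν ≤ (h : ℝ) ^ 4 * Real.log 2 := by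
  have hE : (0 : ℝ) < Real.log 2 / 5 := by have := Real.log_pos one_lt_two; positivity
  have hev := ((((eventually_nat_rpow_le (16 * 4) (show lam * 1 < 4 by linarith) hE).and
    (eventually_nat_rpow_le (16 * 10) (show lam * 2 < 4 by linarith) hE)).and
    (eventually_nat_rpow_le (16 * 5) (show lam * (3 / 2) < 4 by linarith) hE)).and
    (eventually_nat_rpow_le 16 hlamν hE)).and
    (eventually_nat_rpow_le 1 (show (0 : ℝ) < 4 by norm_num) hE)
  filter_upwards [hev, eventually_ge_atTop 1] with h hh hh1
  obtain ⟨⟨⟨⟨e1, e2⟩, e3⟩, e5⟩, e6⟩ := hh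
  intro y hy1 hy2
  have hx1 : (1 : ℝ) ≤ h := by exact_mod_cast hh1
  have hy0 : 0 ≤ y := by linarith
  have hx4 : (h : ℝ) ^ (4 : ℝ) = (h : ℝ) ^ 4 := by exact_mod_cast Real.rpow_natCast (h : ℝ) 4
  rw [hx4] at e1 e2 e3 e5 e6
  rw [Real.rpow_zero, mul_one] at e6
  have t1 : y ≤ 16 * (h : ℝ) ^ (lam * 1) := by
    have := rpow_le_sixteen_mul hx1 hy0 hy2 zero_le_one (by linarith)
    rwa [Real.rpow_one] at this
  have t2 : y ^ (2 : ℝ) ≤ 16 * (h : ℝ) ^ (lam * 2) :=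
    rpow_le_sixteen_mul hx1 hy0 hy2 (by norm_num) (by linarith)
  have t3 : y ^ ((3 : ℝ) / 2) ≤ 16 * (h : ℝ) ^ (lam * (3 / 2)) :=
    rpow_le_sixteen_mul hx1 hy0 hy2 (by norm_num) (by linarith)
  have t5 : y ^ ν ≤ 16 * (h : ℝ) ^ (lam * ν) :=
    rpow_le_sixteen_mul hx1 hy0 hy2 hν.le hlamν.le
  linarith

/-- `L log L ≤ 5y^{3/2} + 9y²` for `L = 3⌊y^{3/2}⌋`, `y ≥ 1`. [folklore] -/
theorem count_mul_log_le {y : ℝ} (hy : 1 ≤ y) :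
    ((3 * ⌊y ^ ((3 : ℝ) / 2)⌋₊ : ℕ) : ℝ) * Real.log ((3 * ⌊y ^ ((3 : ℝ) / 2)⌋₊ : ℕ) : ℝ) ≤
      5 * y ^ ((3 : ℝ) / 2) + 9 * y ^ (2 : ℝ) := by
  have hy0 : 0 < y := by linarith
  have hy32 : 1 ≤ y ^ ((3 : ℝ) / 2) := Real.one_le_rpow hy (by norm_num)
  set L : ℕ := 3 * ⌊y ^ ((3 : ℝ) / 2)⌋₊ with hL
  have hLy : (L : ℝ) ≤ 3 * y ^ ((3 : ℝ) / 2) := by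
    rw [hL]; push_cast
    exact mul_le_mul_of_nonneg_left (Nat.floor_le (by positivity)) (by norm_num)
  have hL1 : 1 ≤ L := by
    have : 1 ≤ ⌊y ^ ((3 : ℝ) / 2)⌋₊ := Nat.le_floor (by simpa using hy32)
    omega
  have hL0 : (0 : ℝ) < L := by exact_mod_cast hL1
  have hlog3 : Real.log 3 < 14 / 10 := by
    have := Real.log_two_lt_d9
    have h34 : Real.log 3 ≤ Real.log 4 := Real.log_le_log (by norm_num) (by norm_num)
    have h4 : Real.log 4 = 2 * Real.log 2 := by
      rw [show (4 : ℝ) = 2 ^ 2 by norm_num, Real.log_pow]; norm_num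
    linarith
  have hlogy : Real.log y ≤ 2 * y ^ ((1 : ℝ) / 2) := by
    have := Real.log_le_rpow_div hy0.le (show (0 : ℝ) < 1 / 2 by norm_num)
    linarith [this]
  have hlogL : Real.log L ≤ Real.log 3 + 3 / 2 * Real.log y := by
    calc Real.log L ≤ Real.log (3 * y ^ ((3 : ℝ) / 2)) := Real.log_le_log hL0 hLy
      _ = Real.log 3 + 3 / 2 * Real.log y := by
          rw [Real.log_mul (by norm_num) (by positivity), Real.log_rpow hy0]
  have hlogy0 : 0 ≤ Real.log y := Real.log_nonneg hy
  have hprod : y ^ ((3 : ℝ) / 2) * y ^ ((1 : ℝ) / 2) = y ^ (2 : ℝ) := by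
    rw [← Real.rpow_add hy0]; norm_num
  calc (L : ℝ) * Real.log L ≤ L * (Real.log 3 + 3 / 2 * Real.log y) :=
        mul_le_mul_of_nonneg_left hlogL hL0.le
    _ ≤ 3 * y ^ ((3 : ℝ) / 2) * (Real.log 3 + 3 / 2 * Real.log y) :=
        mul_le_mul_of_nonneg_right hLy (by positivity)
    _ ≤ 3 * y ^ ((3 : ℝ) / 2) * (14 / 10 + 3 / 2 * (2 * y ^ ((1 : ℝ) / 2))) := by
        gcongr
    _ = 42 / 10 * y ^ ((3 : ℝ) / 2) + 9 * (y ^ ((3 : ℝ) / 2) * y ^ ((1 : ℝ) / 2)) := by ring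
    _ ≤ 5 * y ^ ((3 : ℝ) / 2) + 9 * y ^ (2 : ℝ) := by rw [hprod]; nlinarith [hy32]

set_option maxHeartbeats 800000 in
/-- **At `(0, η∞)` the small-value hypothesis holds on whole POLYNOMIAL WINDOWS of scales**: for
`τ = 3/2`, `β = 2`, any `ν > 0` and any `λ < 2` with `λν < 4`, there are infinitely many `N`
such that for EVERY `D ∈ [N, N^λ]` a polynomial `P_D` as in the crux's hypothesis exists (one
rational base point `(0, s_n)` serves the whole window). [folklore] -/
theorem frequently_window_hyp_at_eta {ν lam : ℝ} (hν : 0 < ν) (hlam2 : lam < 2)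
    (hlamν : lam * ν < 4) :
    ∃ᶠ N : ℕ in atTop, ∀ D : ℕ, N ≤ D → (D : ℝ) ≤ (N : ℝ) ^ lam →
      ∃ P : MvPolynomial (Fin 2) ℤ, P ≠ 0 ∧ P.totalDegree ≤ D ∧
        (mvPolyHeight P : ℝ) ≤ Real.exp ((D : ℝ) ^ (2 : ℝ)) ∧
        ∀ i : ℕ, i < 3 * ⌊(D : ℝ) ^ ((3 : ℝ) / 2)⌋₊ →
          ‖aeval ![(0 : ℂ), ((∑' m : ℕ, ((2 : ℝ) ^ 2 ^ 4 ^ m)⁻¹ : ℝ) : ℂ)] (royD^[i] P)‖ ≤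
            Real.exp (-(D : ℝ) ^ ν) := by
  rw [Filter.frequently_atTop]
  intro N₀
  obtain ⟨D₀, hD₀⟩ := Filter.eventually_atTop.1
    (exists_taylor_kernel (τ := 3 / 2) (β := 2) (by norm_num) (by norm_num) (by norm_num) (by norm_num))
  obtain ⟨h₀, hh₀⟩ := Filter.eventually_atTop.1 (window_exponent_numerics hν hlam2 hlamν)
  obtain ⟨n, hn⟩ : ∃ n : ℕ, n = N₀ + D₀ + h₀ := ⟨_, rfl⟩
  obtain ⟨h, hh⟩ : ∃ h : ℕ, h = 2 ^ 4 ^ n := ⟨_, rfl⟩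
  have hnh : n + 2 ≤ h := hh ▸ add_two_le_e n
  have hh1 : 1 ≤ h := by omega
  refine ⟨2 * h, by omega, fun D hND hDle => ?_⟩
  have hDr : ((2 * h : ℕ) : ℝ) = 2 * (h : ℝ) := by push_cast; ring
  rw [hDr] at hDle
  have hND' : 2 * (h : ℝ) ≤ D := by exact_mod_cast hND
  obtain ⟨t, ht0, hker, hnorm⟩ := hD₀ D (by omega)
  have hnum := hh₀ h (by omega) (D : ℝ) hND' hDle
  have hx1 : (1 : ℝ) ≤ h := by exact_mod_cast hh1
  have hx0 : (0 : ℝ) < h := by linarith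
  have hy1 : (1 : ℝ) ≤ D := by linarith
  have hy0 : (0 : ℝ) < D := by linarith
  -- the box size `⌊D/2⌋`
  have hhK : h ≤ D / 2 := by omega
  have hKle : D / 2 ≤ D := by omega
  have hKr : ((D / 2 : ℕ) : ℝ) ≤ (D : ℝ) / 2 := by
    rw [le_div_iff₀ (by norm_num : (0:ℝ) < 2)]; exact_mod_cast (by omega : D / 2 * 2 ≤ D)
  have hKr' : ((D / 2 : ℕ) : ℝ) ≤ D := by exact_mod_cast hKle
  -- the number and its `n`-th partial sum
  have hηpos := eta_pos
  have hηhalf := eta_le_half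
  obtain ⟨htail0, htail⟩ := tail_bounds n
  rw [e_succ, ← hh] at htail
  have ha0 : 0 < ∑ m ∈ range (n + 1), (2 : ℕ) ^ (2 ^ 4 ^ n - 2 ^ 4 ^ m) := numerator_pos n
  obtain ⟨a, ha⟩ : ∃ a : ℕ, a = ∑ m ∈ range (n + 1), (2 : ℕ) ^ (2 ^ 4 ^ n - 2 ^ 4 ^ m) := ⟨_, rfl⟩
  rw [← ha] at ha0
  have hs : ∑ m ∈ range (n + 1), ((2 : ℝ) ^ 2 ^ 4 ^ m)⁻¹ = (a : ℝ) / (2 : ℝ) ^ h := by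
    rw [partialSum_eq n, ← ha, ← hh]
  rw [hs] at htail0 htail
  have ha0z : ((a : ℕ) : ℤ) ≠ 0 := by exact_mod_cast ha0.ne'
  have hq0 : ((2 : ℤ) ^ h) ≠ 0 := by positivity
  have hs_le : (a : ℝ) / (2 : ℝ) ^ h ≤ 1 := by linarith
  have hs_pos : 0 < (a : ℝ) / (2 : ℝ) ^ h := by positivity
  have ha_le : (a : ℝ) ≤ (2 : ℝ) ^ h := by rwa [div_le_one (by positivity)] at hs_le
  have hy1' : ‖((∑' m : ℕ, ((2 : ℝ) ^ 2 ^ 4 ^ m)⁻¹ : ℝ) : ℂ)‖ ≤ 1 := by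
    rw [Complex.norm_real, Real.norm_eq_abs, abs_of_pos hηpos]; linarith
  have hr1 : ‖(((a : ℝ) / (2 : ℝ) ^ h : ℝ) : ℂ)‖ ≤ 1 := by
    rw [Complex.norm_real, Real.norm_eq_abs, abs_of_pos hs_pos]; exact hs_le
  have hpt : ((((a : ℕ) : ℤ) : ℂ) / ((((2 : ℤ) ^ h : ℤ)) : ℂ)) = (((a : ℝ) / (2 : ℝ) ^ h : ℝ) : ℂ) := by
    push_cast; ring
  have hdist : ‖((∑' m : ℕ, ((2 : ℝ) ^ 2 ^ 4 ^ m)⁻¹ : ℝ) : ℂ) - (((a : ℝ) / (2 : ℝ) ^ h : ℝ) : ℂ)‖ ≤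
      2 * ((2 : ℝ) ^ h ^ 4)⁻¹ := by
    rw [← Complex.ofReal_sub, Complex.norm_real, Real.norm_eq_abs, abs_of_pos htail0]
    exact htail
  -- the height bookkeeping: `‖t‖ · (2^h)^K ≤ exp(D²)`
  have hR : max |(((a : ℕ) : ℤ) : ℝ)| |((((2 : ℤ) ^ h : ℤ)) : ℝ)| ≤ (2 : ℝ) ^ h := by
    refine max_le ?_ ?_
    · push_cast; rw [abs_of_nonneg (by positivity)]; exact ha_le
    · push_cast; rw [abs_of_nonneg (by positivity)]
  have hD2 : ((D : ℝ) ^ (2 : ℝ)) = (D : ℝ) ^ 2 := Real.rpow_two _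
  have hnorm' : ‖t‖ ≤ Real.exp ((D : ℝ) ^ 2 / 2) := by rw [← hD2]; exact hnorm
  have hl2 : Real.log 2 ≤ 1 := by have := Real.log_two_lt_d9; linarith
  have h2hK : ((2 : ℝ) ^ h) ^ (D / 2) ≤ Real.exp ((D : ℝ) ^ 2 / 2) := by
    rw [← pow_mul, ← Real.rpow_natCast, Real.rpow_def_of_pos (by norm_num)]
    refine Real.exp_le_exp.2 ?_
    push_cast
    have hhK' : (h : ℝ) ≤ ((D / 2 : ℕ) : ℝ) := by exact_mod_cast hhK
    have hK0 : (0 : ℝ) ≤ ((D / 2 : ℕ) : ℝ) := by positivity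
    calc Real.log 2 * ((h : ℝ) * ((D / 2 : ℕ) : ℝ)) ≤ 1 * ((((D / 2 : ℕ) : ℝ)) * ((D / 2 : ℕ) : ℝ)) := by
          gcongr
      _ ≤ (D / 2) * (D / 2) := by rw [one_mul]; exact mul_le_mul hKr hKr hK0 (by positivity)
      _ ≤ (D : ℝ) ^ 2 / 2 := by nlinarith
  have htt : ‖(fun ab : Fin (D / 2 + 1) × Fin (D / 2 + 1) =>
      t ab * ((a : ℕ) : ℤ) ^ (D / 2 - (ab.2 : ℕ)) * ((2 : ℤ) ^ h) ^ (ab.2 : ℕ))‖ ≤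
      Real.exp ((D : ℝ) ^ 2) := by
    refine (norm_rescaled_le t ((a : ℕ) : ℤ) ((2 : ℤ) ^ h)).trans ?_
    calc ‖t‖ * (max |(((a : ℕ) : ℤ) : ℝ)| |((((2 : ℤ) ^ h : ℤ)) : ℝ)|) ^ (D / 2)
        ≤ Real.exp ((D : ℝ) ^ 2 / 2) * ((2 : ℝ) ^ h) ^ (D / 2) := by gcongr
      _ ≤ Real.exp ((D : ℝ) ^ 2 / 2) * Real.exp ((D : ℝ) ^ 2 / 2) := by gcongr
      _ = Real.exp ((D : ℝ) ^ 2) := by rw [← Real.exp_add]; ring_nf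
  -- the polynomial
  refine ⟨polyOfCoeffs fun ab => t ab * ((a : ℕ) : ℤ) ^ (D / 2 - (ab.2 : ℕ)) * ((2 : ℤ) ^ h) ^ (ab.2 : ℕ),
    polyOfCoeffs_ne_zero (rescaled_ne_zero ht0 ha0z hq0), ?_, ?_, ?_⟩
  · exact (totalDegree_polyOfCoeffs_le _).trans (by omega)
  · -- height
    rw [hD2]
    exact (mvPolyHeight_polyOfCoeffs_le _).trans htt
  · -- values
    intro i hi
    have hzero : aeval ![(0 : ℂ), ((((a : ℕ) : ℤ) : ℂ) / ((((2 : ℤ) ^ h : ℤ)) : ℂ))]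
        (royD^[i] (polyOfCoeffs fun ab => t ab * ((a : ℕ) : ℤ) ^ (D / 2 - (ab.2 : ℕ)) *
          ((2 : ℤ) ^ h) ^ (ab.2 : ℕ))) = 0 := by
      rw [aeval_rescaled t ((a : ℕ) : ℤ) ((2 : ℤ) ^ h) hq0 i, hker i hi, Int.cast_zero, mul_zero]
    rw [hpt] at hzero
    have key := norm_aeval_zero_sub_le
      (fun ab => t ab * ((a : ℕ) : ℤ) ^ (D / 2 - (ab.2 : ℕ)) * ((2 : ℤ) ^ h) ^ (ab.2 : ℕ)) i hy1' hr1
    rw [hzero, sub_zero] at key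
    refine key.trans ?_
    -- the count and the factorial
    set L : ℕ := 3 * ⌊(D : ℝ) ^ ((3 : ℝ) / 2)⌋₊ with hL
    have hL1 : 1 ≤ L := by
      have : 1 ≤ ⌊(D : ℝ) ^ ((3 : ℝ) / 2)⌋₊ := Nat.le_floor (by
        have : (1 : ℝ) ≤ (D : ℝ) ^ ((3 : ℝ) / 2) := Real.one_le_rpow hy1 (by norm_num)
        simpa using this)
      omega
    have hL0 : (0 : ℝ) < L := by exact_mod_cast hL1
    have hfac : (i.factorial : ℝ) ≤ (L : ℝ) ^ L := by
      have h1 : i.factorial ≤ i ^ i := Nat.factorial_le_pow i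
      have h2 : i ^ i ≤ L ^ i := Nat.pow_le_pow_left hi.le i
      have h3 : L ^ i ≤ L ^ L := Nat.pow_le_pow_right hL1 hi.le
      exact_mod_cast h1.trans (h2.trans h3)
    have hK0' : (0 : ℝ) ≤ ((D / 2 : ℕ) : ℝ) := Nat.cast_nonneg _
    have hcard : ((((D / 2 + 1) * (D / 2 + 1)) : ℕ) : ℝ) ≤ ((D : ℝ) + 1) ^ 2 := by
      push_cast; nlinarith [hKr', hy0, hK0']
    -- every factor as an exponential
    have hf1 : ((D : ℝ) + 1) ^ 2 ≤ Real.exp (2 * D) := by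
      have h1 : (D : ℝ) + 1 ≤ Real.exp D := by have := Real.add_one_le_exp (D : ℝ); linarith
      calc ((D : ℝ) + 1) ^ 2 ≤ (Real.exp D) ^ 2 := pow_le_pow_left₀ (by linarith) h1 2
        _ = Real.exp (2 * D) := by rw [← Real.exp_nat_mul]; norm_num
    have hf3 : (L : ℝ) ^ L = Real.exp (L * Real.log L) := by
      rw [← Real.rpow_natCast, Real.rpow_def_of_pos hL0]; ring_nf
    have hf4 : (D : ℝ) = Real.exp (Real.log D) := (Real.exp_log hy0).symm
    have hf5 : (2 : ℝ) * ((2 : ℝ) ^ (h ^ 4))⁻¹ = Real.exp (Real.log 2 - (h : ℝ) ^ 4 * Real.log 2) := by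
      rw [Real.exp_sub, Real.exp_log (by norm_num), ← Real.rpow_natCast, Real.rpow_def_of_pos (by norm_num),
        div_eq_mul_inv]
      push_cast; ring_nf
    have hlogD : Real.log D ≤ D := by have := Real.log_le_sub_one_of_pos hy0; linarith
    have hLlogL := count_mul_log_le hy1
    rw [← hL] at hLlogL
    have hexpo : 2 * (D : ℝ) + (D : ℝ) ^ 2 + L * Real.log L + D + (Real.log D + (Real.log 2 - (h : ℝ) ^ 4 * Real.log 2))
        ≤ -(D : ℝ) ^ ν := by
      rw [← hD2]
      linarith [hnum, hLlogL, hlogD, hl2]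
    calc ((((D / 2 + 1) * (D / 2 + 1)) : ℕ) : ℝ) *
          ‖(fun ab : Fin (D / 2 + 1) × Fin (D / 2 + 1) =>
            t ab * ((a : ℕ) : ℤ) ^ (D / 2 - (ab.2 : ℕ)) * ((2 : ℤ) ^ h) ^ (ab.2 : ℕ))‖ *
          ((i.factorial : ℝ) * Real.exp ((D / 2 : ℕ) : ℝ)) *
          (((D / 2 : ℕ) : ℝ) * ‖((∑' m : ℕ, ((2 : ℝ) ^ 2 ^ 4 ^ m)⁻¹ : ℝ) : ℂ) -
            (((a : ℝ) / (2 : ℝ) ^ h : ℝ) : ℂ)‖)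
        ≤ ((D : ℝ) + 1) ^ 2 * Real.exp ((D : ℝ) ^ 2) * ((L : ℝ) ^ L * Real.exp D) *
          ((D : ℝ) * (2 * ((2 : ℝ) ^ (h ^ 4))⁻¹)) := by
          gcongr
      _ ≤ Real.exp (2 * D) * Real.exp ((D : ℝ) ^ 2) * (Real.exp (L * Real.log L) * Real.exp D) *
          (Real.exp (Real.log D) * Real.exp (Real.log 2 - (h : ℝ) ^ 4 * Real.log 2)) := by
          rw [← hf3, ← hf4, ← hf5]
          gcongr
      _ = Real.exp (2 * (D : ℝ) + (D : ℝ) ^ 2 + L * Real.log L + D +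
          (Real.log D + (Real.log 2 - (h : ℝ) ^ 4 * Real.log 2))) := by simp only [← Real.exp_add]; ring_nf
      _ ≤ Real.exp (-(D : ℝ) ^ ν) := Real.exp_le_exp.2 hexpo

/-- The crux with the hypothesis required only on POLYNOMIAL WINDOWS of scales `[N, N^λ]`, for
infinitely many `N` (for `λ ≤ 1` this is the `∃ᶠ D`-variant `CruxFrequently` of §6). -/
def CruxOnWindows (lam : ℝ) : Prop :=
  ∀ (ξ η : ℂ), η ≠ 0 → ∀ (β τ ν : ℝ), 1 ≤ τ → τ < 2 → τ < β → 2 + β - τ < ν →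
    (∃ᶠ N : ℕ in atTop, ∀ D : ℕ, N ≤ D → (D : ℝ) ≤ (N : ℝ) ^ lam →
      ∃ P : MvPolynomial (Fin 2) ℤ, P ≠ 0 ∧ P.totalDegree ≤ D ∧
        (mvPolyHeight P : ℝ) ≤ Real.exp ((D : ℝ) ^ β) ∧
        ∀ i : ℕ, i < 3 * ⌊(D : ℝ) ^ τ⌋₊ → ‖aeval ![ξ, η] (royD^[i] P)‖ ≤ Real.exp (-(D : ℝ) ^ ν)) →
    IsAlgebraic ℚ ξ ∧ IsAlgebraic ℚ η

/-- **POLYNOMIAL WINDOWS OF SCALES DO NOT SUFFICE**: `CruxOnWindows λ` is FALSE for every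
`λ < 3/2` — witness `(0, η∞)`, `τ = 3/2`, `β = 2`, `ν = 13/5` inside the gap `(5/2, 8/3]`.
So a proof of the crux must couple each level `D` to levels below `D^{2/3}`. [folklore] -/
theorem not_cruxOnWindows {lam : ℝ} (hlam : lam < 3 / 2) : ¬ CruxOnWindows lam := fun hC =>
  transcendental_eta (hC 0 _ (Complex.ofReal_ne_zero.2 eta_pos.ne') 2 (3 / 2) (13 / 5) (by norm_num)
    (by norm_num) (by norm_num) (by norm_num)
    (frequently_window_hyp_at_eta (ν := 13 / 5) (by norm_num) (by linarith) (by linarith))).2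

/-- Larger windows give a weaker variant: `CruxOnWindows λ → CruxOnWindows λ'` for `λ ≤ λ'`. -/
theorem cruxOnWindows_mono {lam lam' : ℝ} (h : lam ≤ lam') (hC : CruxOnWindows lam) :
    CruxOnWindows lam' := by
  intro ξ η hη β τ ν h1 h2 hβ hν hW
  refine hC ξ η hη β τ ν h1 h2 hβ hν ?_
  refine (hW.and_eventually (eventually_ge_atTop 1)).mono ?_
  rintro N ⟨hN, hN1⟩ D hND hDle
  have hN1r : (1 : ℝ) ≤ N := by exact_mod_cast hN1
  exact hN D hND (hDle.trans (Real.rpow_le_rpow_of_exponent_le hN1r h))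

/-- The crux is the limit `λ → ∞` of the windowed variants: each `CruxOnWindows λ` implies it
(its `∀ᶠ D` hypothesis gives every window). So §8 places the crux strictly above the refuted
variants `λ < 3/2`. -/
theorem crux_of_cruxOnWindows {lam : ℝ} (hC : CruxOnWindows lam) : RoySmallValueDirichletGap := by
  intro ξ η hη β τ ν h1 h2 hβ hν hP
  refine hC ξ η hη β τ ν h1 h2 hβ hν ?_
  obtain ⟨N₀, hN₀⟩ := eventually_atTop.1 hP
  refine frequently_atTop.2 fun N => ⟨max N N₀, le_max_left _ _, fun D hND _ => ?_⟩
  exact hN₀ D ((le_max_right _ _).trans hND)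

/-- Even Roy's PRINTED Theorem 1.1 cannot be proved from windows `[N, N^λ]`, `λ < 4/3`: the
windowed variant with the printed bound `ν > 2 + β − τ + (τ−1)(2−τ)/(β+1−τ)` is false as well
(same witness, `ν = 3 > 8/3`). [cite: Roy2013, Theorem 1.1] -/
theorem roy2013_thm_1_1_false_on_windows {lam : ℝ} (hlam : lam < 4 / 3) :
    ¬ (∀ (ξ η : ℂ), η ≠ 0 → ∀ (β τ ν : ℝ), 1 ≤ τ → τ < 2 → τ < β →
      2 + β - τ + (τ - 1) * (2 - τ) / (β + 1 - τ) < ν →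
      (∃ᶠ N : ℕ in atTop, ∀ D : ℕ, N ≤ D → (D : ℝ) ≤ (N : ℝ) ^ lam →
        ∃ P : MvPolynomial (Fin 2) ℤ, P ≠ 0 ∧ P.totalDegree ≤ D ∧
          (mvPolyHeight P : ℝ) ≤ Real.exp ((D : ℝ) ^ β) ∧
          ∀ i : ℕ, i < 3 * ⌊(D : ℝ) ^ τ⌋₊ →
            ‖aeval ![ξ, η] (royD^[i] P)‖ ≤ Real.exp (-(D : ℝ) ^ ν)) →
      IsAlgebraic ℚ ξ ∧ IsAlgebraic ℚ η) := fun hC =>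
  transcendental_eta (hC 0 _ (Complex.ofReal_ne_zero.2 eta_pos.ne') 2 (3 / 2) 3 (by norm_num)
    (by norm_num) (by norm_num) (by norm_num)
    (frequently_window_hyp_at_eta (ν := 3) (by norm_num) (by linarith) (by linarith))).2


/-! ### §8b Sharper windows via Siegel's exponent: ratio `6/ν` (`23/10` in the gap)

Taking the Thue–Siegel kernel DIRECTLY at `(0, p/q)` (unknowns = the integer coefficients, no
rescaling) and keeping Siegel's exponent `L/(N−L) ≍ D^{−1/2}` gives heights
`exp(D^{7/4} + 12√D·log q)` (`exists_scaled_taylor_kernel`, uniform in `p, q`), so the base point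
`(0, s_n)` serves from `D ≍ (log q_n)^{2/3} = (log q_n)^{1/(β+1−τ)}` on: windows `[N, N^λ]` for every
`λ < 6/ν` (`frequently_window_hyp_at_eta'`), whence `CruxOnWindows λ` is false for
`0 ≤ λ < 23/10` and the windowed printed theorem for `0 ≤ λ < 2`. -/

/-- Entry bound for the Taylor matrix SCALED to the rational point `(0, p/q)`:
`|taylorInt n (X₁ᵃX₂ᵇ) · pᵇ q^{H−b}| ≤ L^L e^H R^H` for `n < L`, `b ≤ H`, `R = max(1,|p|,|q|)`.
[folklore] -/
theorem abs_scaled_entry_le {L H : ℕ} (hL : 1 ≤ L) (n : Fin L) (a : ℕ) (b : Fin (H + 1)) (p q : ℤ) :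
    |((taylorInt n (monoXY a b) * p ^ (b : ℕ) * q ^ (H - (b : ℕ)) : ℤ) : ℝ)| ≤
      (L : ℝ) ^ L * Real.exp H * (max 1 (max |(p : ℝ)| |(q : ℝ)|)) ^ H := by
  have hb : (b : ℕ) ≤ H := Nat.lt_succ_iff.1 b.isLt
  have hn : (n : ℕ) ≤ L := n.isLt.le
  set R : ℝ := max 1 (max |(p : ℝ)| |(q : ℝ)|) with hR
  have hR1 : 1 ≤ R := le_max_left _ _
  have hfact : ((n : ℕ).factorial : ℝ) ≤ (L : ℝ) ^ L := by
    calc ((n : ℕ).factorial : ℝ) ≤ ((n : ℕ) : ℝ) ^ (n : ℕ) := by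
          exact_mod_cast Nat.factorial_le_pow n
      _ ≤ (L : ℝ) ^ (n : ℕ) := by gcongr
      _ ≤ (L : ℝ) ^ L := pow_le_pow_right₀ (by exact_mod_cast hL) hn
  push_cast
  rw [abs_mul, abs_mul, abs_pow, abs_pow]
  have h1 : |(taylorInt n (monoXY a b) : ℝ)| ≤ (L : ℝ) ^ L * Real.exp H := by
    calc |(taylorInt n (monoXY a b) : ℝ)| ≤ (n : ℕ).factorial * Real.exp (b : ℕ) :=
          abs_taylorInt_monoXY_le n a b
      _ ≤ (L : ℝ) ^ L * Real.exp H := by gcongr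
  have h2 : |(p : ℝ)| ^ (b : ℕ) ≤ R ^ (b : ℕ) :=
    pow_le_pow_left₀ (abs_nonneg _) ((le_max_left _ _).trans (le_max_right _ _)) _
  have h3 : |(q : ℝ)| ^ (H - (b : ℕ)) ≤ R ^ (H - (b : ℕ)) :=
    pow_le_pow_left₀ (abs_nonneg _) ((le_max_right _ _).trans (le_max_right _ _)) _
  calc |(taylorInt n (monoXY a b) : ℝ)| * |(p : ℝ)| ^ (b : ℕ) * |(q : ℝ)| ^ (H - (b : ℕ))
      ≤ ((L : ℝ) ^ L * Real.exp H) * R ^ (b : ℕ) * R ^ (H - (b : ℕ)) := by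
        gcongr
    _ = (L : ℝ) ^ L * Real.exp H * R ^ H := by rw [mul_assoc, ← pow_add, Nat.add_sub_cancel' hb]

set_option maxHeartbeats 800000 in
/-- **Thue–Siegel at `(0, p/q)` with Siegel's exponent, uniformly in `p, q`** (`τ = 3/2`): for all
large `D` and ALL integers `p, q`, there is a non-zero integer vector `t` on the box `{0..⌊D/2⌋}²`
with `∑ t_{ab} · 𝒟₁ⁿ(X₁ᵃX₂ᵇ)(0,1) · pᵇ q^{⌊D/2⌋−b} = 0` for all `n < 3⌊D^{3/2}⌋` and
`‖t‖ ≤ exp(D^{7/4} + 12 D^{1/2} log R)`, `R = max(1, |p|, |q|)`. [cite: Roy2013, p. 3 (Thue–Siegel)] -/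
theorem exists_scaled_taylor_kernel :
    ∀ᶠ D : ℕ in atTop, ∀ p q : ℤ, ∃ t : Fin (D / 2 + 1) × Fin (D / 2 + 1) → ℤ, t ≠ 0 ∧
      (∀ n : ℕ, n < 3 * ⌊(D : ℝ) ^ ((3 : ℝ) / 2)⌋₊ →
        ∑ ab : Fin (D / 2 + 1) × Fin (D / 2 + 1),
          taylorInt n (monoXY ab.1 ab.2) * p ^ (ab.2 : ℕ) * q ^ (D / 2 - (ab.2 : ℕ)) * t ab = 0) ∧
      ‖t‖ ≤ Real.exp ((D : ℝ) ^ ((7 : ℝ) / 4) +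
        12 * (D : ℝ) ^ ((1 : ℝ) / 2) * Real.log (max 1 (max |(p : ℝ)| |(q : ℝ)|))) := by
  have hE : (0 : ℝ) < 1 / 3 := by norm_num
  have hev := (((eventually_nat_rpow_le 60 (show (1 : ℝ) / 2 < 7 / 4 by norm_num) hE).and
    (eventually_nat_rpow_le (504 / 5) (show (1 : ℝ) < 7 / 4 by norm_num) hE)).and
    (eventually_nat_rpow_log_le (show (1 : ℝ) < 7 / 4 by norm_num) (show (0 : ℝ) ≤ 108 by norm_num) hE)).and
    (eventually_nat_rpow_le 24 (show (3 : ℝ) / 2 < 2 by norm_num) (show (0 : ℝ) < 1 by norm_num))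
  filter_upwards [hev, eventually_ge_atTop 1] with D hD hD1
  obtain ⟨⟨⟨e1, e2⟩, e3⟩, e4⟩ := hD
  intro p q
  have hD1r : (1 : ℝ) ≤ D := by exact_mod_cast hD1
  have hD0r : (0 : ℝ) < D := by linarith
  set x : ℝ := (D : ℝ) with hx
  set H : ℕ := D / 2 with hH
  set L : ℕ := 3 * ⌊x ^ ((3 : ℝ) / 2)⌋₊ with hL
  set R : ℝ := max 1 (max |(p : ℝ)| |(q : ℝ)|) with hR
  have hR1 : 1 ≤ R := le_max_left _ _
  have hR0 : 0 < R := by linarith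
  have hlogR : 0 ≤ Real.log R := Real.log_nonneg hR1
  -- sizes
  have hxτ1 : 1 ≤ x ^ ((3 : ℝ) / 2) := Real.one_le_rpow hD1r (by norm_num)
  have hL1 : 1 ≤ L := by
    have : 1 ≤ ⌊x ^ ((3 : ℝ) / 2)⌋₊ := Nat.le_floor (by simpa using hxτ1)
    omega
  have hLx : (L : ℝ) ≤ 3 * x ^ ((3 : ℝ) / 2) := by
    rw [hL]; push_cast
    exact mul_le_mul_of_nonneg_left (Nat.floor_le (by positivity)) (by norm_num)
  have hL0 : (0 : ℝ) < L := by exact_mod_cast hL1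
  have hHx : (H : ℝ) ≤ x / 2 := by
    rw [hx, le_div_iff₀ (by norm_num : (0:ℝ) < 2)]; exact_mod_cast (show H * 2 ≤ D by omega)
  have hHx' : x / 2 ≤ (H : ℝ) + 1 := by
    rw [hx, div_le_iff₀ (by norm_num : (0:ℝ) < 2)]
    exact_mod_cast (show D ≤ (H + 1) * 2 by omega)
  set N : ℕ := (H + 1) * (H + 1) with hN
  -- the scaled matrix
  set M : Matrix (Fin L) (Fin (H + 1) × Fin (H + 1)) ℤ :=
    Matrix.of fun n ab => taylorInt n (monoXY ab.1 ab.2) * p ^ (ab.2 : ℕ) * q ^ (H - (ab.2 : ℕ))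
    with hM
  clear_value x L N
  have hN4 : x ^ 2 / 4 ≤ (N : ℝ) := by
    rw [hN]; push_cast
    have h2 : (x / 2) ^ 2 ≤ ((H : ℝ) + 1) ^ 2 := pow_le_pow_left₀ (by linarith) hHx' 2
    nlinarith [h2]
  have hNx : (N : ℝ) ≤ (x + 1) ^ 2 := by
    rw [hN]; push_cast
    have h2 : ((H : ℝ) + 1) ^ 2 ≤ (x + 1) ^ 2 := pow_le_pow_left₀ (by positivity) (by linarith) 2
    nlinarith [h2]
  have hx24 : 24 * x ^ ((3 : ℝ) / 2) ≤ x ^ (2 : ℝ) := by simpa using e4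
  have hx2 : x ^ (2 : ℝ) = x ^ 2 := Real.rpow_two x
  have hLN2 : 2 * (L : ℝ) ≤ N := by
    calc 2 * (L : ℝ) ≤ 6 * x ^ ((3 : ℝ) / 2) := by linarith
      _ ≤ x ^ 2 / 4 := by rw [← hx2]; linarith
      _ ≤ N := hN4
  have hLN : L < N := by
    have h2 : ((2 * L : ℕ) : ℝ) ≤ N := by push_cast; exact hLN2
    have h3 : 2 * L ≤ N := by exact_mod_cast h2
    omega
  -- Siegel
  letI instM : SeminormedAddCommGroup (Matrix (Fin L) (Fin (H + 1) × Fin (H + 1)) ℤ) :=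
    Matrix.seminormedAddCommGroup
  obtain ⟨t, ht0, hAt, hnorm⟩ := Int.Matrix.exists_ne_zero_int_vec_norm_le M
    (by rw [Fintype.card_fin, Fintype.card_prod, Fintype.card_fin, ← hN]; exact hLN)
    (by rw [Fintype.card_fin]; omega)
  refine ⟨t, ht0, fun n hn => ?_, ?_⟩
  · have := congrFun hAt ⟨n, hn⟩
    simpa [hM, Matrix.mulVec, dotProduct] using this
  · have hnorm' : ‖t‖ ≤ ((((H + 1) * (H + 1) : ℕ) : ℝ) * max 1 ‖M‖) ^
        ((L : ℝ) / ((((H + 1) * (H + 1) : ℕ) : ℝ) - L)) := by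
      have h := hnorm
      rw [Fintype.card_fin, Fintype.card_prod, Fintype.card_fin] at h
      exact h
    refine hnorm'.trans ?_
    -- the base and the exponent
    have hA : ‖M‖ ≤ (L : ℝ) ^ L * Real.exp H * R ^ H := by
      rw [Matrix.norm_le_iff (by positivity)]
      rintro n ⟨a, b⟩
      rw [hM, Matrix.of_apply, Int.norm_eq_abs]
      exact abs_scaled_entry_le hL1 n a b p q
    have hmax : max 1 ‖M‖ ≤ (L : ℝ) ^ L * Real.exp H * R ^ H := by
      refine max_le ?_ hA
      exact one_le_mul_of_one_le_of_one_le (one_le_mul_of_one_le_of_one_le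
        (one_le_pow₀ (by exact_mod_cast hL1)) (Real.one_le_exp (by positivity))) (one_le_pow₀ hR1)
    have hmax1 : 1 ≤ max 1 ‖M‖ := le_max_left _ _
    have hN1 : (1 : ℝ) ≤ (((H + 1) * (H + 1) : ℕ) : ℝ) := by
      exact_mod_cast Nat.one_le_iff_ne_zero.2 (by positivity)
    have hNcast : (((H + 1) * (H + 1) : ℕ) : ℝ) = N := by rw [hN]
    set B₀ : ℝ := (((H + 1) * (H + 1) : ℕ) : ℝ) * max 1 ‖M‖ with hB₀
    have hB₀1 : 1 ≤ B₀ := one_le_mul_of_one_le_of_one_le hN1 hmax1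
    have hB₀pos : 0 < B₀ := by linarith
    have hlogx : 0 ≤ Real.log x := Real.log_nonneg hD1r
    have hlog3 : Real.log 3 < 14 / 10 := by
      have := Real.log_two_lt_d9
      have h34 : Real.log 3 ≤ Real.log 4 := Real.log_le_log (by norm_num) (by norm_num)
      have h4 : Real.log 4 = 2 * Real.log 2 := by
        rw [show (4 : ℝ) = 2 ^ 2 by norm_num, Real.log_pow]; norm_num
      linarith
    have hLlogL : (L : ℝ) * Real.log L ≤ 3 * x ^ ((3 : ℝ) / 2) * (14 / 10 + 3 / 2 * Real.log x) := by
      have hlogL : Real.log L ≤ 14 / 10 + 3 / 2 * Real.log x := by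
        calc Real.log L ≤ Real.log (3 * x ^ ((3 : ℝ) / 2)) := Real.log_le_log hL0 hLx
          _ = Real.log 3 + 3 / 2 * Real.log x := by
              rw [Real.log_mul (by norm_num) (by positivity), Real.log_rpow hD0r]
          _ ≤ 14 / 10 + 3 / 2 * Real.log x := by linarith
      calc (L : ℝ) * Real.log L ≤ L * (14 / 10 + 3 / 2 * Real.log x) :=
            mul_le_mul_of_nonneg_left hlogL hL0.le
        _ ≤ 3 * x ^ ((3 : ℝ) / 2) * (14 / 10 + 3 / 2 * Real.log x) :=
            mul_le_mul_of_nonneg_right hLx (by positivity)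
    have hlogB₀ : Real.log B₀ ≤ 2 * x + (3 * x ^ ((3 : ℝ) / 2) * (14 / 10 + 3 / 2 * Real.log x) +
        x / 2 + x / 2 * Real.log R) := by
      have hlogN : Real.log (((H + 1) * (H + 1) : ℕ) : ℝ) ≤ 2 * x := by
        have h1 : Real.log (((H + 1) * (H + 1) : ℕ) : ℝ) ≤ Real.log ((x + 1) ^ 2) :=
          Real.log_le_log (by positivity) (by rw [hNcast]; exact hNx)
        have h2 : Real.log (x + 1) ≤ x := by
          have := Real.log_le_sub_one_of_pos (show 0 < x + 1 by linarith); linarith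
        have hlog2 : Real.log ((x + 1) ^ 2) = 2 * Real.log (x + 1) := by
          rw [Real.log_pow]; norm_num
        rw [hlog2] at h1; linarith
      have hlogmax : Real.log (max 1 ‖M‖) ≤ L * Real.log L + H + H * Real.log R := by
        calc Real.log (max 1 ‖M‖) ≤ Real.log ((L : ℝ) ^ L * Real.exp H * R ^ H) :=
              Real.log_le_log (by positivity) hmax
          _ = L * Real.log L + H + H * Real.log R := by
              rw [Real.log_mul (by positivity) (by positivity), Real.log_mul (by positivity) (by positivity),
                Real.log_pow, Real.log_exp, Real.log_pow]
      have hHR : (H : ℝ) * Real.log R ≤ x / 2 * Real.log R := mul_le_mul_of_nonneg_right hHx hlogR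
      rw [hB₀, Real.log_mul (by positivity) (by positivity)]
      linarith
    have hlogB₀0 : 0 ≤ Real.log B₀ := Real.log_nonneg hB₀1
    have hexp_le : (L : ℝ) / ((((H + 1) * (H + 1) : ℕ) : ℝ) - L) ≤ 24 * x ^ (-(1 : ℝ) / 2) := by
      rw [hNcast]
      have hLhalf : (L : ℝ) ≤ N / 2 := by
        rw [le_div_iff₀ (two_pos : (0:ℝ) < 2), mul_comm]; exact hLN2
      have hNL : (N : ℝ) / 2 ≤ (N : ℝ) - L := by
        calc (N : ℝ) / 2 = N - N / 2 := by ring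
          _ ≤ N - L := sub_le_sub_left hLhalf _
      have hNpos' : (0 : ℝ) < N := lt_of_lt_of_le (by positivity) hN4
      have hNLpos : (0 : ℝ) < (N : ℝ) - L := lt_of_lt_of_le (half_pos hNpos') hNL
      have hNpos : (0 : ℝ) < x ^ 2 / 8 := by positivity
      have hx8 : x ^ 2 / 8 ≤ (N : ℝ) - L := by
        calc x ^ 2 / 8 = (x ^ 2 / 4) / 2 := by ring
          _ ≤ (N : ℝ) / 2 := by gcongr
          _ ≤ N - L := hNL
      calc (L : ℝ) / ((N : ℝ) - L) ≤ (3 * x ^ ((3 : ℝ) / 2)) / ((N : ℝ) - L) :=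
            div_le_div_of_nonneg_right hLx hNLpos.le
        _ ≤ (3 * x ^ ((3 : ℝ) / 2)) / (x ^ 2 / 8) :=
            div_le_div_of_nonneg_left (by positivity) hNpos hx8
        _ = 24 * (x ^ ((3 : ℝ) / 2) / x ^ 2) := by ring
        _ = 24 * x ^ (-(1 : ℝ) / 2) := by
            rw [← hx2, ← Real.rpow_sub hD0r]; norm_num
    have hexp0 : 0 ≤ (L : ℝ) / ((((H + 1) * (H + 1) : ℕ) : ℝ) - L) := by
      rw [hNcast]
      have hLhalf : (L : ℝ) ≤ N / 2 := by
        rw [le_div_iff₀ (two_pos : (0:ℝ) < 2), mul_comm]; exact hLN2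
      have hNpos' : (0 : ℝ) < N := lt_of_lt_of_le (by positivity) hN4
      exact div_nonneg hL0.le (by
        have : (N : ℝ) / 2 ≤ N - L := by
          calc (N : ℝ) / 2 = N - N / 2 := by ring
            _ ≤ N - L := sub_le_sub_left hLhalf _
        exact (lt_of_lt_of_le (half_pos hNpos') this).le)
    -- x-power identities
    have hp1 : x ^ (-(1 : ℝ) / 2) * x = x ^ ((1 : ℝ) / 2) := by
      rw [← Real.rpow_add_one hD0r.ne']; norm_num
    have hp2 : x ^ (-(1 : ℝ) / 2) * x ^ ((3 : ℝ) / 2) = x := by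
      rw [← Real.rpow_add hD0r]; norm_num
    have hxm : 0 ≤ x ^ (-(1 : ℝ) / 2) := Real.rpow_nonneg hD0r.le _
    have hx12 : 0 ≤ x ^ ((1 : ℝ) / 2) := Real.rpow_nonneg hD0r.le _
    have hxr1 : x ^ (1 : ℝ) = x := Real.rpow_one x
    rw [hxr1] at e2 e3
    -- assemble
    have hprod : Real.log B₀ * ((L : ℝ) / ((((H + 1) * (H + 1) : ℕ) : ℝ) - L)) ≤
        x ^ ((7 : ℝ) / 4) + 12 * x ^ ((1 : ℝ) / 2) * Real.log R := by
      calc Real.log B₀ * ((L : ℝ) / ((((H + 1) * (H + 1) : ℕ) : ℝ) - L))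
          ≤ (2 * x + (3 * x ^ ((3 : ℝ) / 2) * (14 / 10 + 3 / 2 * Real.log x) + x / 2 +
              x / 2 * Real.log R)) * (24 * x ^ (-(1 : ℝ) / 2)) :=
            mul_le_mul hlogB₀ hexp_le hexp0 (by positivity)
        _ = 60 * (x ^ (-(1 : ℝ) / 2) * x) + (504 / 5) * (x ^ (-(1 : ℝ) / 2) * x ^ ((3 : ℝ) / 2)) +
              108 * (x ^ (-(1 : ℝ) / 2) * x ^ ((3 : ℝ) / 2)) * Real.log x +
              12 * (x ^ (-(1 : ℝ) / 2) * x) * Real.log R := by ring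
        _ = 60 * x ^ ((1 : ℝ) / 2) + (504 / 5) * x + 108 * x * Real.log x +
              12 * x ^ ((1 : ℝ) / 2) * Real.log R := by rw [hp1, hp2]
        _ ≤ 1 / 3 * x ^ ((7 : ℝ) / 4) + 1 / 3 * x ^ ((7 : ℝ) / 4) + 1 / 3 * x ^ ((7 : ℝ) / 4) +
              12 * x ^ ((1 : ℝ) / 2) * Real.log R := by
            linarith only [e1, e2, e3]
        _ = x ^ ((7 : ℝ) / 4) + 12 * x ^ ((1 : ℝ) / 2) * Real.log R := by ring
    rw [Real.rpow_def_of_pos hB₀pos]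
    exact Real.exp_le_exp.2 hprod


/-- Kernel identity ⇒ exact zeros at `(0, p/q)`. [folklore] -/
theorem aeval_zero_rat_eq_zero_of_kernel {H : ℕ} (t : Fin (H + 1) × Fin (H + 1) → ℤ) (p q : ℤ)
    (hq : q ≠ 0) (n : ℕ)
    (hker : ∑ ab : Fin (H + 1) × Fin (H + 1),
      taylorInt n (monoXY ab.1 ab.2) * p ^ (ab.2 : ℕ) * q ^ (H - (ab.2 : ℕ)) * t ab = 0) :
    aeval ![0, ((p : ℂ) / (q : ℂ))] (royD^[n] (polyOfCoeffs t)) = 0 := by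
  rw [aeval_zero_iterate_royD_polyOfCoeffs]
  have hq' : (q : ℂ) ≠ 0 := by exact_mod_cast hq
  have hqH : (q : ℂ) ^ H ≠ 0 := pow_ne_zero _ hq'
  have hmul : (q : ℂ) ^ H * ∑ ab : Fin (H + 1) × Fin (H + 1),
      (t ab : ℂ) * (((p : ℂ) / (q : ℂ)) ^ (ab.2 : ℕ) * (taylorInt n (monoXY ab.1 ab.2) : ℂ)) =
      ((∑ ab : Fin (H + 1) × Fin (H + 1),
        taylorInt n (monoXY ab.1 ab.2) * p ^ (ab.2 : ℕ) * q ^ (H - (ab.2 : ℕ)) * t ab : ℤ) : ℂ) := by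
    push_cast
    rw [Finset.mul_sum]
    refine Finset.sum_congr rfl fun ab _ => ?_
    have hb : (ab.2 : ℕ) ≤ H := Nat.lt_succ_iff.1 ab.2.isLt
    have h1 : (q : ℂ) ^ (ab.2 : ℕ) * ((p : ℂ) / (q : ℂ)) ^ (ab.2 : ℕ) = (p : ℂ) ^ (ab.2 : ℕ) := by
      rw [← mul_pow, mul_div_cancel₀ _ hq']
    calc (q : ℂ) ^ H * ((t ab : ℂ) * (((p : ℂ) / (q : ℂ)) ^ (ab.2 : ℕ) *
          (taylorInt n (monoXY ab.1 ab.2) : ℂ)))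
        = (t ab : ℂ) * (taylorInt n (monoXY ab.1 ab.2) : ℂ) *
            ((q : ℂ) ^ (H - (ab.2 : ℕ)) * ((q : ℂ) ^ (ab.2 : ℕ) * ((p : ℂ) / (q : ℂ)) ^ (ab.2 : ℕ))) := by
            rw [← mul_assoc ((q : ℂ) ^ (H - (ab.2 : ℕ))), pow_sub_mul_pow _ hb]; ring
      _ = (taylorInt n (monoXY ab.1 ab.2) : ℂ) * (p : ℂ) ^ (ab.2 : ℕ) * (q : ℂ) ^ (H - (ab.2 : ℕ)) *
            (t ab : ℂ) := by rw [h1]; ring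
  have h0 : (q : ℂ) ^ H * ∑ ab : Fin (H + 1) × Fin (H + 1),
      (t ab : ℂ) * (((p : ℂ) / (q : ℂ)) ^ (ab.2 : ℕ) * (taylorInt n (monoXY ab.1 ab.2) : ℂ)) = 0 := by
    rw [hmul, hker]; push_cast; ring
  exact (mul_eq_zero.mp h0).resolve_left hqH

/-- `y^a ≤ 2312⁴·x^{ea}` for `0 ≤ y ≤ 2312·x^e`, `x ≥ 1`, `0 ≤ a ≤ 4`. [folklore] -/
theorem rpow_le_const_mul {x y e a : ℝ} (hx : 1 ≤ x) (hy0 : 0 ≤ y) (hyY : y ≤ 2312 * x ^ e)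
    (ha : 0 ≤ a) (ha4 : a ≤ 4) : y ^ a ≤ (2312 : ℝ) ^ (4 : ℕ) * x ^ (e * a) := by
  have hx0 : 0 ≤ x := by linarith
  have hxe : 0 ≤ x ^ e := Real.rpow_nonneg hx0 e
  calc y ^ a ≤ (2312 * x ^ e) ^ a := Real.rpow_le_rpow hy0 hyY ha
    _ = (2312 : ℝ) ^ a * (x ^ e) ^ a := Real.mul_rpow (by norm_num) hxe
    _ = (2312 : ℝ) ^ a * x ^ (e * a) := by rw [← Real.rpow_mul hx0]
    _ ≤ (2312 : ℝ) ^ (4 : ℝ) * x ^ (e * a) :=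
        mul_le_mul_of_nonneg_right (Real.rpow_le_rpow_of_exponent_le (by norm_num) ha4)
          (Real.rpow_nonneg hx0 _)
    _ = (2312 : ℝ) ^ (4 : ℕ) * x ^ (e * a) := by rw [← Real.rpow_natCast]; norm_num

/-- **Window numerics (Siegel-exponent version)**: for `λ < 3`, `0 < ν ≤ 4`, `λν < 6`, eventually
in `h`, for every real `y ∈ [1, 2312·h^{2λ/3}]`: `4y + 10y² + 5y^{3/2} + 1 + y^ν ≤ h⁴ log 2`.
[folklore] -/
theorem window_exponent_numerics' {ν lam : ℝ} (hν : 0 < ν) (hν4 : ν ≤ 4) (hlam3 : lam < 3)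
    (hlamν : lam * ν < 6) :
    ∀ᶠ h : ℕ in atTop, ∀ y : ℝ, 1 ≤ y → y ≤ 2312 * (h : ℝ) ^ (2 * lam / 3) →
      4 * y + 10 * y ^ (2 : ℝ) + 5 * y ^ ((3 : ℝ) / 2) + 1 + y ^ ν ≤ (h : ℝ) ^ 4 * Real.log 2 := by
  have hE : (0 : ℝ) < Real.log 2 / 5 := by have := Real.log_pos one_lt_two; positivity
  set K : ℝ := (2312 : ℝ) ^ (4 : ℕ) with hK
  have hK0 : 0 ≤ K := by positivity
  have hev := ((((eventually_nat_rpow_le (K * 4) (show 2 * lam / 3 * 1 < 4 by linarith) hE).and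
    (eventually_nat_rpow_le (K * 10) (show 2 * lam / 3 * 2 < 4 by linarith) hE)).and
    (eventually_nat_rpow_le (K * 5) (show 2 * lam / 3 * (3 / 2) < 4 by linarith) hE)).and
    (eventually_nat_rpow_le K (show 2 * lam / 3 * ν < 4 by nlinarith) hE)).and
    (eventually_nat_rpow_le 1 (show (0 : ℝ) < 4 by norm_num) hE)
  filter_upwards [hev, eventually_ge_atTop 1] with h hh hh1
  obtain ⟨⟨⟨⟨e1, e2⟩, e3⟩, e5⟩, e6⟩ := hh
  intro y hy1 hy2
  have hx1 : (1 : ℝ) ≤ h := by exact_mod_cast hh1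
  have hy0 : 0 ≤ y := by linarith
  have hx4 : (h : ℝ) ^ (4 : ℝ) = (h : ℝ) ^ 4 := by exact_mod_cast Real.rpow_natCast (h : ℝ) 4
  rw [hx4] at e1 e2 e3 e5 e6
  rw [Real.rpow_zero, mul_one] at e6
  have t1 : y ≤ K * (h : ℝ) ^ (2 * lam / 3 * 1) := by
    have := rpow_le_const_mul hx1 hy0 hy2 zero_le_one (by norm_num)
    rwa [Real.rpow_one] at this
  have t2 : y ^ (2 : ℝ) ≤ K * (h : ℝ) ^ (2 * lam / 3 * 2) :=
    rpow_le_const_mul hx1 hy0 hy2 (by norm_num) (by norm_num)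
  have t3 : y ^ ((3 : ℝ) / 2) ≤ K * (h : ℝ) ^ (2 * lam / 3 * (3 / 2)) :=
    rpow_le_const_mul hx1 hy0 hy2 (by norm_num) (by norm_num)
  have t5 : y ^ ν ≤ K * (h : ℝ) ^ (2 * lam / 3 * ν) :=
    rpow_le_const_mul hx1 hy0 hy2 hν.le hν4
  nlinarith [t1, t2, t3, t5, e1, e2, e3, e5, e6, hK0]

/-- `2 ≤ D^{1/4}` for `D ≥ 16`. [folklore] -/
theorem two_le_rpow_quarter {x : ℝ} (hx : 16 ≤ x) : 2 ≤ x ^ ((1 : ℝ) / 4) := by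
  have h0 : (0 : ℝ) ≤ x := by linarith
  have h : (2 : ℝ) ^ (4 : ℕ) ≤ (x ^ ((1 : ℝ) / 4)) ^ (4 : ℕ) := by
    rw [← Real.rpow_natCast (x ^ ((1 : ℝ) / 4)) 4, ← Real.rpow_mul h0]; norm_num; linarith
  exact le_of_pow_le_pow_left₀ (by norm_num) (Real.rpow_nonneg h0 _) h

set_option maxHeartbeats 1600000 in
/-- **Sharper windows at `(0, η∞)` (Siegel's exponent)**: for `τ = 3/2`, `β = 2`, `0 < ν ≤ 4`,
`0 ≤ λ < 3` with `λν < 6`, there are infinitely many `N` such that for EVERY `D ∈ [N, N^λ]` a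
polynomial as in the crux's hypothesis exists at `(0, η∞)`.  The base point `(0, s_n)` now serves
from `N ≍ e(n)^{2/3}` on (heights `exp(D^{7/4} + 12√D·log q_n)` instead of `q_n^{D/2}`), up to
`≍ e(n)^{4/ν}`: exponent ratio `6/ν`. [folklore] -/
theorem frequently_window_hyp_at_eta' {ν lam : ℝ} (hν : 0 < ν) (hν4 : ν ≤ 4) (hlam0 : 0 ≤ lam)
    (hlam3 : lam < 3) (hlamν : lam * ν < 6) :
    ∃ᶠ N : ℕ in atTop, ∀ D : ℕ, N ≤ D → (D : ℝ) ≤ (N : ℝ) ^ lam →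
      ∃ P : MvPolynomial (Fin 2) ℤ, P ≠ 0 ∧ P.totalDegree ≤ D ∧
        (mvPolyHeight P : ℝ) ≤ Real.exp ((D : ℝ) ^ (2 : ℝ)) ∧
        ∀ i : ℕ, i < 3 * ⌊(D : ℝ) ^ ((3 : ℝ) / 2)⌋₊ →
          ‖aeval ![(0 : ℂ), ((∑' m : ℕ, ((2 : ℝ) ^ 2 ^ 4 ^ m)⁻¹ : ℝ) : ℂ)] (royD^[i] P)‖ ≤
            Real.exp (-(D : ℝ) ^ ν) := by
  rw [Filter.frequently_atTop]
  intro N₀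
  obtain ⟨D₀, hD₀⟩ := Filter.eventually_atTop.1 exists_scaled_taylor_kernel
  obtain ⟨h₀, hh₀⟩ := Filter.eventually_atTop.1 (window_exponent_numerics' hν hν4 hlam3 hlamν)
  obtain ⟨h₁, hh₁⟩ := Filter.eventually_atTop.1
    (eventually_nat_rpow_le ((D₀ : ℝ) + N₀ + 16) (show (0 : ℝ) < 2 / 3 by norm_num) one_pos)
  obtain ⟨n, hn⟩ : ∃ n : ℕ, n = h₀ + h₁ := ⟨_, rfl⟩
  obtain ⟨h, hh⟩ : ∃ h : ℕ, h = 2 ^ 4 ^ n := ⟨_, rfl⟩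
  have hnh : n + 2 ≤ h := hh ▸ add_two_le_e n
  have hh1 : 1 ≤ h := by omega
  have hx1 : (1 : ℝ) ≤ h := by exact_mod_cast hh1
  have hx0 : (0 : ℝ) < h := by linarith
  -- the window base `W = (17h)^{2/3}` and `N = ⌈W⌉`
  set W : ℝ := (17 * (h : ℝ)) ^ ((2 : ℝ) / 3) with hW
  have hW0 : 0 ≤ W := Real.rpow_nonneg (by positivity) _
  have hW16 : (D₀ : ℝ) + N₀ + 16 ≤ W := by
    have e := hh₁ h (by omega)
    rw [Real.rpow_zero, mul_one, one_mul] at e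
    refine e.trans ?_
    exact Real.rpow_le_rpow hx0.le (by linarith) (by norm_num)
  obtain ⟨N, hN⟩ : ∃ N : ℕ, N = ⌈W⌉₊ := ⟨_, rfl⟩
  have hNW : W ≤ N := by rw [hN]; exact Nat.le_ceil W
  have hNW' : (N : ℝ) ≤ W + 1 := by rw [hN]; exact (Nat.ceil_lt_add_one hW0).le
  have hNN₀ : N₀ ≤ N := by
    have : (N₀ : ℝ) ≤ N := by linarith
    exact_mod_cast this
  refine ⟨N, hNN₀, fun D hND hDle => ?_⟩
  have hNDr : (N : ℝ) ≤ D := by exact_mod_cast hND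
  have hWD : W ≤ D := hNW.trans hNDr
  have hD₀D : D₀ ≤ D := by
    have : (D₀ : ℝ) ≤ D := by linarith
    exact_mod_cast this
  have hy16 : (16 : ℝ) ≤ D := by linarith
  have hy1 : (1 : ℝ) ≤ D := by linarith
  have hy0 : (0 : ℝ) < D := by linarith
  -- `D ≤ 2312 · h^{2λ/3}`
  have hDtop : (D : ℝ) ≤ 2312 * (h : ℝ) ^ (2 * lam / 3) := by
    have hW1 : 1 ≤ W := by linarith
    have h2W : (N : ℝ) ≤ 2 * W := by linarith
    calc (D : ℝ) ≤ (N : ℝ) ^ lam := hDle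
      _ ≤ (2 * W) ^ lam := Real.rpow_le_rpow (by positivity) h2W hlam0
      _ = 2 ^ lam * ((17 : ℝ) ^ ((2 : ℝ) / 3 * lam) * (h : ℝ) ^ ((2 : ℝ) / 3 * lam)) := by
          rw [Real.mul_rpow (by norm_num) hW0, hW, Real.mul_rpow (by norm_num) hx0.le,
            Real.mul_rpow (Real.rpow_nonneg (by norm_num) _) (Real.rpow_nonneg hx0.le _),
            ← Real.rpow_mul (by norm_num), ← Real.rpow_mul hx0.le]
      _ ≤ 2 ^ (3 : ℝ) * ((17 : ℝ) ^ (2 : ℝ) * (h : ℝ) ^ ((2 : ℝ) / 3 * lam)) := by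
          gcongr
          all_goals linarith
      _ = 2312 * (h : ℝ) ^ (2 * lam / 3) := by norm_num; ring_nf
  -- the kernel at `(0, s_n)`
  have hηpos := eta_pos
  have hηhalf := eta_le_half
  obtain ⟨htail0, htail⟩ := tail_bounds n
  rw [e_succ, ← hh] at htail
  have ha0 : 0 < ∑ m ∈ range (n + 1), (2 : ℕ) ^ (2 ^ 4 ^ n - 2 ^ 4 ^ m) := numerator_pos n
  obtain ⟨a, ha⟩ : ∃ a : ℕ, a = ∑ m ∈ range (n + 1), (2 : ℕ) ^ (2 ^ 4 ^ n - 2 ^ 4 ^ m) := ⟨_, rfl⟩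
  rw [← ha] at ha0
  have hs : ∑ m ∈ range (n + 1), ((2 : ℝ) ^ 2 ^ 4 ^ m)⁻¹ = (a : ℝ) / (2 : ℝ) ^ h := by
    rw [partialSum_eq n, ← ha, ← hh]
  rw [hs] at htail0 htail
  have hq0 : ((2 : ℤ) ^ h) ≠ 0 := by positivity
  have hs_le : (a : ℝ) / (2 : ℝ) ^ h ≤ 1 := by linarith
  have hs_pos : 0 < (a : ℝ) / (2 : ℝ) ^ h := by positivity
  have ha_le : (a : ℝ) ≤ (2 : ℝ) ^ h := by rwa [div_le_one (by positivity)] at hs_le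
  have hy1' : ‖((∑' m : ℕ, ((2 : ℝ) ^ 2 ^ 4 ^ m)⁻¹ : ℝ) : ℂ)‖ ≤ 1 := by
    rw [Complex.norm_real, Real.norm_eq_abs, abs_of_pos hηpos]; linarith
  have hr1 : ‖(((a : ℝ) / (2 : ℝ) ^ h : ℝ) : ℂ)‖ ≤ 1 := by
    rw [Complex.norm_real, Real.norm_eq_abs, abs_of_pos hs_pos]; exact hs_le
  have hpt : ((((a : ℕ) : ℤ) : ℂ) / ((((2 : ℤ) ^ h : ℤ)) : ℂ)) = (((a : ℝ) / (2 : ℝ) ^ h : ℝ) : ℂ) := by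
    push_cast; ring
  have hdist : ‖((∑' m : ℕ, ((2 : ℝ) ^ 2 ^ 4 ^ m)⁻¹ : ℝ) : ℂ) - (((a : ℝ) / (2 : ℝ) ^ h : ℝ) : ℂ)‖ ≤
      2 * ((2 : ℝ) ^ h ^ 4)⁻¹ := by
    rw [← Complex.ofReal_sub, Complex.norm_real, Real.norm_eq_abs, abs_of_pos htail0]
    exact htail
  obtain ⟨t, ht0, hker, hnorm⟩ := hD₀ D hD₀D ((a : ℕ) : ℤ) ((2 : ℤ) ^ h)
  -- the height: `‖t‖ ≤ exp(D²)`
  have hR : max 1 (max |(((a : ℕ) : ℤ) : ℝ)| |((((2 : ℤ) ^ h : ℤ)) : ℝ)|) = (2 : ℝ) ^ h := by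
    have h2h : (1 : ℝ) ≤ (2 : ℝ) ^ h := one_le_pow₀ (by norm_num)
    rw [max_eq_right, max_eq_right]
    · push_cast; rw [abs_of_nonneg (by positivity)]
    · push_cast; rw [abs_of_nonneg (by positivity), abs_of_nonneg (by positivity)]; exact ha_le
    · refine le_max_of_le_right ?_
      push_cast; rw [abs_of_nonneg (by positivity)]; exact h2h
  have hl2 : Real.log 2 < 7 / 10 := by have := Real.log_two_lt_d9; linarith
  have hlogR : Real.log ((2 : ℝ) ^ h) = h * Real.log 2 := by rw [Real.log_pow]
  have h17 : 17 * (h : ℝ) ≤ (D : ℝ) ^ ((3 : ℝ) / 2) := by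
    have := Real.rpow_le_rpow hW0 hWD (show (0 : ℝ) ≤ 3 / 2 by norm_num)
    rwa [hW, ← Real.rpow_mul (by positivity), show (2 : ℝ) / 3 * (3 / 2) = 1 by norm_num,
      Real.rpow_one] at this
  have hD2 : ((D : ℝ) ^ (2 : ℝ)) = (D : ℝ) ^ 2 := Real.rpow_two _
  have hsq : (D : ℝ) ^ ((1 : ℝ) / 2) * (D : ℝ) ^ ((3 : ℝ) / 2) = (D : ℝ) ^ 2 := by
    rw [← Real.rpow_add hy0, ← hD2]; norm_num
  have h74 : 2 * (D : ℝ) ^ ((7 : ℝ) / 4) ≤ (D : ℝ) ^ 2 := by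
    have hq := two_le_rpow_quarter hy16
    have h0 : 0 ≤ (D : ℝ) ^ ((7 : ℝ) / 4) := Real.rpow_nonneg hy0.le _
    calc 2 * (D : ℝ) ^ ((7 : ℝ) / 4) ≤ (D : ℝ) ^ ((1 : ℝ) / 4) * (D : ℝ) ^ ((7 : ℝ) / 4) :=
          mul_le_mul_of_nonneg_right hq h0
      _ = (D : ℝ) ^ 2 := by rw [← Real.rpow_add hy0, ← hD2]; norm_num
  have htt : ‖t‖ ≤ Real.exp ((D : ℝ) ^ 2) := by
    refine hnorm.trans (Real.exp_le_exp.2 ?_)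
    rw [hR, hlogR]
    have hx12 : 0 ≤ (D : ℝ) ^ ((1 : ℝ) / 2) := Real.rpow_nonneg hy0.le _
    have hkey : 12 * (D : ℝ) ^ ((1 : ℝ) / 2) * ((h : ℝ) * Real.log 2) ≤ (D : ℝ) ^ 2 / 2 := by
      calc 12 * (D : ℝ) ^ ((1 : ℝ) / 2) * ((h : ℝ) * Real.log 2)
          ≤ 12 * (D : ℝ) ^ ((1 : ℝ) / 2) * ((h : ℝ) * (7 / 10)) := by gcongr
        _ = (84 / 170) * ((D : ℝ) ^ ((1 : ℝ) / 2) * (17 * (h : ℝ))) := by ring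
        _ ≤ (84 / 170) * ((D : ℝ) ^ ((1 : ℝ) / 2) * (D : ℝ) ^ ((3 : ℝ) / 2)) := by gcongr
        _ = (84 / 170) * (D : ℝ) ^ 2 := by rw [hsq]
        _ ≤ (D : ℝ) ^ 2 / 2 := by nlinarith [sq_nonneg (D : ℝ)]
    linarith
  -- the polynomial (no rescaling)
  refine ⟨polyOfCoeffs t, polyOfCoeffs_ne_zero ht0, ?_, ?_, ?_⟩
  · exact (totalDegree_polyOfCoeffs_le _).trans (by omega)
  · rw [hD2]; exact (mvPolyHeight_polyOfCoeffs_le _).trans htt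
  · intro i hi
    have hnum := hh₀ h (by omega) (D : ℝ) hy1 hDtop
    have hzero : aeval ![(0 : ℂ), ((((a : ℕ) : ℤ) : ℂ) / ((((2 : ℤ) ^ h : ℤ)) : ℂ))]
        (royD^[i] (polyOfCoeffs t)) = 0 :=
      aeval_zero_rat_eq_zero_of_kernel t _ _ hq0 i (hker i hi)
    rw [hpt] at hzero
    have key := norm_aeval_zero_sub_le t i hy1' hr1
    rw [hzero, sub_zero] at key
    refine key.trans ?_
    have hKle : D / 2 ≤ D := Nat.div_le_self _ _
    have hKr' : ((D / 2 : ℕ) : ℝ) ≤ D := by exact_mod_cast hKle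
    -- the count and the factorial
    set L : ℕ := 3 * ⌊(D : ℝ) ^ ((3 : ℝ) / 2)⌋₊ with hL
    have hL1 : 1 ≤ L := by
      have : 1 ≤ ⌊(D : ℝ) ^ ((3 : ℝ) / 2)⌋₊ := Nat.le_floor (by
        have : (1 : ℝ) ≤ (D : ℝ) ^ ((3 : ℝ) / 2) := Real.one_le_rpow hy1 (by norm_num)
        simpa using this)
      omega
    have hL0 : (0 : ℝ) < L := by exact_mod_cast hL1
    have hfac : (i.factorial : ℝ) ≤ (L : ℝ) ^ L := by
      have h1 : i.factorial ≤ i ^ i := Nat.factorial_le_pow i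
      have h2 : i ^ i ≤ L ^ i := Nat.pow_le_pow_left hi.le i
      have h3 : L ^ i ≤ L ^ L := Nat.pow_le_pow_right hL1 hi.le
      exact_mod_cast h1.trans (h2.trans h3)
    have hK0' : (0 : ℝ) ≤ ((D / 2 : ℕ) : ℝ) := Nat.cast_nonneg _
    have hcard : ((((D / 2 + 1) * (D / 2 + 1)) : ℕ) : ℝ) ≤ ((D : ℝ) + 1) ^ 2 := by
      push_cast; nlinarith [hKr', hy0, hK0']
    -- every factor as an exponential
    have hf1 : ((D : ℝ) + 1) ^ 2 ≤ Real.exp (2 * D) := by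
      have h1 : (D : ℝ) + 1 ≤ Real.exp D := by have := Real.add_one_le_exp (D : ℝ); linarith
      calc ((D : ℝ) + 1) ^ 2 ≤ (Real.exp D) ^ 2 := pow_le_pow_left₀ (by linarith) h1 2
        _ = Real.exp (2 * D) := by rw [← Real.exp_nat_mul]; norm_num
    have hf3 : (L : ℝ) ^ L = Real.exp (L * Real.log L) := by
      rw [← Real.rpow_natCast, Real.rpow_def_of_pos hL0]; ring_nf
    have hf4 : (D : ℝ) = Real.exp (Real.log D) := (Real.exp_log hy0).symm
    have hf5 : (2 : ℝ) * ((2 : ℝ) ^ (h ^ 4))⁻¹ = Real.exp (Real.log 2 - (h : ℝ) ^ 4 * Real.log 2) := by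
      rw [Real.exp_sub, Real.exp_log (by norm_num), ← Real.rpow_natCast, Real.rpow_def_of_pos (by norm_num),
        div_eq_mul_inv]
      push_cast; ring_nf
    have hlogD : Real.log D ≤ D := by have := Real.log_le_sub_one_of_pos hy0; linarith
    have hLlogL := count_mul_log_le hy1
    rw [← hL] at hLlogL
    have hl2' : Real.log 2 ≤ 1 := by linarith
    have hexpo : 2 * (D : ℝ) + (D : ℝ) ^ 2 + L * Real.log L + D +
        (Real.log D + (Real.log 2 - (h : ℝ) ^ 4 * Real.log 2)) ≤ -(D : ℝ) ^ ν := by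
      rw [← hD2]
      linarith [hnum, hLlogL, hlogD, hl2']
    calc ((((D / 2 + 1) * (D / 2 + 1)) : ℕ) : ℝ) * ‖t‖ *
          ((i.factorial : ℝ) * Real.exp ((D / 2 : ℕ) : ℝ)) *
          (((D / 2 : ℕ) : ℝ) * ‖((∑' m : ℕ, ((2 : ℝ) ^ 2 ^ 4 ^ m)⁻¹ : ℝ) : ℂ) -
            (((a : ℝ) / (2 : ℝ) ^ h : ℝ) : ℂ)‖)
        ≤ ((D : ℝ) + 1) ^ 2 * Real.exp ((D : ℝ) ^ 2) * ((L : ℝ) ^ L * Real.exp D) *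
          ((D : ℝ) * (2 * ((2 : ℝ) ^ (h ^ 4))⁻¹)) := by
          gcongr
      _ ≤ Real.exp (2 * D) * Real.exp ((D : ℝ) ^ 2) * (Real.exp (L * Real.log L) * Real.exp D) *
          (Real.exp (Real.log D) * Real.exp (Real.log 2 - (h : ℝ) ^ 4 * Real.log 2)) := by
          rw [← hf3, ← hf4, ← hf5]
          gcongr
      _ = Real.exp (2 * (D : ℝ) + (D : ℝ) ^ 2 + L * Real.log L + D +
          (Real.log D + (Real.log 2 - (h : ℝ) ^ 4 * Real.log 2))) := by simp only [← Real.exp_add]; ring_nf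
      _ ≤ Real.exp (-(D : ℝ) ^ ν) := Real.exp_le_exp.2 hexpo

/-- **Windows up to exponent ratio `23/10` do not suffice**: `CruxOnWindows λ` is FALSE for
`0 ≤ λ < 23/10` (witness `(0, η∞)`, `τ = 3/2`, `β = 2`, `ν = 13/5` in the gap). [folklore] -/
theorem not_cruxOnWindows' {lam : ℝ} (hlam0 : 0 ≤ lam) (hlam : lam < 23 / 10) :
    ¬ CruxOnWindows lam := fun hC =>
  transcendental_eta (hC 0 _ (Complex.ofReal_ne_zero.2 eta_pos.ne') 2 (3 / 2) (13 / 5) (by norm_num)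
    (by norm_num) (by norm_num) (by norm_num)
    (frequently_window_hyp_at_eta' (ν := 13 / 5) (by norm_num) (by norm_num) hlam0 (by linarith)
      (by linarith))).2

/-- … and the windowed PRINTED theorem is false for `0 ≤ λ < 2` (`ν = 3`). [cite: Roy2013, Theorem 1.1] -/
theorem roy2013_thm_1_1_false_on_windows' {lam : ℝ} (hlam0 : 0 ≤ lam) (hlam : lam < 2) :
    ¬ (∀ (ξ η : ℂ), η ≠ 0 → ∀ (β τ ν : ℝ), 1 ≤ τ → τ < 2 → τ < β →
      2 + β - τ + (τ - 1) * (2 - τ) / (β + 1 - τ) < ν →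
      (∃ᶠ N : ℕ in atTop, ∀ D : ℕ, N ≤ D → (D : ℝ) ≤ (N : ℝ) ^ lam →
        ∃ P : MvPolynomial (Fin 2) ℤ, P ≠ 0 ∧ P.totalDegree ≤ D ∧
          (mvPolyHeight P : ℝ) ≤ Real.exp ((D : ℝ) ^ β) ∧
          ∀ i : ℕ, i < 3 * ⌊(D : ℝ) ^ τ⌋₊ →
            ‖aeval ![ξ, η] (royD^[i] P)‖ ≤ Real.exp (-(D : ℝ) ^ ν)) →
      IsAlgebraic ℚ ξ ∧ IsAlgebraic ℚ η) := fun hC =>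
  transcendental_eta (hC 0 _ (Complex.ofReal_ne_zero.2 eta_pos.ne') 2 (3 / 2) 3 (by norm_num)
    (by norm_num) (by norm_num) (by norm_num)
    (frequently_window_hyp_at_eta' (ν := 3) (by norm_num) (by norm_num) hlam0 (by linarith)
      (by linarith))).2


end Windows

end Summit.Schanuel.Schanuel.Cruxes.RoySmallValueDirichletGap.Disproof

end
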